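import Mathlib
import Summits.KontsevichZagierPeriods.KontsevichZagierPeriods.Theses.HyperbolicBloch
import Literature.NumberTheory.Transcendental.ZagierDilogarithmConjecture
import Literature.NumberTheory.Transcendental.BlochWignerDilogarithm
import Literature.NumberTheory.Transcendental.BlochWignerDilogarithmProofs
import Literature.NumberTheory.Transcendental.BlochWignerDilogarithmVolumeProofs
import Literature.NumberTheory.Transcendental.PreBlochGroup
import Literature.NumberTheory.Transcendental.PreBlochRelationCriterion
import Summits.KontsevichZagierPeriods.KontsevichZagierPeriods.Theorems.HyperbolicBlochZagierDilogarithmConjectureStubTwoSaturation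
import Summits.KontsevichZagierPeriods.KontsevichZagierPeriods.Theorems.HyperbolicBlochZagierDilogarithmConjectureStubKummerDescent
import Summits.KontsevichZagierPeriods.KontsevichZagierPeriods.Theorems.HyperbolicBlochZagierDilogarithmConjecturePositivitySector
import Summits.KontsevichZagierPeriods.KontsevichZagierPeriods.Theorems.HyperbolicBlochZagierDilogarithmConjectureClausenTransfer
import Summits.KontsevichZagierPeriods.KontsevichZagierPeriods.Theorems.ZagierDilogarithmConjecture.Negative.DehnInvariant
import Summits.KontsevichZagierPeriods.KontsevichZagierPeriods.Theorems.HyperbolicBlochZagierDilogarithmConjectureStubSaturation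
import Summits.KontsevichZagierPeriods.KontsevichZagierPeriods.Theorems.HyperbolicBlochZagierDilogarithmConjectureStubRegulatorParity
import Summits.KontsevichZagierPeriods.KontsevichZagierPeriods.Theorems.HyperbolicBlochZagierDilogarithmConjectureStubBorelSlice
import Summits.KontsevichZagierPeriods.KontsevichZagierPeriods.Theorems.HyperbolicBlochZagierDilogarithmConjectureStubImagQuadraticSlice
import Summits.KontsevichZagierPeriods.KontsevichZagierPeriods.Theorems.HyperbolicBlochZagierDilogarithmConjectureStubSubSector
import Summits.KontsevichZagierPeriods.KontsevichZagierPeriods.Theorems.HyperbolicBlochZagierDilogarithmConjectureGaloisRegulator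
import Summits.KontsevichZagierPeriods.KontsevichZagierPeriods.Theorems.HyperbolicBlochZagierDilogarithmConjectureNumberFieldDescent
import Summits.KontsevichZagierPeriods.KontsevichZagierPeriods.Theorems.HyperbolicBlochZagierDilogarithmConjectureOneComplexPlace
import Summits.KontsevichZagierPeriods.KontsevichZagierPeriods.Theorems.HyperbolicBlochTetraSector
import Summits.KontsevichZagierPeriods.KontsevichZagierPeriods.Theorems.HyperbolicBlochZagierDilogarithmConjectureStubGaloisDescent
import Summits.KontsevichZagierPeriods.KontsevichZagierPeriods.Theorems.HyperbolicBlochZagierDilogarithmConjectureStubSelfSimilar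
import Summits.KontsevichZagierPeriods.KontsevichZagierPeriods.Theorems.HyperbolicBlochZagierDilogarithmConjectureStubBiquadraticSymmetric
import Summits.KontsevichZagierPeriods.KontsevichZagierPeriods.Theorems.HyperbolicBlochZagierDilogarithmConjectureStubTwistMemClosure
import Summits.KontsevichZagierPeriods.KontsevichZagierPeriods.Theorems.HyperbolicBlochZagierDilogarithmConjectureStubGaloisSubSector
import Summits.KontsevichZagierPeriods.KontsevichZagierPeriods.Theorems.HyperbolicBlochZagierDilogarithmConjectureStubSignedPermutation
import Summits.KontsevichZagierPeriods.KontsevichZagierPeriods.Theorems.HyperbolicBlochZagierDilogarithmConjectureStubOnePlaceSigned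
import Summits.KontsevichZagierPeriods.KontsevichZagierPeriods.Theorems.HyperbolicBlochZagierDilogarithmConjectureStubCyclotomicPoints
import Summits.KontsevichZagierPeriods.KontsevichZagierPeriods.Theorems.HyperbolicBlochZagierDilogarithmConjectureStubMonomialSymmetric
import Summits.KontsevichZagierPeriods.KontsevichZagierPeriods.Theorems.HyperbolicBlochZagierDilogarithmConjectureStubCyclotomicSigned
import Summits.KontsevichZagierPeriods.KontsevichZagierPeriods.Theorems.HyperbolicBlochZagierDilogarithmConjectureStubBiquadraticSigned
import Summits.KontsevichZagierPeriods.KontsevichZagierPeriods.Theorems.HyperbolicBlochZagierDilogarithmConjectureStubDistributionSlice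
import Summits.KontsevichZagierPeriods.KontsevichZagierPeriods.Theorems.HyperbolicBlochZagierDilogarithmConjectureGaloisSlices
import Summits.KontsevichZagierPeriods.KontsevichZagierPeriods.Theorems.HyperbolicBlochZagierDilogarithmConjectureStubHeptagonalCertificate
import Summits.KontsevichZagierPeriods.KontsevichZagierPeriods.Theorems.HyperbolicBlochZagierDilogarithmConjectureStubHeptagonalDehnZero
import Summits.KontsevichZagierPeriods.KontsevichZagierPeriods.Theorems.HyperbolicBlochZagierDilogarithmConjectureStubHeptagonalRelation
import Literature.NumberTheory.Transcendental.BlochGroupRegulator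
import Literature.NumberTheory.Transcendental.SqrtSevenCertificate
import Summits.KontsevichZagierPeriods.KontsevichZagierPeriods.Theorems.HyperbolicBlochZagierDilogarithmConjectureStubHeptagonalVolume
import Summits.KontsevichZagierPeriods.KontsevichZagierPeriods.Theorems.HyperbolicBlochZagierDilogarithmConjectureStubExplainedToKZ
import Summits.KontsevichZagierPeriods.KontsevichZagierPeriods.Theorems.HyperbolicBlochZagierDilogarithmConjectureStubDupontOfBorelSuslin
import Summits.KontsevichZagierPeriods.KontsevichZagierPeriods.Theorems.HyperbolicBlochZagierDilogarithmConjectureStubHeptagonalMembership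
import Summits.KontsevichZagierPeriods.KontsevichZagierPeriods.Theorems.HyperbolicBlochZagierDilogarithmConjectureStubClausenCharSumPrimitive
import Summits.KontsevichZagierPeriods.KontsevichZagierPeriods.Theorems.HyperbolicBlochZagierDilogarithmConjectureStubClausenCharSumLevel
import Summits.KontsevichZagierPeriods.KontsevichZagierPeriods.Theorems.HyperbolicBlochZagierDilogarithmConjectureStubClausenCharSumNeZero
import Summits.KontsevichZagierPeriods.KontsevichZagierPeriods.Theorems.HyperbolicBlochZagierDilogarithmConjectureStubCyclotomicTwists
import Summits.KontsevichZagierPeriods.KontsevichZagierPeriods.Theorems.HyperbolicBlochZagierDilogarithmConjectureStubOddFourierInversion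
import Summits.KontsevichZagierPeriods.KontsevichZagierPeriods.Theorems.HyperbolicBlochZagierDilogarithmConjectureStubDistributionKZ
import Summits.KontsevichZagierPeriods.KontsevichZagierPeriods.Theorems.HyperbolicBlochZagierDilogarithmConjectureStubSexticSector
import Summits.KontsevichZagierPeriods.KontsevichZagierPeriods.Theorems.HyperbolicBlochZagierDilogarithmConjectureStubCyclotomicIndependence
import Summits.KontsevichZagierPeriods.KontsevichZagierPeriods.Theorems.HyperbolicBlochZagierDilogarithmConjectureStubCyclotomicPrimeSectorIff
import Summits.KontsevichZagierPeriods.KontsevichZagierPeriods.Theorems.HyperbolicBlochZagierDilogarithmConjectureStubSexticKZ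
import Summits.KontsevichZagierPeriods.KontsevichZagierPeriods.Theorems.HyperbolicBlochZagierDilogarithmConjectureStubMilnorRationalForm
import Summits.KontsevichZagierPeriods.KontsevichZagierPeriods.Theorems.HyperbolicBlochZagierDilogarithmConjectureStubClausenLobachevsky
import Summits.KontsevichZagierPeriods.KontsevichZagierPeriods.Theorems.HyperbolicBlochZagierDilogarithmConjectureStubQuarticSector
import Literature.NumberTheory.LFunctions.DirichletLValueBernoulli
import Summits.KontsevichZagierPeriods.KontsevichZagierPeriods.Theorems.HyperbolicBlochZagierDilogarithmConjectureStubCyclotomicSpanning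
import Summits.KontsevichZagierPeriods.KontsevichZagierPeriods.Theorems.HyperbolicBlochZagierDilogarithmConjectureStubEqZeroOfTwists
import Summits.KontsevichZagierPeriods.KontsevichZagierPeriods.Theorems.HyperbolicBlochZagierDilogarithmConjectureStubCyclotomicFolding
import Summits.KontsevichZagierPeriods.KontsevichZagierPeriods.Theorems.HyperbolicBlochZagierDilogarithmConjectureStubCyclotomicTorsionDescent
import Summits.KontsevichZagierPeriods.KontsevichZagierPeriods.Theorems.HyperbolicBlochZagierDilogarithmConjectureStubCyclotomicSectorTorsionIff
import Summits.KontsevichZagierPeriods.KontsevichZagierPeriods.Theorems.HyperbolicBlochZagierDilogarithmConjectureStubAllRootsOfUnityIff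
import Summits.KontsevichZagierPeriods.KontsevichZagierPeriods.Theorems.HyperbolicBlochZagierDilogarithmConjectureStubAbelianSectorIff
import Summits.KontsevichZagierPeriods.KontsevichZagierPeriods.Theorems.HyperbolicBlochZagierDilogarithmConjectureStubCyclotomicSectorIffMilnor
import Summits.KontsevichZagierPeriods.KontsevichZagierPeriods.Theorems.HyperbolicBlochZagierDilogarithmConjectureStubCyclotomicDescentIff
import Summits.KontsevichZagierPeriods.KontsevichZagierPeriods.Theorems.HyperbolicBlochZagierDilogarithmConjectureStubAllRootsOfUnityIffMilnor
import Summits.KontsevichZagierPeriods.KontsevichZagierPeriods.Theorems.HyperbolicBlochZagierDilogarithmConjectureStubCyclotomicSectorExactIffMilnor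
import Summits.KontsevichZagierPeriods.KontsevichZagierPeriods.Theorems.HyperbolicBlochZagierDilogarithmConjectureStubMilnorFiveIffIrrational
import Summits.KontsevichZagierPeriods.KontsevichZagierPeriods.Theorems.HyperbolicBlochZagierDilogarithmConjectureStubAbelianPropagation
import Summits.KontsevichZagierPeriods.KontsevichZagierPeriods.Theorems.HyperbolicBlochZagierDilogarithmConjectureStubAbelianSectorIffMilnor
import Summits.KontsevichZagierPeriods.KontsevichZagierPeriods.Theorems.HyperbolicBlochZagierDilogarithmConjectureStubAbelianKZOfMilnor
import Summits.KontsevichZagierPeriods.KontsevichZagierPeriods.Theorems.HyperbolicBlochZagierDilogarithmConjectureStubAbelianSectorTorsionOfMilnor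
import Summits.KontsevichZagierPeriods.KontsevichZagierPeriods.Theorems.HyperbolicBlochZagierDilogarithmConjectureStubMilnorTwelveIffIrrational
import Summits.KontsevichZagierPeriods.KontsevichZagierPeriods.Theorems.HyperbolicBlochZagierDilogarithmConjectureStubMilnorEightIffIrrational
import Summits.KontsevichZagierPeriods.KontsevichZagierPeriods.Theorems.HyperbolicBlochZagierDilogarithmConjectureOctCertOne
import Summits.KontsevichZagierPeriods.KontsevichZagierPeriods.Theorems.HyperbolicBlochZagierDilogarithmConjectureOctCertTwo
import Summits.KontsevichZagierPeriods.KontsevichZagierPeriods.Theorems.HyperbolicBlochZagierDilogarithmConjectureOctCertThree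
import Summits.KontsevichZagierPeriods.KontsevichZagierPeriods.Theorems.HyperbolicBlochZagierDilogarithmConjectureOctCertFour
import Summits.KontsevichZagierPeriods.KontsevichZagierPeriods.Theorems.HyperbolicBlochZagierDilogarithmConjectureOctCertIdentity
import Summits.KontsevichZagierPeriods.KontsevichZagierPeriods.Theorems.HyperbolicBlochZagierDilogarithmConjectureStubMilnorAntitone
import Summits.KontsevichZagierPeriods.KontsevichZagierPeriods.Theorems.HyperbolicBlochZagierDilogarithmConjectureStubCruxIrrational
import Summits.KontsevichZagierPeriods.KontsevichZagierPeriods.Theorems.HyperbolicBlochZagierDilogarithmConjectureGaussCertificate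
import Summits.KontsevichZagierPeriods.KontsevichZagierPeriods.Theorems.HyperbolicBlochZagierDilogarithmConjectureStubGaussianMembership
import Summits.KontsevichZagierPeriods.KontsevichZagierPeriods.Theorems.HyperbolicBlochZagierDilogarithmConjectureGaussSectorInstancesOne
import Summits.KontsevichZagierPeriods.KontsevichZagierPeriods.Theorems.HyperbolicBlochZagierDilogarithmConjectureGaussSectorInstancesTwo
import Summits.KontsevichZagierPeriods.KontsevichZagierPeriods.Theorems.HyperbolicBlochZagierDilogarithmConjectureGaussSectorPoints
import Summits.KontsevichZagierPeriods.KontsevichZagierPeriods.Theorems.HyperbolicBlochZagierDilogarithmConjectureGaussSectorChars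
import Summits.KontsevichZagierPeriods.KontsevichZagierPeriods.Theorems.HyperbolicBlochZagierDilogarithmConjectureGaussSectorDehn
import Summits.KontsevichZagierPeriods.KontsevichZagierPeriods.Theorems.HyperbolicBlochZagierDilogarithmConjectureGaussSectorIdentitiesOne
import Summits.KontsevichZagierPeriods.KontsevichZagierPeriods.Theorems.HyperbolicBlochZagierDilogarithmConjectureGaussSectorIdentitiesTwo
import Summits.KontsevichZagierPeriods.KontsevichZagierPeriods.Theorems.HyperbolicBlochZagierDilogarithmConjectureStubOctagonalMembership
import Summits.KontsevichZagierPeriods.KontsevichZagierPeriods.Theorems.HyperbolicBlochZagierDilogarithmConjectureGaussSectorAnharmonic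
import Summits.KontsevichZagierPeriods.KontsevichZagierPeriods.Theorems.HyperbolicBlochZagierDilogarithmConjectureGaussSectorTargetsOne
import Summits.KontsevichZagierPeriods.KontsevichZagierPeriods.Theorems.HyperbolicBlochZagierDilogarithmConjectureGaussSectorTargetsTwo
import Summits.KontsevichZagierPeriods.KontsevichZagierPeriods.Theorems.HyperbolicBlochZagierDilogarithmConjectureGaussSectorTargetsThree
import Summits.KontsevichZagierPeriods.KontsevichZagierPeriods.Theorems.HyperbolicBlochZagierDilogarithmConjectureGaussSectorFoldOne
import Summits.KontsevichZagierPeriods.KontsevichZagierPeriods.Theorems.HyperbolicBlochZagierDilogarithmConjectureGaussSectorFoldTwo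
import Summits.KontsevichZagierPeriods.KontsevichZagierPeriods.Theorems.HyperbolicBlochZagierDilogarithmConjectureGaussSectorFoldThree
import Summits.KontsevichZagierPeriods.KontsevichZagierPeriods.Theorems.HyperbolicBlochZagierDilogarithmConjectureGaussSectorHeadline

/-!
# Line `kummer-clausen-linearisation` — skeleton for the crux `ZagierDilogarithmConjecture`
# (stmt-KontsevichZagierPeriods-10550, route HyperbolicBloch); leads c0–c5

The crux is Zagier's dilogarithm conjecture (`crux_iff` ↔ `Literature…ZagierDilogarithmRelationsConjecture`, an OPEN problem). History of
the line (all p-ids in the per-stub `-- CLOSED:` comments and in `Lines/kummer_clausen_linearisation.md`): c0 Kummer–Clausen transfer and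
2-saturation; c1 Borel / imaginary-quadratic / sub-sector slices; c2 Galois descent (mod Dupont 2001 Thm 10.24 a), signed/symmetric/cyclotomic/
biquadratic/distribution slices; c3 certificate #1 (heptagonal relation over ℚ(√−7), unconditional) + volume/KZ consequences; c4 the cyclotomic
sector exactly (Clausen character sums; primitive roots of unity unconditional; crux ⇒ Milnor_N); c5 the cyclotomic tower and the abelian sector
(⇔ Milnor_N), certificate #2 (octagonal, ℚ(ζ₈)), certificate #3 (Gaussian circle relation), corollaries, and the Gaussian exceptional-unit
sector (unconditional). Residual: `stub_symbolPart ∧ stub_galoisPropagation` (mod Dupont) = the conjecture itself; named facts `stub_dupontFact`,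
`stub_borelRankFact`. The composition `ZagierDilogarithmConjecture_of` concludes the crux BY NAME from the stubs. -/

noncomputable section

open scoped BigOperators ComplexConjugate
open Literature.NumberTheory.Transcendental
open Summit.KontsevichZagierPeriods.HyperbolicBloch.ZagierDilogarithmConjectureNegative (dehn)
open Summit.KontsevichZagierPeriods.HyperbolicBloch

set_option linter.dupNamespace false -- crux work-file namespace repeats the summit name

namespace Summit.KontsevichZagierPeriods.KontsevichZagierPeriods.Cruxes.ZagierDilogarithmConjecture.KummerClausen

/-- The route decl is verbatim the inline form of the named open conjecture. [folklore] -/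
theorem crux_iff :
    Theses.HyperbolicBloch.ZagierDilogarithmConjecture ↔ ZagierDilogarithmRelationsConjecture := by
  constructor
  · intro h
    exact ZagierDilogarithmRelationsConjecture.of_inline idealTetrahedron (fun z => rfl)
      (h idealTetrahedron (fun z => rfl))
  · intro h T hT
    exact h.inline T hT

/-! ## Registered stubs -/

/-- **Stub (NAMED FACT, not a prover target): Dupont 2001 Thm. 10.24 a) (Borel + Suslin).** A
`ℤ`-combination of symbols of `ℚ̄` with zero Dehn invariant and zero Galois-twisted volumes is a consequence
of the five-term relations. Discharged only by the Literature fact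
`Dupont2001_preBloch_relation_of_invariants` (p97428); the slices are CONDITIONAL on it. -/
theorem stub_dupontFact : Dupont2001_preBloch_relation_of_invariants := by
  sorry

/-- **Stub (OPEN, conjecture-grade): the symbol part.** A relation `Σ nᵢ D(zᵢ) = 0` whose formal
combination has a NON-ZERO Dehn invariant `dehn u v β` would have to be explained — but `dehn` kills
`⟨dilogRelators⟩` (`dehn_eq_zero_of_mem_closure`), so this stub says exactly: non-zero Dehn invariant ⇒
`Σ nᵢ D(zᵢ) ≠ 0` (e.g. `a·D((3+4i)/5) ≠ b·G`, Disproof §7). Wide open; no reduction removes it. -/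
theorem stub_symbolPart :
    ∀ (k : ℕ) (z : Fin k → ℂ) (n : Fin k → ℤ), (∀ i, IsAlgebraic ℚ (z i)) → (∀ i, 0 < (z i).im) →
      (∃ u v : Additive ℂˣ →+ ℚ, dehn u v (∑ i, n i • FreeAbelianGroup.of (z i)) ≠ 0) →
      ∑ i, (n i : ℝ) * blochWignerDilog (z i) = 0 →
        (∑ i, n i • FreeAbelianGroup.of (z i)) ∈ AddSubgroup.closure dilogRelators := by
  sorry

/-- **Stub (OPEN, conjecture-grade): Galois propagation** — one place versus all places. For a Dehn-zero
relation `Σ nᵢ D(zᵢ) = 0` among algebraic points of `ℍ⁺`, the Galois-twisted odd volumes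
`Σ nᵢ (D(σ zᵢ) − D(σ z̄ᵢ))` vanish for EVERY `ℚ`-embedding `σ : ℚ̄ → ℂ` (lifts `wᵢ, w'ᵢ ∈ ℚ̄` of `zᵢ, z̄ᵢ`).
Implied by the crux (`crux_iff_residual`); contains Milnor's conjecture; replaces `stub_blochHigherRank`. -/
theorem stub_galoisPropagation :
    ∀ (k : ℕ) (z : Fin k → ℂ) (n : Fin k → ℤ), (∀ i, IsAlgebraic ℚ (z i)) → (∀ i, 0 < (z i).im) →
      (∀ u v : Additive ℂˣ →+ ℚ, dehn u v (∑ i, n i • FreeAbelianGroup.of (z i)) = 0) →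
      ∑ i, (n i : ℝ) * blochWignerDilog (z i) = 0 →
        ∀ (σ : ↥(algebraicClosure ℚ ℂ) →ₐ[ℚ] ℂ) (w w' : Fin k → ↥(algebraicClosure ℚ ℂ)),
          (∀ i, (w i : ℂ) = z i) → (∀ i, (w' i : ℂ) = conj (z i)) →
          ∑ i, (n i : ℝ) * (blochWignerDilog (σ (w i)) - blochWignerDilog (σ (w' i))) = 0 := by
  sorry

/-- **Stub (CLOSED p122345 — the lead's; mod Dupont): Galois descent.** If every Dehn invariant of `β = Σ nᵢ[zᵢ]`
(algebraic `zᵢ ∈ ℍ⁺`) vanishes and the Galois-twisted odd volumes `Σ nᵢ (D(σ zᵢ) − D(σ z̄ᵢ))` vanish for every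
`ℚ`-embedding `σ : ℚ̄ → ℂ`, then `β ∈ ⟨dilogRelators⟩` — GIVEN Dupont 2001 Thm. 10.24 a). Proof: the doubled
configuration `ξ = Σ nᵢ([zᵢ] − [z̄ᵢ]) ∈ ℤ⟨ℚ̄ ∖ {0,1}⟩` has zero Bloch symbol against all characters of `ℚ̄ˣ`
(extend to `ℂˣ`, `ℚ` injective: this is `dehn = 0`) and zero volume at every embedding (the hypothesis, each
ring embedding of `ℚ̄` being a `ℚ`-algebra map), so Dupont puts `ξ` in the five-term span of `ℚ̄`, which maps
into `⟨dilogRelators⟩`; add the conjugation relators and halve (`stub_twoSaturation`). -/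
theorem stub_galoisDescent :
    Dupont2001_preBloch_relation_of_invariants →
    ∀ (k : ℕ) (z : Fin k → ℂ) (n : Fin k → ℤ), (∀ i, IsAlgebraic ℚ (z i)) → (∀ i, 0 < (z i).im) →
      (∀ u v : Additive ℂˣ →+ ℚ, dehn u v (∑ i, n i • FreeAbelianGroup.of (z i)) = 0) →
      (∀ (σ : ↥(algebraicClosure ℚ ℂ) →ₐ[ℚ] ℂ) (w w' : Fin k → ↥(algebraicClosure ℚ ℂ)),
          (∀ i, (w i : ℂ) = z i) → (∀ i, (w' i : ℂ) = conj (z i)) →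
          ∑ i, (n i : ℝ) * (blochWignerDilog (σ (w i)) - blochWignerDilog (σ (w' i))) = 0) →
        (∑ i, n i • FreeAbelianGroup.of (z i)) ∈ AddSubgroup.closure dilogRelators :=
  -- CLOSED: Theorems/HyperbolicBlochZagierDilogarithmConjectureStubGaloisDescent.lean (p122345, lead c2)
  Summit.KontsevichZagierPeriods.HyperbolicBloch.ZagierDilogarithmGaloisDescent.stub_galoisDescent

/-- **Stub (CLOSED p121708): self-similar combinations propagate.** If for every `ℚ`-embedding
`σ : ℚ̄ → ℂ` there are integers `a ≠ 0`, `b` with `a·σ_*ξ − b·ξ ∈ ⟨dilogRelators⟩`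
(`ξ = Σ nᵢ([zᵢ] − [z̄ᵢ])`, `σ_*ξ = Σ nᵢ([σwᵢ] − [σw'ᵢ])`), then `Σ nᵢ D(zᵢ) = 0` propagates to every `σ`:
apply the value map `[w] ↦ D(w)`, which kills the relators, and use `D(z̄) = −D(z)`. -/
theorem stub_selfSimilar :
    ∀ (k : ℕ) (z : Fin k → ℂ) (n : Fin k → ℤ),
      (∀ (σ : ↥(algebraicClosure ℚ ℂ) →ₐ[ℚ] ℂ) (w w' : Fin k → ↥(algebraicClosure ℚ ℂ)),
          (∀ i, (w i : ℂ) = z i) → (∀ i, (w' i : ℂ) = conj (z i)) →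
          ∃ a b : ℤ, a ≠ 0 ∧
            a • (∑ i, n i • (FreeAbelianGroup.of (σ (w i)) - FreeAbelianGroup.of (σ (w' i)))) -
              b • (∑ i, n i • (FreeAbelianGroup.of (z i) - FreeAbelianGroup.of (conj (z i)))) ∈
                AddSubgroup.closure dilogRelators) →
      ∑ i, (n i : ℝ) * blochWignerDilog (z i) = 0 →
        ∀ (σ : ↥(algebraicClosure ℚ ℂ) →ₐ[ℚ] ℂ) (w w' : Fin k → ↥(algebraicClosure ℚ ℂ)),
          (∀ i, (w i : ℂ) = z i) → (∀ i, (w' i : ℂ) = conj (z i)) →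
          ∑ i, (n i : ℝ) * (blochWignerDilog (σ (w i)) - blochWignerDilog (σ (w' i))) = 0 :=
  -- CLOSED: Theorems/HyperbolicBlochZagierDilogarithmConjectureStubSelfSimilar.lean (p121708)
  Summit.KontsevichZagierPeriods.HyperbolicBloch.ZagierDilogarithmGaloisDescent.stub_selfSimilar

/-- **Stub (CLOSED p122041, `r₂ = 2`): `τ`-symmetric combinations over `ℚ(√e, √−d)` are
self-similar.** Points `zᵢ = aᵢ + bᵢ√e + (cᵢ + fᵢ√e)·√d·i` (`aᵢ, bᵢ, cᵢ, fᵢ ∈ ℚ`, `d, e ∈ ℕ`); the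
combination `Σ nᵢ[zᵢ]` is symmetric under `τ : √e ↦ −√e` through a permutation `π` of the indices
(`n ∘ π = n`, `(a, b, c, f) ∘ π = (a, −b, c, −f)`). Then for every `ℚ`-embedding `σ : ℚ̄ → ℂ`
(`σ(√e) = ±√e`, `σ(√d·i) = ±√d·i`) one has `σ_*ξ = ξ` (signs `++`, `−+`, reindexing by `π`) or `σ_*ξ = −ξ`
(signs `+−`, `−−`), so `σ_*ξ ∓ ξ = 0 ∈ ⟨dilogRelators⟩`. -/
theorem stub_biquadraticSymmetric :
    ∀ (d e : ℕ) (k : ℕ) (z : Fin k → ℂ) (n : Fin k → ℤ) (a b c f : Fin k → ℚ) (π : Equiv.Perm (Fin k)),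
      (∀ i, z i = a i + b i * (Real.sqrt e : ℂ) +
        (c i + f i * (Real.sqrt e : ℂ)) * ((Real.sqrt d : ℂ) * Complex.I)) →
      (∀ i, n (π i) = n i ∧ a (π i) = a i ∧ b (π i) = -b i ∧ c (π i) = c i ∧ f (π i) = -f i) →
        ∀ (σ : ↥(algebraicClosure ℚ ℂ) →ₐ[ℚ] ℂ) (w w' : Fin k → ↥(algebraicClosure ℚ ℂ)),
          (∀ i, (w i : ℂ) = z i) → (∀ i, (w' i : ℂ) = conj (z i)) →
          ∃ A B : ℤ, A ≠ 0 ∧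
            A • (∑ i, n i • (FreeAbelianGroup.of (σ (w i)) - FreeAbelianGroup.of (σ (w' i)))) -
              B • (∑ i, n i • (FreeAbelianGroup.of (z i) - FreeAbelianGroup.of (conj (z i)))) ∈
                AddSubgroup.closure dilogRelators :=
  -- CLOSED: Theorems/HyperbolicBlochZagierDilogarithmConjectureStubBiquadraticSymmetric.lean (p122041)
  Summit.KontsevichZagierPeriods.HyperbolicBloch.ZagierDilogarithmGaloisDescent.stub_biquadraticSymmetric

/-- **Stub (CLOSED p122307; EXACTNESS of the reshape): explained combinations stay explained under
every Galois twist.** If `β = Σ nᵢ[zᵢ] ∈ ⟨dilogRelators⟩` then `σ_*ξ = Σ nᵢ([σwᵢ] − [σw'ᵢ]) ∈ ⟨dilogRelators⟩`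
for every `ℚ`-embedding `σ : ℚ̄ → ℂ` and lifts `wᵢ, w'ᵢ ∈ ℚ̄` of `zᵢ, z̄ᵢ`: the additive map
`[x] ↦ [σx] − [σx̄]` (algebraic `x`; `0` otherwise) sends a five-term relator over `ℚ̄` to the difference of
the five-term relators at `(σx, σy)` and `(σx̄, σȳ)`, kills `[w] + [w̄]`, and kills real `[w]` (`w̄ = w`).
Hence self-similarity is necessary for being explained. -/
theorem stub_twist_mem_closure :
    ∀ (k : ℕ) (z : Fin k → ℂ) (n : Fin k → ℤ),
      (∑ i, n i • FreeAbelianGroup.of (z i)) ∈ AddSubgroup.closure dilogRelators →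
        ∀ (σ : ↥(algebraicClosure ℚ ℂ) →ₐ[ℚ] ℂ) (w w' : Fin k → ↥(algebraicClosure ℚ ℂ)),
          (∀ i, (w i : ℂ) = z i) → (∀ i, (w' i : ℂ) = conj (z i)) →
          (∑ i, n i • (FreeAbelianGroup.of (σ (w i)) - FreeAbelianGroup.of (σ (w' i)))) ∈
            AddSubgroup.closure dilogRelators :=
  -- CLOSED: Theorems/HyperbolicBlochZagierDilogarithmConjectureStubTwistMemClosure.lean (p122307)
  Summit.KontsevichZagierPeriods.HyperbolicBloch.ZagierDilogarithmGaloisDescent.stub_twist_mem_closure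

/-- **Stub (CLOSED p124370): signed-permutation symmetry ⇒ self-similarity.** The general
combinatorial certificate. Suppose that for every `ℚ`-embedding `σ : ℚ̄ → ℂ` EACH of the two families
`(σwᵢ)ᵢ` and `(σw'ᵢ)ᵢ` (lifts of `zᵢ`, `z̄ᵢ`) is either entirely real, or a coefficient-preserving permutation
of `(zᵢ)ᵢ`, or a coefficient-preserving permutation of `(z̄ᵢ)ᵢ`. Then `β = Σ nᵢ[zᵢ]` is self-similar: writing
`S₁ = Σ nᵢ[σwᵢ] ≡ e₁β`, `S₂ = Σ nᵢ[σw'ᵢ] ≡ e₂β` (`eⱼ ∈ {0, 1, −1}`, congruences mod `⟨dilogRelators⟩`, using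
the real relators, reindexing, and `β̄ ≡ −β` from the conjugation relators) and `ξ ≡ 2β`, one gets
`2·σ_*ξ − (e₁ − e₂)·ξ ∈ ⟨dilogRelators⟩`. Instances: one complex place (`stub_onePlaceSigned`), `τ`-symmetric
biquadratic combinations (`stub_biquadraticSymmetric`), cyclotomic orbit-symmetric combinations
(`stub_cyclotomicPoints`). -/
theorem stub_signedPermutation :
    ∀ (k : ℕ) (z : Fin k → ℂ) (n : Fin k → ℤ),
      (∀ (σ : ↥(algebraicClosure ℚ ℂ) →ₐ[ℚ] ℂ) (w w' : Fin k → ↥(algebraicClosure ℚ ℂ)),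
          (∀ i, (w i : ℂ) = z i) → (∀ i, (w' i : ℂ) = conj (z i)) →
          ((∀ i, (σ (w i)).im = 0) ∨
            (∃ π : Equiv.Perm (Fin k), (∀ i, n (π i) = n i) ∧ ∀ i, σ (w i) = z (π i)) ∨
            (∃ π : Equiv.Perm (Fin k), (∀ i, n (π i) = n i) ∧ ∀ i, σ (w i) = conj (z (π i)))) ∧
          ((∀ i, (σ (w' i)).im = 0) ∨
            (∃ π : Equiv.Perm (Fin k), (∀ i, n (π i) = n i) ∧ ∀ i, σ (w' i) = z (π i)) ∨
            (∃ π : Equiv.Perm (Fin k), (∀ i, n (π i) = n i) ∧ ∀ i, σ (w' i) = conj (z (π i))))) →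
        ∀ (σ : ↥(algebraicClosure ℚ ℂ) →ₐ[ℚ] ℂ) (w w' : Fin k → ↥(algebraicClosure ℚ ℂ)),
          (∀ i, (w i : ℂ) = z i) → (∀ i, (w' i : ℂ) = conj (z i)) →
          ∃ a b : ℤ, a ≠ 0 ∧
            a • (∑ i, n i • (FreeAbelianGroup.of (σ (w i)) - FreeAbelianGroup.of (σ (w' i)))) -
              b • (∑ i, n i • (FreeAbelianGroup.of (z i) - FreeAbelianGroup.of (conj (z i)))) ∈
                AddSubgroup.closure dilogRelators :=
  -- CLOSED: Theorems/HyperbolicBlochZagierDilogarithmConjectureStubSignedPermutation.lean (p124370)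
  Summit.KontsevichZagierPeriods.HyperbolicBloch.ZagierDilogarithmGaloisDescent.stub_signedPermutation

/-- **Stub (CLOSED p124372): one complex place ⇒ signed-permutation symmetry.** If the `zᵢ` lie in a
number field `K ⊂ ℂ` every embedding of which is the inclusion, its conjugate, or real (c1's Borel-slice
hypothesis; `K` need not be conjugation-closed), then for every `σ : ℚ̄ → ℂ` the family `(σwᵢ)` is `(zᵢ)`,
`(z̄ᵢ)` or real (restrict `σ` to `K ≤ ℚ̄`), and so is `(σw'ᵢ)` (restrict `σ ∘ c`, `c` = complex conjugation on
`ℚ̄`, `exists_conj_ringHom`) — with the identity permutation. So c1's `stub_borelSlice` is an instance of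
`stub_galoisDescent ∘ stub_selfSimilar ∘ stub_signedPermutation`. -/
theorem stub_onePlaceSigned :
    ∀ (k : ℕ) (z : Fin k → ℂ) (n : Fin k → ℤ),
      (∃ K : IntermediateField ℚ ℂ, FiniteDimensional ℚ K ∧ (∀ i, z i ∈ K) ∧
          ∀ σ : K →+* ℂ, (∀ x : K, σ x = (x : ℂ)) ∨ (∀ x : K, σ x = (starRingEnd ℂ) (x : ℂ)) ∨
            (∀ x : K, (σ x).im = 0)) →
        ∀ (σ : ↥(algebraicClosure ℚ ℂ) →ₐ[ℚ] ℂ) (w w' : Fin k → ↥(algebraicClosure ℚ ℂ)),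
          (∀ i, (w i : ℂ) = z i) → (∀ i, (w' i : ℂ) = conj (z i)) →
          ((∀ i, (σ (w i)).im = 0) ∨
            (∃ π : Equiv.Perm (Fin k), (∀ i, n (π i) = n i) ∧ ∀ i, σ (w i) = z (π i)) ∨
            (∃ π : Equiv.Perm (Fin k), (∀ i, n (π i) = n i) ∧ ∀ i, σ (w i) = conj (z (π i)))) ∧
          ((∀ i, (σ (w' i)).im = 0) ∨
            (∃ π : Equiv.Perm (Fin k), (∀ i, n (π i) = n i) ∧ ∀ i, σ (w' i) = z (π i)) ∨
            (∃ π : Equiv.Perm (Fin k), (∀ i, n (π i) = n i) ∧ ∀ i, σ (w' i) = conj (z (π i)))) :=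
  -- CLOSED: Theorems/HyperbolicBlochZagierDilogarithmConjectureStubOnePlaceSigned.lean (p124372)
  Summit.KontsevichZagierPeriods.HyperbolicBloch.ZagierDilogarithmGaloisDescent.stub_onePlaceSigned

/-- **Stub (CLOSED p124373): cyclotomic points — orbit symmetry ⇒ signed-permutation symmetry.** Points
given cyclotomically, `zᵢ = Σ_{m<N} qᵢₘ ζᵐ` (`ζ = e^{2πi/N}`, `qᵢₘ ∈ ℚ`). A `ℚ`-embedding `σ : ℚ̄ → ℂ` sends `ζ`
to `ζʲ` with `j` coprime to `N`, hence `σwᵢ = Σ qᵢₘ ζ^{jm}` and `σw'ᵢ = Σ qᵢₘ ζ^{(N−j)m}` (`z̄ᵢ = Σ qᵢₘ ζ^{−m}`).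
So if for EVERY `j` coprime to `N` the family `(Σₘ qᵢₘ ζ^{jm})ᵢ` is a coefficient-preserving permutation of
`(zᵢ)` or of `(z̄ᵢ)`, the signed-permutation hypothesis of `stub_signedPermutation` holds. Instances: orbit
sums `Σ_{h∈H}[h·z]` for an index-2 subgroup `H ≤ (ℤ/N)ˣ` with `−1 ∉ H` (fixed field an imaginary quadratic
subfield of `ℚ(ζ_N)`, e.g. `H = {1,2,4}` in `(ℤ/7)ˣ`, `ℚ(√−7) ⊂ ℚ(ζ₇)`, `r₂ = 3`) together with points of that
subfield. -/
theorem stub_cyclotomicPoints :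
    ∀ (N : ℕ), 0 < N → ∀ (k : ℕ) (z : Fin k → ℂ) (n : Fin k → ℤ) (q : Fin k → Fin N → ℚ),
      (∀ i, z i = ∑ m : Fin N, (q i m : ℂ) *
        Complex.exp (2 * Real.pi * Complex.I / N) ^ (m : ℕ)) →
      (∀ j : ℕ, j.Coprime N →
        (∃ π : Equiv.Perm (Fin k), (∀ i, n (π i) = n i) ∧ ∀ i,
            (∑ m : Fin N, (q i m : ℂ) * Complex.exp (2 * Real.pi * Complex.I / N) ^ (j * (m : ℕ))) =
              z (π i)) ∨
        (∃ π : Equiv.Perm (Fin k), (∀ i, n (π i) = n i) ∧ ∀ i,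
            (∑ m : Fin N, (q i m : ℂ) * Complex.exp (2 * Real.pi * Complex.I / N) ^ (j * (m : ℕ))) =
              conj (z (π i)))) →
        ∀ (σ : ↥(algebraicClosure ℚ ℂ) →ₐ[ℚ] ℂ) (w w' : Fin k → ↥(algebraicClosure ℚ ℂ)),
          (∀ i, (w i : ℂ) = z i) → (∀ i, (w' i : ℂ) = conj (z i)) →
          ((∀ i, (σ (w i)).im = 0) ∨
            (∃ π : Equiv.Perm (Fin k), (∀ i, n (π i) = n i) ∧ ∀ i, σ (w i) = z (π i)) ∨
            (∃ π : Equiv.Perm (Fin k), (∀ i, n (π i) = n i) ∧ ∀ i, σ (w i) = conj (z (π i)))) ∧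
          ((∀ i, (σ (w' i)).im = 0) ∨
            (∃ π : Equiv.Perm (Fin k), (∀ i, n (π i) = n i) ∧ ∀ i, σ (w' i) = z (π i)) ∨
            (∃ π : Equiv.Perm (Fin k), (∀ i, n (π i) = n i) ∧ ∀ i, σ (w' i) = conj (z (π i)))) :=
  -- CLOSED: Theorems/HyperbolicBlochZagierDilogarithmConjectureStubCyclotomicPoints.lean (p124373)
  Summit.KontsevichZagierPeriods.HyperbolicBloch.ZagierDilogarithmGaloisDescent.stub_cyclotomicPoints

/-- **Stub (CLOSED p124368 — lead c2; route level, mod Dupont): the Galois sub-sector of Conjecture 1.** What the route's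
deciding theorem `closes` consumes from `hZ` is TetraSector's conclusion — the kernel form of Conjecture 1 on
the tetrahedral subgroup: `Σ nᵢ · value(ρ zᵢ) = 0 ⇒ Σ nᵢ[ρ zᵢ] ∈ KZ.relations` for the standard reps `ρ` on the
ideal tetrahedra `T(zᵢ)`. On the largest provable slice (Dehn invariant zero ∧ Galois propagation — which at
`σ = id` already contains the volume relation) this holds GIVEN Dupont's theorem: `stub_galoisDescent` puts
`Σ nᵢ[zᵢ]` in `⟨dilogRelators⟩`, and the PROVED transfer theorem `FiveTermTransfer_of` turns every relator into
a KZ relation (as in `sectorReduction_proof`). Generalises c1's `stub_subSector` (one complex place). -/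
theorem stub_galoisSubSector :
    Dupont2001_preBloch_relation_of_invariants →
    ∀ (T : ℂ → Set (Fin 3 → ℝ)), (∀ z, T z = {p | 0 < p 1 ∧ z.re * p 1 < z.im * p 0 ∧
      z.im * (p 0 - 1) < (z.re - 1) * p 1 ∧ 0 < p 2 ∧
      0 < z.im * (p 0 ^ 2 + p 1 ^ 2 + p 2 ^ 2 - p 0) + (z.re - Complex.normSq z) * p 1}) →
    ∀ (ρ : ℂ → KZ.IntegralRep 3), (∀ z, IsAlgebraic ℚ z → 0 < z.im →
      (ρ z).domain = T z ∧ Set.EqOn (ρ z).integrand (fun p => 1 / p 2 ^ 3) (T z)) →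
    ∀ (k : ℕ) (z : Fin k → ℂ) (n : Fin k → ℤ), (∀ i, IsAlgebraic ℚ (z i)) → (∀ i, 0 < (z i).im) →
      (∀ u v : Additive ℂˣ →+ ℚ, dehn u v (∑ i, n i • FreeAbelianGroup.of (z i)) = 0) →
      (∀ (σ : ↥(algebraicClosure ℚ ℂ) →ₐ[ℚ] ℂ) (w w' : Fin k → ↥(algebraicClosure ℚ ℂ)),
          (∀ i, (w i : ℂ) = z i) → (∀ i, (w' i : ℂ) = conj (z i)) →
          ∑ i, (n i : ℝ) * (blochWignerDilog (σ (w i)) - blochWignerDilog (σ (w' i))) = 0) →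
        (∑ i, n i • KZ.of (ρ (z i))) ∈ KZ.relations :=
  -- CLOSED: Theorems/HyperbolicBlochZagierDilogarithmConjectureStubGaloisSubSector.lean (p124368, lead c2)
  Summit.KontsevichZagierPeriods.HyperbolicBloch.ZagierDilogarithmGaloisDescent.stub_galoisSubSector

/-- **Stub (CLOSED p125160): monomial (signed-permutation-with-signs) symmetry ⇒ self-similarity.**
The general combinatorial certificate, per index. For a family `u = (σwᵢ)ᵢ` or `(σw'ᵢ)ᵢ` say `u` is
MONOMIAL over `β = Σ nᵢ[zᵢ]` if there are `e ∈ ℤ` and a permutation `π` with, for every `i`, either `uᵢ` real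
and `e·n_{πi} = 0`, or `uᵢ = z_{πi}` and `nᵢ = e·n_{πi}`, or `uᵢ = z̄_{πi}` and `nᵢ = −e·n_{πi}` (so `σ` acts on
the formal combination as `e` times a signed permutation matrix). Then `Σ nᵢ[uᵢ] ≡ e·β` modulo
`⟨dilogRelators⟩` (real relators; `[z̄] ≡ −[z]`; reindexing by `π`), hence `2·σ_*ξ − (e₁ − e₂)·ξ ∈ ⟨dilogRelators⟩`.
Refines `stub_signedPermutation` (constant sign) — needed because `ℍ⁺`-normalised Galois orbits carry
per-index signs (e.g. `[ζ₇] + [ζ₇²] − [ζ₇³]` under `ζ ↦ ζ²`). -/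
theorem stub_monomialSymmetric :
    ∀ (k : ℕ) (z : Fin k → ℂ) (n : Fin k → ℤ),
      (∀ (σ : ↥(algebraicClosure ℚ ℂ) →ₐ[ℚ] ℂ) (w w' : Fin k → ↥(algebraicClosure ℚ ℂ)),
          (∀ i, (w i : ℂ) = z i) → (∀ i, (w' i : ℂ) = conj (z i)) →
          (∃ (e : ℤ) (π : Equiv.Perm (Fin k)), ∀ i,
              ((σ (w i)).im = 0 ∧ e * n (π i) = 0) ∨ (σ (w i) = z (π i) ∧ n i = e * n (π i)) ∨
                (σ (w i) = conj (z (π i)) ∧ n i = -(e * n (π i)))) ∧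
          (∃ (e : ℤ) (π : Equiv.Perm (Fin k)), ∀ i,
              ((σ (w' i)).im = 0 ∧ e * n (π i) = 0) ∨ (σ (w' i) = z (π i) ∧ n i = e * n (π i)) ∨
                (σ (w' i) = conj (z (π i)) ∧ n i = -(e * n (π i))))) →
        ∀ (σ : ↥(algebraicClosure ℚ ℂ) →ₐ[ℚ] ℂ) (w w' : Fin k → ↥(algebraicClosure ℚ ℂ)),
          (∀ i, (w i : ℂ) = z i) → (∀ i, (w' i : ℂ) = conj (z i)) →
          ∃ a b : ℤ, a ≠ 0 ∧
            a • (∑ i, n i • (FreeAbelianGroup.of (σ (w i)) - FreeAbelianGroup.of (σ (w' i)))) -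
              b • (∑ i, n i • (FreeAbelianGroup.of (z i) - FreeAbelianGroup.of (conj (z i)))) ∈
                AddSubgroup.closure dilogRelators :=
  -- CLOSED: Theorems/HyperbolicBlochZagierDilogarithmConjectureStubMonomialSymmetric.lean (p125160)
  Summit.KontsevichZagierPeriods.HyperbolicBloch.ZagierDilogarithmGaloisDescent.stub_monomialSymmetric

/-- **Stub (CLOSED p125162): cyclotomic points with signs.** Points `zᵢ = Σₘ qᵢₘ ζᵐ` (`ζ = e^{2πi/N}`);
if for EVERY `j` coprime to `N` the twisted family `(Σₘ qᵢₘ ζ^{jm})ᵢ` is monomial over `β` through the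
second and third alternatives (some `e, π` with `Σₘ qᵢₘ ζ^{jm} = z_{πi}, nᵢ = e n_{πi}` or
`= z̄_{πi}, nᵢ = −e n_{πi}`), then both families `(σwᵢ)`, `(σw'ᵢ)` are monomial for every `σ`
(`σζ = ζʲ`, `σ` of the conjugate lift `= Σ qᵢₘ ζ^{j(N−1)m}`). Instance: `ℍ⁺`-normalised orbit sums over an
index-2 subgroup `H ≤ (ℤ/N)ˣ` with `−1 ∉ H` together with points of the imaginary quadratic subfield
`ℚ(ζ_N)^H` — e.g. `[ζ₇] + [ζ₇²] − [ζ₇³]` and `2[(1+√−7)/2] + [(−1+√−7)/4]` in `ℚ(ζ₇)` (`r₂ = 3`). -/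
theorem stub_cyclotomicSigned :
    ∀ (N : ℕ), 0 < N → ∀ (k : ℕ) (z : Fin k → ℂ) (n : Fin k → ℤ) (q : Fin k → Fin N → ℚ),
      (∀ i, z i = ∑ m : Fin N, (q i m : ℂ) *
        Complex.exp (2 * Real.pi * Complex.I / N) ^ (m : ℕ)) →
      (∀ j : ℕ, j.Coprime N → ∃ (e : ℤ) (π : Equiv.Perm (Fin k)), ∀ i,
          ((∑ m : Fin N, (q i m : ℂ) * Complex.exp (2 * Real.pi * Complex.I / N) ^ (j * (m : ℕ))) =
              z (π i) ∧ n i = e * n (π i)) ∨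
          ((∑ m : Fin N, (q i m : ℂ) * Complex.exp (2 * Real.pi * Complex.I / N) ^ (j * (m : ℕ))) =
              conj (z (π i)) ∧ n i = -(e * n (π i)))) →
        ∀ (σ : ↥(algebraicClosure ℚ ℂ) →ₐ[ℚ] ℂ) (w w' : Fin k → ↥(algebraicClosure ℚ ℂ)),
          (∀ i, (w i : ℂ) = z i) → (∀ i, (w' i : ℂ) = conj (z i)) →
          (∃ (e : ℤ) (π : Equiv.Perm (Fin k)), ∀ i,
              ((σ (w i)).im = 0 ∧ e * n (π i) = 0) ∨ (σ (w i) = z (π i) ∧ n i = e * n (π i)) ∨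
                (σ (w i) = conj (z (π i)) ∧ n i = -(e * n (π i)))) ∧
          (∃ (e : ℤ) (π : Equiv.Perm (Fin k)), ∀ i,
              ((σ (w' i)).im = 0 ∧ e * n (π i) = 0) ∨ (σ (w' i) = z (π i) ∧ n i = e * n (π i)) ∨
                (σ (w' i) = conj (z (π i)) ∧ n i = -(e * n (π i)))) :=
  -- CLOSED: Theorems/HyperbolicBlochZagierDilogarithmConjectureStubCyclotomicSigned.lean (p125162)
  Summit.KontsevichZagierPeriods.HyperbolicBloch.ZagierDilogarithmGaloisDescent.stub_cyclotomicSigned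

/-- **Stub (CLOSED p125165): biquadratic points with signs.** Points `zᵢ = aᵢ + bᵢ√e + (cᵢ + fᵢ√e)√d·i`
of `ℚ(√e, √−d)`; `τ : √e ↦ −√e`. If the family `(τzᵢ)ᵢ` is monomial over `β` through the second and third
alternatives (some `E, π`: `τzᵢ = z_{πi}, nᵢ = E n_{πi}` or `τzᵢ = z̄_{πi}, nᵢ = −E n_{πi}`), then for every
`σ : ℚ̄ → ℂ` both `(σwᵢ)` and `(σw'ᵢ)` are monomial (`σ|_K ∈ {1, τ, c, cτ}`; `c` and `cτ` swap the two
alternatives and negate `E`). Refines `stub_biquadraticSymmetric` (all pairs `w, τw` in `ℍ⁺`) to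
`ℍ⁺`-normalised `τ`-orbits `[w] − [conj τw]`. -/
theorem stub_biquadraticSigned :
    ∀ (d e : ℕ) (k : ℕ) (z : Fin k → ℂ) (n : Fin k → ℤ) (a b c f : Fin k → ℚ),
      (∀ i, z i = a i + b i * (Real.sqrt e : ℂ) +
        (c i + f i * (Real.sqrt e : ℂ)) * ((Real.sqrt d : ℂ) * Complex.I)) →
      (∃ (E : ℤ) (π : Equiv.Perm (Fin k)), ∀ i,
          ((a i : ℂ) - b i * (Real.sqrt e : ℂ) +
              (c i - f i * (Real.sqrt e : ℂ)) * ((Real.sqrt d : ℂ) * Complex.I) = z (π i) ∧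
            n i = E * n (π i)) ∨
          ((a i : ℂ) - b i * (Real.sqrt e : ℂ) +
              (c i - f i * (Real.sqrt e : ℂ)) * ((Real.sqrt d : ℂ) * Complex.I) = conj (z (π i)) ∧
            n i = -(E * n (π i)))) →
        ∀ (σ : ↥(algebraicClosure ℚ ℂ) →ₐ[ℚ] ℂ) (w w' : Fin k → ↥(algebraicClosure ℚ ℂ)),
          (∀ i, (w i : ℂ) = z i) → (∀ i, (w' i : ℂ) = conj (z i)) →
          (∃ (e : ℤ) (π : Equiv.Perm (Fin k)), ∀ i,
              ((σ (w i)).im = 0 ∧ e * n (π i) = 0) ∨ (σ (w i) = z (π i) ∧ n i = e * n (π i)) ∨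
                (σ (w i) = conj (z (π i)) ∧ n i = -(e * n (π i)))) ∧
          (∃ (e : ℤ) (π : Equiv.Perm (Fin k)), ∀ i,
              ((σ (w' i)).im = 0 ∧ e * n (π i) = 0) ∨ (σ (w' i) = z (π i) ∧ n i = e * n (π i)) ∨
                (σ (w' i) = conj (z (π i)) ∧ n i = -(e * n (π i)))) :=
  -- CLOSED: Theorems/HyperbolicBlochZagierDilogarithmConjectureStubBiquadraticSigned.lean (p125165)
  Summit.KontsevichZagierPeriods.HyperbolicBloch.ZagierDilogarithmGaloisDescent.stub_biquadraticSigned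

/-- **Stub (CLOSED p125554, UNCONDITIONAL): the distribution slice.** For `N ≥ 1`, `ζ = e^{2πi/N}` and
algebraic `x`, `[xᴺ] − N · Σ_{m<N} [ζᵐ x] ∈ ⟨dilogRelators⟩`: the weight-2 distribution relations among
Bloch–Wigner values at algebraic points are explained by five-term relations over `ℚ̄` (and the flat
relators `[0]`, `[1]`), with NO appeal to Borel — Dupont's identity `{zᴺ} = N Σ {ζʲ z}` in `𝒫(ℚ̄)`
(Cor. 8.15, from Rogers' identity; tree `PreBloch.distribution'`) pushed forward to `ℤ[ℂ]`. Its image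
under the value map is the functional equation `D(xᴺ) = N Σ D(ζᵐ x)` (Literature
`blochWignerDilog_pow_distribution`, all `x ∈ ℂ`). -/
theorem stub_distributionSlice :
    ∀ (N : ℕ), 0 < N → ∀ (x : ℂ), IsAlgebraic ℚ x →
      (FreeAbelianGroup.of (x ^ N) -
        N • ∑ m ∈ Finset.range N,
          FreeAbelianGroup.of (Complex.exp (2 * Real.pi * Complex.I / N) ^ m * x)) ∈
        AddSubgroup.closure dilogRelators :=
  -- CLOSED: Theorems/HyperbolicBlochZagierDilogarithmConjectureStubDistributionSlice.lean (p125554, lead c2)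
  Summit.KontsevichZagierPeriods.HyperbolicBloch.ZagierDilogarithmGaloisDescent.stub_distributionSlice

/-! ## The heptagonal instance (explicit relation in `ℚ(ζ₇)`, `r₂ = 3`) -/

/-- **Stub (CLOSED p126339): the signed Galois certificate of the heptagonal relation** — for every `j`
coprime to `7`, the `ζ ↦ ζʲ` twist of `(ζ, ζ², ζ³, 1+ζ+ζ²+ζ⁴, (ζ+ζ²+ζ⁴)/2)` is `e` times a signed permutation
compatible with the coefficients `(7, 7, −7, −8, −4)` (input `hsym` of `stub_cyclotomicSignedSlice`, `N = 7`). -/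
theorem stub_heptagonalCertificate :
    ∀ j : ℕ, j.Coprime 7 → ∃ (e : ℤ) (π : Equiv.Perm (Fin 5)), ∀ i : Fin 5,
    ((∑ m : Fin 7, ((![![0, 1, 0, 0, 0, 0, 0], ![0, 0, 1, 0, 0, 0, 0], ![0, 0, 0, 1, 0, 0, 0],
        ![1, 1, 1, 0, 1, 0, 0], ![0, 1/2, 1/2, 0, 1/2, 0, 0]] : Fin 5 → Fin 7 → ℚ) i m : ℂ) *
          Complex.exp (2 * Real.pi * Complex.I / 7) ^ (j * (m : ℕ))) =
        (![Complex.exp (2 * Real.pi * Complex.I / 7), Complex.exp (2 * Real.pi * Complex.I / 7) ^ 2,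
           Complex.exp (2 * Real.pi * Complex.I / 7) ^ 3,
           1 + Complex.exp (2 * Real.pi * Complex.I / 7) + Complex.exp (2 * Real.pi * Complex.I / 7) ^ 2 +
             Complex.exp (2 * Real.pi * Complex.I / 7) ^ 4,
           (Complex.exp (2 * Real.pi * Complex.I / 7) + Complex.exp (2 * Real.pi * Complex.I / 7) ^ 2 +
             Complex.exp (2 * Real.pi * Complex.I / 7) ^ 4) / 2] : Fin 5 → ℂ) (π i) ∧
      (![7, 7, -7, -8, -4] : Fin 5 → ℤ) i = e * (![7, 7, -7, -8, -4] : Fin 5 → ℤ) (π i)) ∨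
    ((∑ m : Fin 7, ((![![0, 1, 0, 0, 0, 0, 0], ![0, 0, 1, 0, 0, 0, 0], ![0, 0, 0, 1, 0, 0, 0],
        ![1, 1, 1, 0, 1, 0, 0], ![0, 1/2, 1/2, 0, 1/2, 0, 0]] : Fin 5 → Fin 7 → ℚ) i m : ℂ) *
          Complex.exp (2 * Real.pi * Complex.I / 7) ^ (j * (m : ℕ))) =
        conj ((![Complex.exp (2 * Real.pi * Complex.I / 7), Complex.exp (2 * Real.pi * Complex.I / 7) ^ 2,
           Complex.exp (2 * Real.pi * Complex.I / 7) ^ 3,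
           1 + Complex.exp (2 * Real.pi * Complex.I / 7) + Complex.exp (2 * Real.pi * Complex.I / 7) ^ 2 +
             Complex.exp (2 * Real.pi * Complex.I / 7) ^ 4,
           (Complex.exp (2 * Real.pi * Complex.I / 7) + Complex.exp (2 * Real.pi * Complex.I / 7) ^ 2 +
             Complex.exp (2 * Real.pi * Complex.I / 7) ^ 4) / 2] : Fin 5 → ℂ) (π i)) ∧
      (![7, 7, -7, -8, -4] : Fin 5 → ℤ) i = -(e * (![7, 7, -7, -8, -4] : Fin 5 → ℤ) (π i))) :=
  -- CLOSED: Theorems/HyperbolicBlochZagierDilogarithmConjectureStubHeptagonalCertificate.lean (p126339)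
  Summit.KontsevichZagierPeriods.HyperbolicBloch.ZagierDilogarithmGaloisDescent.stub_heptagonalCertificate

/-- **Stub (CLOSED p126284): every Dehn invariant of `β₇ = 7[ζ]+7[ζ²]−7[ζ³]−8[x]−4[y]` vanishes**
(`x = (1+√−7)/2`, `y = (−1+√−7)/4`; roots of unity have torsion symbol, `x ∧ (1−x) = x ∧ x̄`,
`y ∧ (1−y) = −2 x ∧ x̄`). -/
theorem stub_heptagonalDehnZero :
    ∀ u v : Additive ℂˣ →+ ℚ,
    dehn u v (∑ i : Fin 5, (![7, 7, -7, -8, -4] : Fin 5 → ℤ) i •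
      FreeAbelianGroup.of ((![Complex.exp (2 * Real.pi * Complex.I / 7),
        Complex.exp (2 * Real.pi * Complex.I / 7) ^ 2,
        Complex.exp (2 * Real.pi * Complex.I / 7) ^ 3, (1 + (Real.sqrt 7 : ℂ) * Complex.I) / 2,
        (-1 + (Real.sqrt 7 : ℂ) * Complex.I) / 4] : Fin 5 → ℂ) i)) = 0 :=
  -- CLOSED: Theorems/HyperbolicBlochZagierDilogarithmConjectureStubHeptagonalDehnZero.lean (p126284)
  Summit.KontsevichZagierPeriods.HyperbolicBloch.ZagierDilogarithmGaloisDescent.stub_heptagonalDehnZero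

/-- **Stub (CLOSED p126344 — the lead's): the heptagonal relation is explained, mod Borel–Suslin.** IF `7D(ζ₇)+7D(ζ₇²)−7D(ζ₇³)−8D((1+√−7)/2)−4D((−1+√−7)/4) = 0` (true numerically to
< 1e-12; predicted exact by Borel) THEN `β₇ ∈ ⟨dilogRelators⟩`, GIVEN Dupont — the first certified relation among
dilogarithm values at points of a field with three complex places. -/
theorem stub_heptagonalRelation :
    Dupont2001_preBloch_relation_of_invariants →
    7 * blochWignerDilog (Complex.exp (2 * Real.pi * Complex.I / 7)) +
          7 * blochWignerDilog (Complex.exp (2 * Real.pi * Complex.I / 7) ^ 2) -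
          7 * blochWignerDilog (Complex.exp (2 * Real.pi * Complex.I / 7) ^ 3) -
          8 * blochWignerDilog ((1 + (Real.sqrt 7 : ℂ) * Complex.I) / 2) -
          4 * blochWignerDilog ((-1 + (Real.sqrt 7 : ℂ) * Complex.I) / 4) = 0 →
      ((7 : ℤ) • FreeAbelianGroup.of (Complex.exp (2 * Real.pi * Complex.I / 7)) +
          (7 : ℤ) • FreeAbelianGroup.of (Complex.exp (2 * Real.pi * Complex.I / 7) ^ 2) -
          (7 : ℤ) • FreeAbelianGroup.of (Complex.exp (2 * Real.pi * Complex.I / 7) ^ 3) -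
          (8 : ℤ) • FreeAbelianGroup.of ((1 + (Real.sqrt 7 : ℂ) * Complex.I) / 2) -
          (4 : ℤ) • FreeAbelianGroup.of ((-1 + (Real.sqrt 7 : ℂ) * Complex.I) / 4)) ∈
        AddSubgroup.closure dilogRelators :=
  -- CLOSED: Theorems/HyperbolicBlochZagierDilogarithmConjectureStubHeptagonalRelation.lean (p126344, lead c2)
  Summit.KontsevichZagierPeriods.HyperbolicBloch.ZagierDilogarithmGaloisDescent.stub_heptagonalRelation

/-! ## Reshape c3 — the certificate slice (UNCONDITIONAL memberships) -/

/-- **Stub (c3 — the lead's; CLOSED p128854): the heptagonal relation is explained UNCONDITIONALLY.**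
`β₇ = 7[ζ] + 7[ζ²] − 7[ζ³] − 8[x] − 4[y] ∈ ⟨dilogRelators⟩` (`ζ = e^{2πi/7}`, `x = (1+√−7)/2`, `y = (−1+√−7)/4`),
with NO hypothesis: a formal five-term certificate — an identity in `𝒫(ℚ̄)` (`ℚ̄ = algebraicClosure ℚ ℂ`, where
`sym_five_term`, `sym_inv`, `sym_one_sub` are proved) between the symbols of `{2,7}`-units of `ℚ(ζ₇)`, pushed
forward to `ℤ[ℂ]` (`closure_fiveTerm_le_comap`) with the conjugation pairs and real points riding as relators.
Supersedes `stub_heptagonalRelation` (no Dupont, no `hvol`). -/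
theorem stub_heptagonalMembership :
    ((7 : ℤ) • FreeAbelianGroup.of (Complex.exp (2 * Real.pi * Complex.I / 7)) +
          (7 : ℤ) • FreeAbelianGroup.of (Complex.exp (2 * Real.pi * Complex.I / 7) ^ 2) -
          (7 : ℤ) • FreeAbelianGroup.of (Complex.exp (2 * Real.pi * Complex.I / 7) ^ 3) -
          (8 : ℤ) • FreeAbelianGroup.of ((1 + (Real.sqrt 7 : ℂ) * Complex.I) / 2) -
          (4 : ℤ) • FreeAbelianGroup.of ((-1 + (Real.sqrt 7 : ℂ) * Complex.I) / 4)) ∈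
        AddSubgroup.closure dilogRelators :=
  -- CLOSED: Theorems/HyperbolicBlochZagierDilogarithmConjectureStubHeptagonalMembership.lean (p128854, lead c3;
  -- certificate parts p127551/p127552/p127553, identity p128694)
  Summit.KontsevichZagierPeriods.HyperbolicBloch.ZagierDilogarithmCertificate.stub_heptagonalMembership

/-- **Stub (c3 — CLOSED p127989; value level): the heptagonal volume relation is EXACT.**
`7D(ζ₇) + 7D(ζ₇²) − 7D(ζ₇³) − 8D((1+√−7)/2) − 4D((−1+√−7)/4) = 0` — from the tree's `√7` certificate
`SqrtSevenCertificate.sqrt7_certificate` (`6D(u) − 6D(u²) + 2D(u³) = 7(D ζ + D ζ² + D ζ⁴)`, `u = (−3+√−7)/4 = x/x̄`),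
`D(ζ⁴) = −D(ζ³)`, and the two five-term instances `V(u,u)` (`2D(x) = 2D(u) − D(u²)`) and `V(u,u²)`
(`D(u³) = D(u) + D(u²) + 2D(y)`) modulo `D(w̄) = D(1−w) = D(w⁻¹) = −D(w)`. Discharges `hvol` of
`stub_heptagonalRelation`. -/
theorem stub_heptagonalVolume :
    7 * blochWignerDilog (Complex.exp (2 * Real.pi * Complex.I / 7)) +
          7 * blochWignerDilog (Complex.exp (2 * Real.pi * Complex.I / 7) ^ 2) -
          7 * blochWignerDilog (Complex.exp (2 * Real.pi * Complex.I / 7) ^ 3) -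
          8 * blochWignerDilog ((1 + (Real.sqrt 7 : ℂ) * Complex.I) / 2) -
          4 * blochWignerDilog ((-1 + (Real.sqrt 7 : ℂ) * Complex.I) / 4) = 0 :=
  -- CLOSED: Theorems/HyperbolicBlochZagierDilogarithmConjectureStubHeptagonalVolume.lean (p127989, wave 1)
  Summit.KontsevichZagierPeriods.HyperbolicBloch.ZagierDilogarithmCertificate.stub_heptagonalVolume

/-- **Stub (c3 — CLOSED p127692; route level): explained ⇒ KZ relation.** For the standard tetrahedral
representations `ρ` (domain `T(z)`, integrand `t⁻³` for algebraic `z ∈ ℍ⁺`), every formal combination of points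
of `ℍ⁺` lying in `⟨dilogRelators⟩` gives a KZ relation `Σ nᵢ[ρ zᵢ] ∈ KZ.relations` — the transfer step of
`stub_galoisSubSector` / `sectorReduction_proof` (lift `[w] ↦ B w`, five-term relators ↦ `FiveTermTransfer_of`,
`[w]+[w̄] ↦ 0`, real `[w] ↦ 0`) with NO volume / Dehn / Galois hypothesis. With `stub_heptagonalMembership` it
yields an unconditional instance of TetraSector's conclusion over a field with three complex places. -/
theorem stub_explainedToKZ :
    ∀ (T : ℂ → Set (Fin 3 → ℝ)), (∀ z, T z = {p | 0 < p 1 ∧ z.re * p 1 < z.im * p 0 ∧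
      z.im * (p 0 - 1) < (z.re - 1) * p 1 ∧ 0 < p 2 ∧
      0 < z.im * (p 0 ^ 2 + p 1 ^ 2 + p 2 ^ 2 - p 0) + (z.re - Complex.normSq z) * p 1}) →
    ∀ (ρ : ℂ → KZ.IntegralRep 3), (∀ z, IsAlgebraic ℚ z → 0 < z.im →
      (ρ z).domain = T z ∧ Set.EqOn (ρ z).integrand (fun p => 1 / p 2 ^ 3) (T z)) →
    ∀ (k : ℕ) (z : Fin k → ℂ) (n : Fin k → ℤ), (∀ i, 0 < (z i).im) →
      (∑ i, n i • FreeAbelianGroup.of (z i)) ∈ AddSubgroup.closure dilogRelators →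
        (∑ i, n i • KZ.of (ρ (z i))) ∈ KZ.relations :=
  -- CLOSED: Theorems/HyperbolicBlochZagierDilogarithmConjectureStubExplainedToKZ.lean (p127692, wave 1)
  Summit.KontsevichZagierPeriods.HyperbolicBloch.ZagierDilogarithmCertificate.stub_explainedToKZ

/-- **Stub (c3 — CLOSED p127792; fact hygiene): Dupont's relation criterion from Borel (Neumann's form) and Suslin.** The two
renderings of the line's deep input are one: Neumann 1998 Thm 3.2 (Borel: zero Bloch symbol and zero regulators
⇒ torsion in `𝒫(K)`, `K` a number field; fact `Borel1977_blochGroup_regulator_kernel_torsion`, p96535) together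
with the unique divisibility of `𝒫(ℚ̄)` (fact `Suslin1991_preBloch_isUniquelyDivisible`) imply Dupont 2001
Thm 10.24 a) as rendered (`Dupont2001_preBloch_relation_of_invariants`, p97428): descend the combination to the
number field generated by its points, extend `ℚ`-valued characters and complex embeddings, push the torsion
relation to `𝒫(ℚ̄)` and divide. -/
theorem stub_dupontOfBorelSuslin :
    Borel1977_blochGroup_regulator_kernel_torsion → Suslin1991_preBloch_isUniquelyDivisible →
      Dupont2001_preBloch_relation_of_invariants :=
  -- CLOSED: Theorems/HyperbolicBlochZagierDilogarithmConjectureStubDupontOfBorelSuslin.lean (p127792, wave 1;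
  -- = Literature `Dupont2001_preBloch_relation_of_invariants_of_borel_suslin`, PreBlochRelationCriterionProofs)
  Summit.KontsevichZagierPeriods.HyperbolicBloch.ZagierDilogarithmCertificate.stub_dupontOfBorelSuslin

/-- **Consequence (c3): the heptagonal relation is explained MOD DUPONT ONLY** — `stub_heptagonalRelation` (p126344)
with its numerical hypothesis discharged by `stub_heptagonalVolume` (p127989). Superseded by the unconditional
`stub_heptagonalMembership`, kept as the value-level route. [folklore] -/
theorem heptagonalRelation_of_dupont (hD : Dupont2001_preBloch_relation_of_invariants) :
    ((7 : ℤ) • FreeAbelianGroup.of (Complex.exp (2 * Real.pi * Complex.I / 7)) +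
          (7 : ℤ) • FreeAbelianGroup.of (Complex.exp (2 * Real.pi * Complex.I / 7) ^ 2) -
          (7 : ℤ) • FreeAbelianGroup.of (Complex.exp (2 * Real.pi * Complex.I / 7) ^ 3) -
          (8 : ℤ) • FreeAbelianGroup.of ((1 + (Real.sqrt 7 : ℂ) * Complex.I) / 2) -
          (4 : ℤ) • FreeAbelianGroup.of ((-1 + (Real.sqrt 7 : ℂ) * Complex.I) / 4)) ∈
        AddSubgroup.closure dilogRelators :=
  stub_heptagonalRelation hD stub_heptagonalVolume

/-- **Consequence (c3, route level): the heptagonal KZ relation, UNCONDITIONALLY** — `stub_explainedToKZ ∘ stub_heptagonalMembership`: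
an instance of TetraSector's conclusion (Conjecture 1, kernel form) over a field with three complex places with no appeal to
Zagier's conjecture, Borel or numerics. **The heptagonal KZ relation.** For the standard tetrahedral representations `ρ`,
`7[ρ ζ₇] + 7[ρ ζ₇²] − 7[ρ ζ₇³] − 8[ρ ((1+√−7)/2)] − 4[ρ ((−1+√−7)/4)] ∈ KZ.relations`.
[cite: Neumann1998, §2.1 end (pp. 393–394): Zagier's conjecture] -/
theorem heptagonalKZ :
    ∀ (T : ℂ → Set (Fin 3 → ℝ)), (∀ z, T z = {p | 0 < p 1 ∧ z.re * p 1 < z.im * p 0 ∧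
      z.im * (p 0 - 1) < (z.re - 1) * p 1 ∧ 0 < p 2 ∧
      0 < z.im * (p 0 ^ 2 + p 1 ^ 2 + p 2 ^ 2 - p 0) + (z.re - Complex.normSq z) * p 1}) →
    ∀ (ρ : ℂ → KZ.IntegralRep 3), (∀ z, IsAlgebraic ℚ z → 0 < z.im →
      (ρ z).domain = T z ∧ Set.EqOn (ρ z).integrand (fun p => 1 / p 2 ^ 3) (T z)) →
      ((7 : ℤ) • KZ.of (ρ (Complex.exp (2 * Real.pi * Complex.I / 7))) +
        (7 : ℤ) • KZ.of (ρ (Complex.exp (2 * Real.pi * Complex.I / 7) ^ 2)) -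
        (7 : ℤ) • KZ.of (ρ (Complex.exp (2 * Real.pi * Complex.I / 7) ^ 3)) -
        (8 : ℤ) • KZ.of (ρ ((1 + (Real.sqrt 7 : ℂ) * Complex.I) / 2)) -
        (4 : ℤ) • KZ.of (ρ ((-1 + (Real.sqrt 7 : ℂ) * Complex.I) / 4))) ∈ KZ.relations := by
  intro T hT ρ hρ
  set ζ : ℂ := Complex.exp (2 * Real.pi * Complex.I / 7) with hζdef
  set x : ℂ := (1 + (Real.sqrt 7 : ℂ) * Complex.I) / 2 with hxdef
  set y : ℂ := (-1 + (Real.sqrt 7 : ℂ) * Complex.I) / 4 with hydef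
  have him : ∀ i : Fin 5, 0 < ((![ζ, ζ ^ 2, ζ ^ 3, x, y] : Fin 5 → ℂ) i).im :=
    Summit.KontsevichZagierPeriods.HyperbolicBloch.ZagierDilogarithmGaloisDescent.hept_im_pos
  have hmem := Summit.KontsevichZagierPeriods.HyperbolicBloch.ZagierDilogarithmCertificate.stub_heptagonalMembership
  have e : (∑ i : Fin 5, (![7, 7, -7, -8, -4] : Fin 5 → ℤ) i •
      FreeAbelianGroup.of ((![ζ, ζ ^ 2, ζ ^ 3, x, y] : Fin 5 → ℂ) i)) =
      (7 : ℤ) • FreeAbelianGroup.of ζ + (7 : ℤ) • FreeAbelianGroup.of (ζ ^ 2) -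
        (7 : ℤ) • FreeAbelianGroup.of (ζ ^ 3) - (8 : ℤ) • FreeAbelianGroup.of x -
        (4 : ℤ) • FreeAbelianGroup.of y := by
    simp only [Fin.sum_univ_five, Matrix.cons_val_zero, Matrix.cons_val_one, Matrix.head_cons,
      Matrix.cons_val_two, Matrix.tail_cons, Matrix.cons_val_three, Matrix.cons_val_four, neg_smul]
    abel
  have key := Summit.KontsevichZagierPeriods.HyperbolicBloch.ZagierDilogarithmCertificate.stub_explainedToKZ T hT ρ hρ 5 (![ζ, ζ ^ 2, ζ ^ 3, x, y]) (![7, 7, -7, -8, -4]) him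
    (by rw [e]; exact hmem)
  have e' : (∑ i : Fin 5, (![7, 7, -7, -8, -4] : Fin 5 → ℤ) i •
      KZ.of (ρ ((![ζ, ζ ^ 2, ζ ^ 3, x, y] : Fin 5 → ℂ) i))) =
      (7 : ℤ) • KZ.of (ρ ζ) + (7 : ℤ) • KZ.of (ρ (ζ ^ 2)) - (7 : ℤ) • KZ.of (ρ (ζ ^ 3)) -
        (8 : ℤ) • KZ.of (ρ x) - (4 : ℤ) • KZ.of (ρ y) := by
    simp only [Fin.sum_univ_five, Matrix.cons_val_zero, Matrix.cons_val_one, Matrix.head_cons,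
      Matrix.cons_val_two, Matrix.tail_cons, Matrix.cons_val_three, Matrix.cons_val_four, neg_smul]
    abel
  rw [e'] at key
  exact key

/-! ## Reshape c4 — the cyclotomic sector, exactly (Clausen–Dirichlet character sums)

Notation: `ζ_N = e^{2πi/N}`; for a Dirichlet character `χ mod N` the **Clausen character sum**
`Λ_N(χ) := Σ_{c mod N} χ(c) · D(ζ_N^c)` (`D(ζ_N^c) = Cl₂(2πc/N)`), written out in every signature.
The c4 stubs prove: `Λ_N(χ) ≠ 0` for every ODD `χ` (primitive case `Λ = −i·W(χ)·L(2, χ̄)`,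
level-raising `Λ_{Mp}(χ↑) = (1/p − χ(p))·Λ_M(χ)` by the distribution relations of `D`), hence by the
Galois twists `ζ ↦ ζᵃ` and Fourier inversion on `(ℤ/N)ˣ`: the primitive `N`-th roots of unity of the
upper half plane are `ℤ`-linearly independent modulo `⟨dilogRelators⟩` (UNCONDITIONAL), so the crux
implies Milnor's conjecture on the Clausen values `Cl₂(2πj/N)`, `(j, N) = 1`, `0 < j < N/2`, for every
`N` — and its restriction to `p`-th roots of unity (`p` prime) is EQUIVALENT to Milnor's conjecture for `p`.
-/

/-- **Stub (c4): the Clausen character sum of a primitive odd character.** For a primitive odd Dirichlet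
character `χ mod N`: `Σ_{c mod N} χ(c) D(ζ_N^c) = −i · W(χ) · L(2, χ⁻¹)`, `W(χ) = Σ_a χ(a) e^{2πia/N}` the
Gauss sum (Clausen series `D(e^{iθ}) = Σ sin(nθ)/n²` and Gauss inversion `Σ_a χ(a) e^{2πina/N} = χ̄(n) W(χ)`). -/
theorem stub_clausenCharSumPrimitive :
    ∀ (N : ℕ) [NeZero N] (χ : DirichletCharacter ℂ N), χ.IsPrimitive → χ.Odd →
      (∑ c : ZMod N, χ c *
          (blochWignerDilog (Complex.exp (2 * Real.pi * Complex.I / N) ^ c.val) : ℂ)) =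
        -(Complex.I * gaussSum χ (ZMod.stdAddChar (N := N)) * χ⁻¹.LFunction 2) :=
  -- CLOSED: Theorems/HyperbolicBlochZagierDilogarithmConjectureStubClausenCharSumPrimitive.lean (p132318, c4 wave 1)
  Summit.KontsevichZagierPeriods.HyperbolicBloch.ZagierDilogarithmCyclotomic.stub_clausenCharSumPrimitive

/-- **Stub (c4): level raising for the Clausen character sum.** For `χ mod M`, a prime `p` and the
induced character `χ↑ mod Mp`: `Λ_{Mp}(χ↑) = (1/p − χ(p)) · Λ_M(χ)` — the fibres of `ℤ/Mp → ℤ/M` are summed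
by the distribution relation `D(xᵖ) = p Σ_{j<p} D(ζ_pʲ x)`, and the residues prime to `M` but not to `Mp`
(present only if `p ∤ M`) are `p·(ℤ/M)ˣ`, contributing `χ(p) Λ_M(χ)`. -/
theorem stub_clausenCharSumLevel :
    ∀ (M p : ℕ) [NeZero M] [NeZero (M * p)], p.Prime → ∀ χ : DirichletCharacter ℂ M,
      (∑ c : ZMod (M * p), DirichletCharacter.changeLevel (dvd_mul_right M p) χ c *
          (blochWignerDilog (Complex.exp (2 * Real.pi * Complex.I / (M * p : ℕ)) ^ c.val) : ℂ)) =
        ((p : ℂ)⁻¹ - χ (p : ZMod M)) *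
          ∑ c : ZMod M, χ c *
            (blochWignerDilog (Complex.exp (2 * Real.pi * Complex.I / M) ^ c.val) : ℂ) :=
  -- CLOSED: Theorems/HyperbolicBlochZagierDilogarithmConjectureStubClausenCharSumLevel.lean (p132672, c4 wave 1)
  Summit.KontsevichZagierPeriods.HyperbolicBloch.ZagierDilogarithmCyclotomic.stub_clausenCharSumLevel

/-- **Stub (c4): non-vanishing of the Clausen character sum of every odd character** — from the
primitive case and level raising, by induction over the level (`χ = χ⋆↑` along
`cond(χ) ∣ … ∣ N/p ∣ N`, each step a non-zero factor `1/p − χ'(p)`, `|χ'(p)| ∈ {0, 1}`). -/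
theorem stub_clausenCharSum_ne_zero :
    (∀ (N : ℕ) [NeZero N] (χ : DirichletCharacter ℂ N), χ.IsPrimitive → χ.Odd →
      (∑ c : ZMod N, χ c *
          (blochWignerDilog (Complex.exp (2 * Real.pi * Complex.I / N) ^ c.val) : ℂ)) ≠ 0) →
    (∀ (M p : ℕ) [NeZero M] [NeZero (M * p)], p.Prime → ∀ χ : DirichletCharacter ℂ M,
      (∑ c : ZMod (M * p), DirichletCharacter.changeLevel (dvd_mul_right M p) χ c *
          (blochWignerDilog (Complex.exp (2 * Real.pi * Complex.I / (M * p : ℕ)) ^ c.val) : ℂ)) =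
        ((p : ℂ)⁻¹ - χ (p : ZMod M)) *
          ∑ c : ZMod M, χ c *
            (blochWignerDilog (Complex.exp (2 * Real.pi * Complex.I / M) ^ c.val) : ℂ)) →
    ∀ (N : ℕ) [NeZero N] (χ : DirichletCharacter ℂ N), χ.Odd →
      (∑ c : ZMod N, χ c *
          (blochWignerDilog (Complex.exp (2 * Real.pi * Complex.I / N) ^ c.val) : ℂ)) ≠ 0 :=
  -- CLOSED: Theorems/HyperbolicBlochZagierDilogarithmConjectureStubClausenCharSumNeZero.lean (p132847, c4 wave 1)
  Summit.KontsevichZagierPeriods.HyperbolicBloch.ZagierDilogarithmCyclotomic.stub_clausenCharSum_ne_zero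

/-- **Stub (c4): Galois twists of an explained cyclotomic combination.** If `Σ_c m_c [ζ_N^c] ∈ ⟨dilogRelators⟩`
then `Σ_c m_c D(ζ_N^{ac}) = 0` for every `a ∈ (ℤ/N)ˣ`: the automorphism `ζ_N ↦ ζ_Nᵃ` of `ℚ(ζ_N)` extends to a
`ℚ`-embedding `σ : ℚ̄ → ℂ`; `stub_twist_mem_closure` keeps the twisted, conjugation-odd combination
`Σ m_c([ζ^{ac}] − [ζ^{−ac}])` in `⟨dilogRelators⟩`, which the value map `[w] ↦ D(w)` kills. -/
theorem stub_cyclotomicTwists :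
    ∀ (N : ℕ) [NeZero N] (m : ZMod N → ℤ),
      (∑ c : ZMod N, m c • FreeAbelianGroup.of (Complex.exp (2 * Real.pi * Complex.I / N) ^ c.val)) ∈
          AddSubgroup.closure dilogRelators →
        ∀ a : (ZMod N)ˣ, ∑ c : ZMod N, (m c : ℝ) *
          blochWignerDilog (Complex.exp (2 * Real.pi * Complex.I / N) ^ ((a : ZMod N) * c).val) = 0 :=
  -- CLOSED: Theorems/HyperbolicBlochZagierDilogarithmConjectureStubCyclotomicTwists.lean (p133064, c4 wave 1)
  Summit.KontsevichZagierPeriods.HyperbolicBloch.ZagierDilogarithmCyclotomic.stub_cyclotomicTwists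

/-- **Stub (c4): Fourier inversion for odd functions on `(ℤ/N)ˣ`.** An odd function `f : (ℤ/N)ˣ → ℂ`
all of whose pairings `Σ_u f(u) χ(u)` with ODD Dirichlet characters vanish is zero (the pairings with even
characters vanish by oddness; then character orthogonality). -/
theorem stub_oddFourierInversion :
    ∀ (N : ℕ) [NeZero N] (f : (ZMod N)ˣ → ℂ), (∀ u, f (-u) = -f u) →
      (∀ χ : DirichletCharacter ℂ N, χ.Odd → ∑ u : (ZMod N)ˣ, f u * χ u = 0) → ∀ u, f u = 0 :=
  -- CLOSED: Theorems/HyperbolicBlochZagierDilogarithmConjectureStubOddFourierInversion.lean (p133135, c4 wave 1)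
  Summit.KontsevichZagierPeriods.HyperbolicBloch.ZagierDilogarithmCyclotomic.stub_oddFourierInversion

/-- **Stub (c4, route level, UNCONDITIONAL): the distribution relations are KZ relations.** For the standard
tetrahedral representations `ρ` and the sign-corrected class `B` of `FiveTermTransfer` (`B w = [ρ w]`,
`−[ρ w̄]`, `0` according to the sign of `Im w`): `B(xᴺ) − N Σ_{m<N} B(ζ_Nᵐ x) ∈ KZ.relations` for every
algebraic `x` — `stub_distributionSlice` pushed through the lift of `B` (five-term relators ↦
`FiveTermTransfer_of`, `[w] + [w̄] ↦ 0`, real `[w] ↦ 0`). An infinite unconditional family of instances of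
TetraSector's conclusion (the kernel form of Conjecture 1 on ideal tetrahedra). -/
theorem stub_distributionKZ :
    ∀ (T : ℂ → Set (Fin 3 → ℝ)), (∀ z, T z = {p | 0 < p 1 ∧ z.re * p 1 < z.im * p 0 ∧
      z.im * (p 0 - 1) < (z.re - 1) * p 1 ∧ 0 < p 2 ∧
      0 < z.im * (p 0 ^ 2 + p 1 ^ 2 + p 2 ^ 2 - p 0) + (z.re - Complex.normSq z) * p 1}) →
    ∀ (ρ : ℂ → KZ.IntegralRep 3), (∀ z, IsAlgebraic ℚ z → 0 < z.im →
      (ρ z).domain = T z ∧ Set.EqOn (ρ z).integrand (fun p => 1 / p 2 ^ 3) (T z)) →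
    ∀ (B : ℂ → KZ.FormalRep), (∀ z, B z = if 0 < z.im then KZ.of (ρ z)
      else if z.im < 0 then -KZ.of (ρ ((starRingEnd ℂ) z)) else 0) →
    ∀ (N : ℕ), 0 < N → ∀ x : ℂ, IsAlgebraic ℚ x →
      B (x ^ N) - N • ∑ m ∈ Finset.range N, B (Complex.exp (2 * Real.pi * Complex.I / N) ^ m * x) ∈
        KZ.relations :=
  -- CLOSED: Theorems/HyperbolicBlochZagierDilogarithmConjectureStubDistributionKZ.lean (p133221, c4 wave 1)
  Summit.KontsevichZagierPeriods.HyperbolicBloch.ZagierDilogarithmCyclotomic.stub_distributionKZ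

/-- **Stub (c4, UNCONDITIONAL): Zagier's conjecture for sixth roots of unity.** A `ℤ`-relation among the
`D`-values of points of `μ₆ ∩ ℍ⁺ = {ζ₆, ζ₃}` is explained: `3D(ζ₃) = 2D(ζ₆)` (distribution `N = 2` at `ζ₆` and
`D(ζ₆⁴) = −D(ζ₃)`), `D(ζ₆) > 0`, so the relation is a multiple of `2[ζ₆] − 3[ζ₃]`, which lies in
`⟨dilogRelators⟩` by `stub_distributionSlice` (`N = 2`, `x = ζ₆`) and the conjugation relator `[ζ₆⁴] + [ζ₃]`. -/
theorem stub_sexticSector :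
    ∀ (k : ℕ) (u : Fin k → ℂ) (n : Fin k → ℤ), (∀ i, u i ^ 6 = 1) → (∀ i, 0 < (u i).im) →
      ∑ i, (n i : ℝ) * blochWignerDilog (u i) = 0 →
        (∑ i, n i • FreeAbelianGroup.of (u i)) ∈ AddSubgroup.closure dilogRelators :=
  -- CLOSED: Theorems/HyperbolicBlochZagierDilogarithmConjectureStubSexticSector.lean (p133728, c4 wave 1)
  Summit.KontsevichZagierPeriods.HyperbolicBloch.ZagierDilogarithmCyclotomic.stub_sexticSector

/-- **Stub (c4 — the lead's): cyclotomic independence modulo the dilogarithm relators (UNCONDITIONAL).**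
For every `N`, a `ℤ`-combination of the primitive `N`-th roots of unity of the upper half plane
(`[ζ_N^c]`, `(c, N) = 1`, `0 < c < N/2`) that lies in `⟨dilogRelators⟩` is ZERO: its Galois twists give
`Σ_c m_c D(ζ_N^{ac}) = 0` for all `a ∈ (ℤ/N)ˣ` (`stub_cyclotomicTwists`); pairing with an odd character `χ`
yields `Λ_N(χ) · Σ_c m_c χ̄(c) = 0`, so `Σ_c m_c χ̄(c) = 0` (`stub_clausenCharSum_ne_zero`), and Fourier
inversion for the odd function `c ↦ m_c − m_{−c}` on `(ℤ/N)ˣ` (`stub_oddFourierInversion`) gives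
`m_c = m_{−c} = 0` (`−c` lies in the lower half). The relator group meets the cyclotomic points in no
unexpected relation — without Borel's theorem. -/
theorem stub_cyclotomicIndependence :
    ∀ (N : ℕ) [NeZero N] (m : ZMod N → ℤ), (∀ c, m c ≠ 0 → IsUnit c ∧ 0 < c.val ∧ 2 * c.val < N) →
      (∑ c : ZMod N, m c • FreeAbelianGroup.of (Complex.exp (2 * Real.pi * Complex.I / N) ^ c.val)) ∈
          AddSubgroup.closure dilogRelators →
        ∀ c, m c = 0 :=
  -- CLOSED: Theorems/HyperbolicBlochZagierDilogarithmConjectureStubCyclotomicIndependence.lean (p133984, lead c4)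
  Summit.KontsevichZagierPeriods.HyperbolicBloch.ZagierDilogarithmCyclotomic.stub_cyclotomicIndependence

/-! ### Reshape c4, wave 2: sector equivalences and classical forms -/

/-- **Stub (c4 wave 2): the prime cyclotomic sector of the crux is EQUIVALENT to Milnor's conjecture.**
For a prime `p`, Zagier's conjecture restricted to `p`-th roots of unity (every `ℤ`-relation among the
`D`-values of points of `μ_p ∩ ℍ⁺` is explained) holds if and only if the Clausen values `D(ζ_p^c)`,
`0 < c < p/2`, are `ℤ`-linearly independent (Milnor's conjecture for `p`): `⇒` by
`stub_cyclotomicIndependence` (an explained primitive combination is zero), `⇐` because the points of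
`μ_p ∩ ℍ⁺` are exactly the `ζ_p^c`, `0 < c < p/2`, so an independent family admits only the zero
relation, whose formal combination is `0`. -/
theorem stub_cyclotomicPrimeSector_iff :
    ∀ (p : ℕ) [NeZero p], p.Prime →
      ((∀ (k : ℕ) (u : Fin k → ℂ) (n : Fin k → ℤ), (∀ i, u i ^ p = 1) → (∀ i, 0 < (u i).im) →
          ∑ i, (n i : ℝ) * blochWignerDilog (u i) = 0 →
            (∑ i, n i • FreeAbelianGroup.of (u i)) ∈ AddSubgroup.closure dilogRelators) ↔
        (∀ m : ZMod p → ℤ, (∀ c, m c ≠ 0 → 0 < c.val ∧ 2 * c.val < p) →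
          ∑ c : ZMod p, (m c : ℝ) *
              blochWignerDilog (Complex.exp (2 * Real.pi * Complex.I / p) ^ c.val) = 0 →
            ∀ c, m c = 0)) :=
  -- CLOSED: Theorems/HyperbolicBlochZagierDilogarithmConjectureStubCyclotomicPrimeSectorIff.lean (p134784, c4 wave 2)
  Summit.KontsevichZagierPeriods.HyperbolicBloch.ZagierDilogarithmCyclotomic.stub_cyclotomicPrimeSector_iff

/-- **Stub (c4 wave 2, route level, UNCONDITIONAL): the sextic sector of Conjecture 1 on ideal tetrahedra.**
For the standard tetrahedral representations `ρ`, every `ℤ`-relation among the periods `vol T(u)`,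
`u ∈ μ₆ ∩ ℍ⁺ = {ζ₆, ζ₃}`, is a KZ relation: `value(ρ u) = D(u)` (the volume theorem), `stub_sexticSector`,
`stub_explainedToKZ`. TetraSector's conclusion holds outright on this sector. -/
theorem stub_sexticKZ :
    ∀ (T : ℂ → Set (Fin 3 → ℝ)), (∀ z, T z = {p | 0 < p 1 ∧ z.re * p 1 < z.im * p 0 ∧
      z.im * (p 0 - 1) < (z.re - 1) * p 1 ∧ 0 < p 2 ∧
      0 < z.im * (p 0 ^ 2 + p 1 ^ 2 + p 2 ^ 2 - p 0) + (z.re - Complex.normSq z) * p 1}) →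
    ∀ (ρ : ℂ → KZ.IntegralRep 3), (∀ z, IsAlgebraic ℚ z → 0 < z.im →
      (ρ z).domain = T z ∧ Set.EqOn (ρ z).integrand (fun p => 1 / p 2 ^ 3) (T z)) →
    ∀ (k : ℕ) (u : Fin k → ℂ) (n : Fin k → ℤ), (∀ i, u i ^ 6 = 1) → (∀ i, 0 < (u i).im) →
      ∑ i, (n i : ℝ) * (ρ (u i)).value = 0 →
        (∑ i, n i • KZ.of (ρ (u i))) ∈ KZ.relations :=
  -- CLOSED: Theorems/HyperbolicBlochZagierDilogarithmConjectureStubSexticKZ.lean (p134946, c4 wave 2)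
  Summit.KontsevichZagierPeriods.HyperbolicBloch.ZagierDilogarithmCyclotomic.stub_sexticKZ

/-- **Stub (c4 wave 2): Milnor's conjecture, `ℤ`-form versus `ℚ`-form.** For every `N`, the `ℤ`-linear
independence statement used by `crux_implies_milnor` is equivalent to the `ℚ`-linear independence
(`LinearIndependent ℚ`) of the family `c ↦ D(ζ_N^c)` on the primitive residues of the open upper half —
clearing denominators. -/
theorem stub_milnorRationalForm :
    ∀ (N : ℕ) [NeZero N],
      (∀ m : ZMod N → ℤ, (∀ c, m c ≠ 0 → IsUnit c ∧ 0 < c.val ∧ 2 * c.val < N) →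
          ∑ c : ZMod N, (m c : ℝ) *
              blochWignerDilog (Complex.exp (2 * Real.pi * Complex.I / N) ^ c.val) = 0 →
            ∀ c, m c = 0) ↔
        LinearIndependent ℚ (fun c : {c : ZMod N // IsUnit c ∧ 0 < c.val ∧ 2 * c.val < N} =>
          blochWignerDilog (Complex.exp (2 * Real.pi * Complex.I / N) ^ (c : ZMod N).val)) :=
  -- CLOSED: Theorems/HyperbolicBlochZagierDilogarithmConjectureStubMilnorRationalForm.lean (p135129, c4 wave 2)
  Summit.KontsevichZagierPeriods.HyperbolicBloch.ZagierDilogarithmCyclotomic.stub_milnorRationalForm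

/-- **Stub (c4 wave 2): Clausen values are Lobachevsky values.** `D(ζ_N^c) = 2·Л(πc/N)` for `0 < c < N`
(`D(e^{iθ}) = −∫₀^θ log|2 sin(t/2)| dt`, substitution `t = 2u`, `Л(θ) = −∫₀^θ log|2 sin u| du`), so
Milnor's conjecture in its printed form (the `Л(πc/N)`, `(c, N) = 1`, `0 < c < N/2`, are `ℚ`-independent;
Milnor 1982) is literally the statement about the `D(ζ_N^c)`. -/
theorem stub_clausenLobachevsky :
    ∀ (N c : ℕ), 0 < c → c < N →
      blochWignerDilog (Complex.exp (2 * Real.pi * Complex.I / N) ^ c) =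
        2 * lobachevsky (Real.pi * c / N) :=
  -- CLOSED: Theorems/HyperbolicBlochZagierDilogarithmConjectureStubClausenLobachevsky.lean (p135332, c4 wave 2)
  Summit.KontsevichZagierPeriods.HyperbolicBloch.ZagierDilogarithmCyclotomic.stub_clausenLobachevsky

/-- **Stub (c4 wave 2, UNCONDITIONAL): Zagier's conjecture for fourth roots of unity.** `μ₄ ∩ ℍ⁺ = {i}`,
`D(i) = G > 0`, so a relation `Σ nᵢ D(uᵢ) = 0` with all `uᵢ⁴ = 1`, `Im uᵢ > 0` has `Σ nᵢ = 0` and its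
formal combination `(Σ nᵢ)[i]` is zero. With `stub_sexticSector`: the crux holds outright on `μ_N ∩ ℍ⁺`
exactly for the `N` with at most one primitive point up to sign, `N ∈ {1, 2, 3, 4, 6}`; for every other `N`
it contains Milnor's conjecture for `N` (`crux_implies_milnor`). -/
theorem stub_quarticSector :
    ∀ (k : ℕ) (u : Fin k → ℂ) (n : Fin k → ℤ), (∀ i, u i ^ 4 = 1) → (∀ i, 0 < (u i).im) →
      ∑ i, (n i : ℝ) * blochWignerDilog (u i) = 0 →
        (∑ i, n i • FreeAbelianGroup.of (u i)) ∈ AddSubgroup.closure dilogRelators :=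
  -- CLOSED: Theorems/HyperbolicBlochZagierDilogarithmConjectureStubQuarticSector.lean (p135387, c4 wave 2)
  Summit.KontsevichZagierPeriods.HyperbolicBloch.ZagierDilogarithmCyclotomic.stub_quarticSector

/-! ### c4 consequences: the cyclotomic sector is exactly Milnor's conjecture -/

/-- **Non-vanishing of every Clausen character sum** (c4; from `stub_clausenCharSumPrimitive` — Gauss sum
and `L(2, χ⁻¹)` are non-zero — `stub_clausenCharSumLevel` and `stub_clausenCharSum_ne_zero`): for every odd
Dirichlet character `χ mod N`, `Σ_{c mod N} χ(c) D(ζ_N^c) ≠ 0`. [folklore] -/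
theorem clausenCharSum_ne_zero (N : ℕ) [NeZero N] (χ : DirichletCharacter ℂ N) (hodd : χ.Odd) :
    (∑ c : ZMod N, χ c *
        (blochWignerDilog (Complex.exp (2 * Real.pi * Complex.I / N) ^ c.val) : ℂ)) ≠ 0 := by
  refine stub_clausenCharSum_ne_zero (fun M hM ψ hψ hψodd => ?_)
    (fun M p hM hMp hp ψ => @stub_clausenCharSumLevel M p hM hMp hp ψ) N χ hodd
  rw [@stub_clausenCharSumPrimitive M hM ψ hψ hψodd]
  refine neg_ne_zero.2 (mul_ne_zero (mul_ne_zero Complex.I_ne_zero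
    (Literature.NumberTheory.LFunctions.gaussSum_ne_zero ψ hψ)) ?_)
  have h := Literature.NumberTheory.LFunctions.LFunction_natCast_ne_zero ψ⁻¹ (k := 2) le_rfl
  simpa using h

/-- Powers of `ζ_N` are algebraic. [folklore] -/
theorem isAlgebraic_zeta_pow (N : ℕ) [NeZero N] (k : ℕ) :
    IsAlgebraic ℚ (Complex.exp (2 * Real.pi * Complex.I / N) ^ k) := by
  have hζ := Complex.isPrimitiveRoot_exp N (NeZero.ne N)
  refine ⟨Polynomial.X ^ N - Polynomial.C 1, Polynomial.X_pow_sub_C_ne_zero (NeZero.pos N) 1, ?_⟩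
  rw [map_sub, map_pow, Polynomial.aeval_X, Polynomial.aeval_C, map_one, ← pow_mul, pow_mul',
    hζ.pow_eq_one, one_pow, sub_self]

/-- `ζ_N^c` lies in the open upper half plane when `0 < c < N/2`. [folklore] -/
theorem zeta_pow_im_pos (N : ℕ) [NeZero N] {c : ℕ} (hc0 : 0 < c) (hc2 : 2 * c < N) :
    0 < (Complex.exp (2 * Real.pi * Complex.I / N) ^ c).im := by
  rw [Summit.KontsevichZagierPeriods.HyperbolicBloch.ZagierDilogarithmCyclotomic.cexp_two_pi_div_pow,
    Complex.exp_ofReal_mul_I_im]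
  have hN : (0 : ℝ) < N := by exact_mod_cast NeZero.pos N
  refine Real.sin_pos_of_pos_of_lt_pi (by positivity) ?_
  rw [div_lt_iff₀ hN]
  have h : (2 * c : ℝ) < N := by exact_mod_cast hc2
  nlinarith [Real.pi_pos]

/-- **The crux implies Milnor's conjecture, for every `N` (c4).** If Zagier's dilogarithm conjecture holds,
then the Clausen values `Cl₂(2πc/N) = D(ζ_N^c)` at the primitive residues `c` of the open upper half
(`(c, N) = 1`, `0 < c < N/2`) are `ℤ`- (equivalently `ℚ`-) linearly independent — Milnor's conjecture on the
values of the Lobachevsky function (Milnor 1982; the cyclotomic case of the crux, Neumann 1998 §2.1). The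
content is `stub_cyclotomicIndependence`: the crux turns a relation into a membership in `⟨dilogRelators⟩`,
which is impossible for a non-zero primitive combination. [cite: Neumann1998, §2.1] -/
theorem crux_implies_milnor (h : Theses.HyperbolicBloch.ZagierDilogarithmConjecture) :
    ∀ (N : ℕ) [NeZero N] (m : ZMod N → ℤ), (∀ c, m c ≠ 0 → IsUnit c ∧ 0 < c.val ∧ 2 * c.val < N) →
      ∑ c : ZMod N, (m c : ℝ) *
          blochWignerDilog (Complex.exp (2 * Real.pi * Complex.I / N) ^ c.val) = 0 →
        ∀ c, m c = 0 := by
  intro N _ m hsupp hsum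
  classical
  have hD := (ZagierDilogarithmRelationsConjecture.iff_blochWignerDilog'.1 (crux_iff.1 h))
  set ζ : ℂ := Complex.exp (2 * Real.pi * Complex.I / N) with hζ
  -- the support family, indexed by `Fin k`
  set S := {c : ZMod N // m c ≠ 0} with hS
  set k := Fintype.card S
  set e : S ≃ Fin k := Fintype.equivFin S
  set z : Fin k → ℂ := fun i => ζ ^ ((e.symm i : ZMod N)).val with hz
  set n : Fin k → ℤ := fun i => m (e.symm i) with hn
  have halg : ∀ i, IsAlgebraic ℚ (z i) := fun i => isAlgebraic_zeta_pow N _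
  have him : ∀ i, 0 < (z i).im := fun i =>
    zeta_pow_im_pos N (hsupp _ (e.symm i).2).2.1 (hsupp _ (e.symm i).2).2.2
  -- sums over the support family are sums over `ℤ/N`
  have hreindex : ∀ (G : Type) [AddCommMonoid G] (F : ZMod N → ℤ → G), (∀ c, F c 0 = 0) →
      ∑ i, F (e.symm i) (n i) = ∑ c : ZMod N, F c (m c) := by
    intro G _ F hF
    rw [Fintype.sum_equiv e.symm (fun i => F (e.symm i) (n i)) (fun s : S => F s (m s)) (fun i => rfl),
      ← Finset.sum_subtype (Finset.univ.filter fun c => m c ≠ 0) (by simp)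
        (fun c => F c (m c))]
    exact Finset.sum_filter_of_ne fun c _ hc h0 => hc (by rw [h0, hF])
  have hval : ∑ i, (n i : ℝ) * blochWignerDilog (z i) = 0 := by
    have := hreindex ℝ (fun c t => (t : ℝ) * blochWignerDilog (ζ ^ c.val)) (fun c => by simp)
    rw [this]
    exact hsum
  have hmem := hD k z n halg him hval
  have hformal : (∑ i, n i • FreeAbelianGroup.of (z i)) =
      ∑ c : ZMod N, m c • FreeAbelianGroup.of (ζ ^ c.val) :=
    hreindex (FreeAbelianGroup ℂ) (fun c t => t • FreeAbelianGroup.of (ζ ^ c.val)) (fun c => by simp)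
  rw [hformal] at hmem
  exact stub_cyclotomicIndependence N m hsupp hmem

/-- **The crux implies Milnor's conjecture — `ℚ`-linear independence form (c4).** If Zagier's dilogarithm
conjecture holds then for every `N` the Clausen values `D(ζ_N^c) = Cl₂(2πc/N)`, `c` a unit of `ℤ/N` with
`0 < c < N/2`, are linearly independent over `ℚ` (`crux_implies_milnor` + `stub_milnorRationalForm`).
[cite: Neumann1998, §2.1] -/
theorem crux_implies_milnor_rational (h : Theses.HyperbolicBloch.ZagierDilogarithmConjecture)
    (N : ℕ) [NeZero N] :
    LinearIndependent ℚ (fun c : {c : ZMod N // IsUnit c ∧ 0 < c.val ∧ 2 * c.val < N} =>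
      blochWignerDilog (Complex.exp (2 * Real.pi * Complex.I / N) ^ (c : ZMod N).val)) :=
  (stub_milnorRationalForm N).1 (crux_implies_milnor h N)

/-- **The crux implies Milnor's conjecture in Milnor's own (Lobachevsky) form (c4).** If Zagier's
dilogarithm conjecture holds then for every `N` the values `Л(πc/N)` of the Lobachevsky function at the
units `c` of `ℤ/N` with `0 < c < N/2` are linearly independent over `ℚ` — Milnor's conjecture
(Milnor 1982, Appendix; `D(ζ_N^c) = 2Л(πc/N)` by `stub_clausenLobachevsky`). [cite: Milnor1982, Appendix] -/
theorem crux_implies_milnor_lobachevsky (h : Theses.HyperbolicBloch.ZagierDilogarithmConjecture)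
    (N : ℕ) [NeZero N] :
    LinearIndependent ℚ (fun c : {c : ZMod N // IsUnit c ∧ 0 < c.val ∧ 2 * c.val < N} =>
      lobachevsky (Real.pi * (c : ZMod N).val / N)) := by
  have hD := crux_implies_milnor_rational h N
  rw [← Summit.KontsevichZagierPeriods.HyperbolicBloch.ZagierDilogarithmCyclotomic.MilnorRationalForm.int_form_iff_linearIndependent_rat]
    at hD ⊢
  intro m hm
  refine hD m ?_
  have e : ∀ c : {c : ZMod N // IsUnit c ∧ 0 < c.val ∧ 2 * c.val < N},
      blochWignerDilog (Complex.exp (2 * Real.pi * Complex.I / N) ^ (c : ZMod N).val) =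
        2 * lobachevsky (Real.pi * (c : ZMod N).val / N) :=
    fun c => stub_clausenLobachevsky N _ c.2.2.1 (ZMod.val_lt _)
  simp only [e]
  calc ∑ i, (m i : ℝ) * (2 * lobachevsky (Real.pi * ((i : ZMod N)).val / N))
      = 2 * ∑ i, (m i : ℝ) * lobachevsky (Real.pi * ((i : ZMod N)).val / N) := by
        rw [Finset.mul_sum]; exact Finset.sum_congr rfl fun i _ => by ring
    _ = 0 := by rw [hm, mul_zero]

/-- **Unconditional low-order sectors (c4).** Zagier's conjecture holds outright for the relations among
`D`-values of `N`-th roots of unity in `ℍ⁺` when `N ∣ 4` or `N ∣ 6` (`stub_quarticSector`, `stub_sexticSector`: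
`μ₄ ∩ ℍ⁺ = {i}`, `μ₆ ∩ ℍ⁺ = {ζ₆, ζ₃}` with `3D(ζ₃) = 2D(ζ₆)` explained by distribution); for every other `N`
the primitive half-system has at least two points and the sector contains the open Milnor conjecture for `N`
(`crux_implies_milnor`; equivalence for prime `N`: `stub_cyclotomicPrimeSector_iff`). [folklore] -/
theorem lowOrderSectors :
    (∀ (k : ℕ) (u : Fin k → ℂ) (n : Fin k → ℤ), (∀ i, u i ^ 4 = 1) → (∀ i, 0 < (u i).im) →
        ∑ i, (n i : ℝ) * blochWignerDilog (u i) = 0 →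
          (∑ i, n i • FreeAbelianGroup.of (u i)) ∈ AddSubgroup.closure dilogRelators) ∧
      (∀ (k : ℕ) (u : Fin k → ℂ) (n : Fin k → ℤ), (∀ i, u i ^ 6 = 1) → (∀ i, 0 < (u i).im) →
        ∑ i, (n i : ℝ) * blochWignerDilog (u i) = 0 →
          (∑ i, n i • FreeAbelianGroup.of (u i)) ∈ AddSubgroup.closure dilogRelators) :=
  ⟨stub_quarticSector, stub_sexticSector⟩

/-! ## Reshape c5 — the cyclotomic tower and the abelian sector

(tower, UNCONDITIONAL) weight-2 Kubert spanning/folding in `ℤ[ℂ]/⟨dilogRelators⟩` ⇒ Galois descent on `μ_N` without Borel, level-`N`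
sector (torsion form) ⇔ Milnor_N for every `N`, all roots of unity ⇔ `∀ N, Milnor_N`; (abelian sector, mod Borel rank + Dupont) Dehn-zero
relations over `ℚ(ζ_N)` propagate given Milnor_N, so that sector ⇔ Milnor_N. Details: Lines/kummer_clausen_linearisation.md. -/

/-- **Stub (c5): weight-2 Kubert spanning modulo the relators (UNCONDITIONAL).** For every `N ≥ 1` and
every residue `c mod N` there are `M ≥ 1` and integers `b_a` supported on the UNITS `a ∈ (ℤ/N)ˣ` with
`M·[ζ_N^c] − Σ_a b_a [ζ_N^a] ∈ ⟨dilogRelators⟩`. Induction on `g = gcd(c, N)`: `[1] ∈ ⟨dilogRelators⟩` (real);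
for `g > 1` pick a prime `p ∣ g`; if `p ∣ N/g` the distribution relator at a `p`-th root
(`stub_distributionSlice`, `x = ζ_N^{c/p}`) writes `[ζ_N^c]` as `p·Σ` of classes with gcd `g/p`; if
`p ∤ N/g` the distribution relators at `x = yᵖⁱ` (`y = ζ_N^c`) telescope along the orbit `y ↦ yᵖ`
(`p^r ≡ 1 mod N/g`) to `(p^r − 1)[y] ≡ −Σᵢ p^{r−1−i}·p·Σ_{0<m<p}[ζ_pᵐ yᵖⁱ]`, classes of gcd `g/p`.
The good classes form a subgroup, which closes the induction. -/
theorem stub_cyclotomicSpanning :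
    ∀ (N : ℕ) [NeZero N] (c : ZMod N), ∃ M : ℕ, 0 < M ∧ ∃ b : ZMod N → ℤ, (∀ a, b a ≠ 0 → IsUnit a) ∧
      (M • FreeAbelianGroup.of (Complex.exp (2 * Real.pi * Complex.I / N) ^ c.val) -
        ∑ a : ZMod N, b a • FreeAbelianGroup.of (Complex.exp (2 * Real.pi * Complex.I / N) ^ a.val)) ∈
        AddSubgroup.closure dilogRelators :=
  -- CLOSED: Theorems/HyperbolicBlochZagierDilogarithmConjectureStubCyclotomicSpanning.lean (p137204, c5 wave 1)
  Summit.KontsevichZagierPeriods.HyperbolicBloch.ZagierDilogarithmCyclotomic.stub_cyclotomicSpanning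

/-- **Stub (c5): vanishing Galois twists kill a primitive upper-half combination.** If `m : ℤ/N → ℤ` is
supported on the units of the open upper half and `Σ_c m_c D(ζ_N^{ac}) = 0` for every unit `a`, then `m = 0`
— steps (2)–(4) of c4's `stub_cyclotomicIndependence` run from the twists directly (pair with odd `χ`,
`Λ_N(χ̄) ≠ 0`, odd Fourier inversion, support). -/
theorem stub_eqZeroOfTwists :
    ∀ (N : ℕ) [NeZero N] (m : ZMod N → ℤ), (∀ c, m c ≠ 0 → IsUnit c ∧ 0 < c.val ∧ 2 * c.val < N) →
      (∀ a : (ZMod N)ˣ, ∑ c : ZMod N, (m c : ℝ) *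
          blochWignerDilog (Complex.exp (2 * Real.pi * Complex.I / N) ^ ((a : ZMod N) * c).val) = 0) →
        ∀ c, m c = 0 :=
  -- CLOSED: Theorems/HyperbolicBlochZagierDilogarithmConjectureStubEqZeroOfTwists.lean (p136778, c5 wave 1)
  Summit.KontsevichZagierPeriods.HyperbolicBloch.ZagierDilogarithmCyclotomic.stub_eqZeroOfTwists

/-- **Stub (c5): folding to the primitive upper half (UNCONDITIONAL).** Given the spanning statement, every
`x = Σ_c m_c[ζ_N^c] ∈ ℤ[μ_N]` has a positive multiple congruent modulo `⟨dilogRelators⟩` to a combination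
supported on the units of the OPEN UPPER half: span each `[ζ^c]` by units, then fold `[ζ^{−a}] = [conj ζ^a]`
with the conjugation relator `[ζ^a] + [ζ̄^a]` (for `N ≤ 2` the units are real points, real relators). -/
theorem stub_cyclotomicFolding :
    (∀ (N : ℕ) [NeZero N] (c : ZMod N), ∃ M : ℕ, 0 < M ∧ ∃ b : ZMod N → ℤ, (∀ a, b a ≠ 0 → IsUnit a) ∧
      (M • FreeAbelianGroup.of (Complex.exp (2 * Real.pi * Complex.I / N) ^ c.val) -
        ∑ a : ZMod N, b a • FreeAbelianGroup.of (Complex.exp (2 * Real.pi * Complex.I / N) ^ a.val)) ∈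
        AddSubgroup.closure dilogRelators) →
    ∀ (N : ℕ) [NeZero N] (m : ZMod N → ℤ), ∃ M : ℕ, 0 < M ∧ ∃ b : ZMod N → ℤ,
      (∀ a, b a ≠ 0 → IsUnit a ∧ 0 < a.val ∧ 2 * a.val < N) ∧
      (M • ∑ c : ZMod N, m c • FreeAbelianGroup.of (Complex.exp (2 * Real.pi * Complex.I / N) ^ c.val) -
        ∑ a : ZMod N, b a • FreeAbelianGroup.of (Complex.exp (2 * Real.pi * Complex.I / N) ^ a.val)) ∈
        AddSubgroup.closure dilogRelators :=
  -- CLOSED: Theorems/HyperbolicBlochZagierDilogarithmConjectureStubCyclotomicFolding.lean (p137228, c5 wave 1)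
  Summit.KontsevichZagierPeriods.HyperbolicBloch.ZagierDilogarithmCyclotomic.stub_cyclotomicFolding

/-- **Stub (c5): Galois descent on the roots of unity WITHOUT Borel, torsion form (UNCONDITIONAL).** Given
folding and `stub_eqZeroOfTwists`: if all Galois-twisted volumes `Σ_c m_c D(ζ_N^{ac})` (`a` a unit) of
`x = Σ_c m_c[ζ_N^c]` vanish, then a positive multiple of `x` lies in `⟨dilogRelators⟩`: fold `M·x ≡ y`
(primitive upper-half support); the twisted volumes of `M·x − y ∈ ⟨dilogRelators⟩` vanish
(`stub_cyclotomicTwists`), hence those of `y`; so `y = 0`. The converse is `stub_cyclotomicTwists`. -/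
theorem stub_cyclotomicTorsionDescent :
    (∀ (N : ℕ) [NeZero N] (m : ZMod N → ℤ), ∃ M : ℕ, 0 < M ∧ ∃ b : ZMod N → ℤ,
      (∀ a, b a ≠ 0 → IsUnit a ∧ 0 < a.val ∧ 2 * a.val < N) ∧
      (M • ∑ c : ZMod N, m c • FreeAbelianGroup.of (Complex.exp (2 * Real.pi * Complex.I / N) ^ c.val) -
        ∑ a : ZMod N, b a • FreeAbelianGroup.of (Complex.exp (2 * Real.pi * Complex.I / N) ^ a.val)) ∈
        AddSubgroup.closure dilogRelators) →
    (∀ (N : ℕ) [NeZero N] (m : ZMod N → ℤ), (∀ c, m c ≠ 0 → IsUnit c ∧ 0 < c.val ∧ 2 * c.val < N) →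
      (∀ a : (ZMod N)ˣ, ∑ c : ZMod N, (m c : ℝ) *
          blochWignerDilog (Complex.exp (2 * Real.pi * Complex.I / N) ^ ((a : ZMod N) * c).val) = 0) →
        ∀ c, m c = 0) →
    ∀ (N : ℕ) [NeZero N] (m : ZMod N → ℤ),
      (∀ a : (ZMod N)ˣ, ∑ c : ZMod N, (m c : ℝ) *
          blochWignerDilog (Complex.exp (2 * Real.pi * Complex.I / N) ^ ((a : ZMod N) * c).val) = 0) →
        ∃ M : ℕ, 0 < M ∧
          M • ∑ c : ZMod N, m c • FreeAbelianGroup.of (Complex.exp (2 * Real.pi * Complex.I / N) ^ c.val) ∈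
            AddSubgroup.closure dilogRelators :=
  -- CLOSED: Theorems/HyperbolicBlochZagierDilogarithmConjectureStubCyclotomicTorsionDescent.lean (p136833, c5 wave 1)
  Summit.KontsevichZagierPeriods.HyperbolicBloch.ZagierDilogarithmCyclotomic.stub_cyclotomicTorsionDescent

/-- **Stub (c5): the full cyclotomic sector at level `N`, torsion form, is EQUIVALENT to Milnor_N
(UNCONDITIONAL; every `N`, composite included).** Given folding: [every `ℤ`-relation `Σ nᵢ D(uᵢ) = 0` among
`N`-th roots of unity `uᵢ ∈ ℍ⁺` (imprimitive ones allowed) has a positive multiple of `Σ nᵢ[uᵢ]` in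
`⟨dilogRelators⟩`] ⇔ [the `D(ζ_N^c)`, `(c, N) = 1`, `0 < c < N/2`, are `ℤ`-independent]. `⇐`: fold
`M·Σ nᵢ[uᵢ] ≡ y` (primitive upper half), apply the value map (sound on the relators): `D(y) = 0`, so `y = 0`
by Milnor_N. `⇒`: a primitive relation gets `M·Σ m_c[ζ^c] ∈ ⟨dilogRelators⟩`, and `stub_cyclotomicIndependence`
(c4) gives `M·m = 0`. Upgrades c4's `stub_cyclotomicPrimeSector_iff` from prime to arbitrary level. -/
theorem stub_cyclotomicSectorTorsion_iff :
    (∀ (N : ℕ) [NeZero N] (m : ZMod N → ℤ), ∃ M : ℕ, 0 < M ∧ ∃ b : ZMod N → ℤ,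
      (∀ a, b a ≠ 0 → IsUnit a ∧ 0 < a.val ∧ 2 * a.val < N) ∧
      (M • ∑ c : ZMod N, m c • FreeAbelianGroup.of (Complex.exp (2 * Real.pi * Complex.I / N) ^ c.val) -
        ∑ a : ZMod N, b a • FreeAbelianGroup.of (Complex.exp (2 * Real.pi * Complex.I / N) ^ a.val)) ∈
        AddSubgroup.closure dilogRelators) →
    ∀ (N : ℕ) [NeZero N],
      (∀ (k : ℕ) (u : Fin k → ℂ) (n : Fin k → ℤ), (∀ i, u i ^ N = 1) → (∀ i, 0 < (u i).im) →
          ∑ i, (n i : ℝ) * blochWignerDilog (u i) = 0 →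
            ∃ M : ℕ, 0 < M ∧ M • (∑ i, n i • FreeAbelianGroup.of (u i)) ∈ AddSubgroup.closure dilogRelators) ↔
        (∀ m : ZMod N → ℤ, (∀ c, m c ≠ 0 → IsUnit c ∧ 0 < c.val ∧ 2 * c.val < N) →
          ∑ c : ZMod N, (m c : ℝ) *
              blochWignerDilog (Complex.exp (2 * Real.pi * Complex.I / N) ^ c.val) = 0 →
            ∀ c, m c = 0) :=
  -- CLOSED: Theorems/HyperbolicBlochZagierDilogarithmConjectureStubCyclotomicSectorTorsionIff.lean (p136913, c5 wave 1)
  Summit.KontsevichZagierPeriods.HyperbolicBloch.ZagierDilogarithmCyclotomic.stub_cyclotomicSectorTorsion_iff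

/-- **Stub (c5): all roots of unity at once.** Given the level-wise equivalence: [every `ℤ`-relation among
`D`-values of roots of unity of ℍ⁺ (any orders) has a positive multiple of its formal combination in
`⟨dilogRelators⟩`] ⇔ [Milnor_N for every `N`] — a relation among roots of unity of orders `Nᵢ` is a relation
among `L`-th roots of unity, `L = Π Nᵢ`. The torsion cyclotomic sector of Zagier's conjecture is exactly the
conjunction of all Milnor conjectures. -/
theorem stub_allRootsOfUnity_iff :
    (∀ (N : ℕ) [NeZero N],
      (∀ (k : ℕ) (u : Fin k → ℂ) (n : Fin k → ℤ), (∀ i, u i ^ N = 1) → (∀ i, 0 < (u i).im) →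
          ∑ i, (n i : ℝ) * blochWignerDilog (u i) = 0 →
            ∃ M : ℕ, 0 < M ∧ M • (∑ i, n i • FreeAbelianGroup.of (u i)) ∈ AddSubgroup.closure dilogRelators) ↔
        (∀ m : ZMod N → ℤ, (∀ c, m c ≠ 0 → IsUnit c ∧ 0 < c.val ∧ 2 * c.val < N) →
          ∑ c : ZMod N, (m c : ℝ) *
              blochWignerDilog (Complex.exp (2 * Real.pi * Complex.I / N) ^ c.val) = 0 →
            ∀ c, m c = 0)) →
    ((∀ (k : ℕ) (u : Fin k → ℂ) (n : Fin k → ℤ), (∀ i, ∃ N : ℕ, 0 < N ∧ u i ^ N = 1) →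
        (∀ i, 0 < (u i).im) → ∑ i, (n i : ℝ) * blochWignerDilog (u i) = 0 →
          ∃ M : ℕ, 0 < M ∧ M • (∑ i, n i • FreeAbelianGroup.of (u i)) ∈ AddSubgroup.closure dilogRelators) ↔
      ∀ (N : ℕ) [NeZero N] (m : ZMod N → ℤ), (∀ c, m c ≠ 0 → IsUnit c ∧ 0 < c.val ∧ 2 * c.val < N) →
        ∑ c : ZMod N, (m c : ℝ) *
            blochWignerDilog (Complex.exp (2 * Real.pi * Complex.I / N) ^ c.val) = 0 →
          ∀ c, m c = 0) :=
  -- CLOSED: Theorems/HyperbolicBlochZagierDilogarithmConjectureStubAllRootsOfUnityIff.lean (p136804, c5 wave 1)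
  Summit.KontsevichZagierPeriods.HyperbolicBloch.ZagierDilogarithmCyclotomic.stub_allRootsOfUnity_iff

/-- **Stub (c5, NAMED FACT, not a prover target): Borel's rank theorem for the Bloch group** — for a number
field `F`, any `m > r₂(F)` elements of `ℤ⟨F ∖ {0,1}⟩` with vanishing rational Bloch symbols (wedge pairings)
are `ℤ`-linearly dependent in `P(F)` modulo torsion: `dim_ℚ B(F) ⊗ ℚ ≤ r₂` (Borel 1977 + Suslin 1991;
Neumann 1998 Thm. 3.2: `B(k)/torsion` is a full lattice in `ℝ^{r₂}`; the tree's
`Borel1977_blochGroup_regulator_kernel_torsion` is the kernel half). Discharged only by the Literature fact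
`Borel1977_blochGroup_rank_le` (landed by c5, p137418); the abelian sector is CONDITIONAL on it (and on Dupont). -/
theorem stub_borelRankFact : Borel1977_blochGroup_rank_le := by
  sorry

/-- **Stub (c5 — the lead's): abelian propagation.** Under Borel's rank theorem: if Milnor's conjecture holds
at level `N`, then every Dehn-zero relation `Σ nᵢ D(zᵢ) = 0` among points `zᵢ = Σₘ qᵢₘ ζ_Nᵐ ∈ ℚ(ζ_N) ∩ ℍ⁺`
PROPAGATES to every Galois twist: `Σ nᵢ (D(σ zᵢ) − D(σ z̄ᵢ)) = 0` for all `σ : ℚ̄ → ℂ`. Proof: in the number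
field `K = ℚ(ζ_N)` (`r₂ = φ(N)/2`) the element `ξ = Σ nᵢ([zᵢ] − [z̄ᵢ])` and the `φ(N)/2` classes `[ζ^c]`
(`c` a unit of the upper half) have vanishing Bloch symbols, so `a₀ξ + Σ a_c[ζ^c]` is torsion in `P(K)` for
some `(a₀, a) ≠ 0`; pushing along each embedding and applying `D`: `a₀ D(τ_*ξ) + Σ a_c D(ζ^{jc}) = 0`.
`a₀ = 0` is excluded by `stub_cyclotomicIndependence`; at `τ = id` the volume hypothesis and Milnor_N give
`a = 0`; hence `D(τ_*ξ) = 0` for every `τ`. -/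
theorem stub_abelianPropagation :
    Borel1977_blochGroup_rank_le →
    ∀ (N : ℕ) [NeZero N],
      (∀ m : ZMod N → ℤ, (∀ c, m c ≠ 0 → IsUnit c ∧ 0 < c.val ∧ 2 * c.val < N) →
          ∑ c : ZMod N, (m c : ℝ) *
              blochWignerDilog (Complex.exp (2 * Real.pi * Complex.I / N) ^ c.val) = 0 →
            ∀ c, m c = 0) →
      ∀ (k : ℕ) (z : Fin k → ℂ) (n : Fin k → ℤ) (q : Fin k → Fin N → ℚ),
        (∀ i, z i = ∑ m : Fin N, (q i m : ℂ) * Complex.exp (2 * Real.pi * Complex.I / N) ^ (m : ℕ)) →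
        (∀ i, 0 < (z i).im) →
        (∀ u v : Additive ℂˣ →+ ℚ, dehn u v (∑ i, n i • FreeAbelianGroup.of (z i)) = 0) →
        ∑ i, (n i : ℝ) * blochWignerDilog (z i) = 0 →
          ∀ (σ : ↥(algebraicClosure ℚ ℂ) →ₐ[ℚ] ℂ) (w w' : Fin k → ↥(algebraicClosure ℚ ℂ)),
            (∀ i, (w i : ℂ) = z i) → (∀ i, (w' i : ℂ) = conj (z i)) →
            ∑ i, (n i : ℝ) * (blochWignerDilog (σ (w i)) - blochWignerDilog (σ (w' i))) = 0 :=
  -- CLOSED: Theorems/HyperbolicBlochZagierDilogarithmConjectureStubAbelianPropagation.lean (p138827, c5 LEAD)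
  Summit.KontsevichZagierPeriods.HyperbolicBloch.ZagierDilogarithmCyclotomic.stub_abelianPropagation

/-- **Stub (c5): the abelian Dehn-zero sector is Milnor's conjecture (mod Dupont and abelian propagation).**
Given Dupont's criterion and the propagation statement of `stub_abelianPropagation` (for every level): for
every `N`, [every Dehn-zero `ℤ`-relation among `D`-values of points of `ℚ(ζ_N) ∩ ℍ⁺` is explained by
`⟨dilogRelators⟩`] ⇔ Milnor_N. `⇐`: propagation + `stub_galoisDescent`. `⇒`: roots of unity are cyclotomic
points with zero Dehn invariant (torsion symbols), and an explained primitive combination vanishes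
(`stub_cyclotomicIndependence`). -/
theorem stub_abelianSector_iff :
    Dupont2001_preBloch_relation_of_invariants →
    (∀ (N : ℕ) [NeZero N],
      (∀ m : ZMod N → ℤ, (∀ c, m c ≠ 0 → IsUnit c ∧ 0 < c.val ∧ 2 * c.val < N) →
          ∑ c : ZMod N, (m c : ℝ) *
              blochWignerDilog (Complex.exp (2 * Real.pi * Complex.I / N) ^ c.val) = 0 →
            ∀ c, m c = 0) →
      ∀ (k : ℕ) (z : Fin k → ℂ) (n : Fin k → ℤ) (q : Fin k → Fin N → ℚ),
        (∀ i, z i = ∑ m : Fin N, (q i m : ℂ) * Complex.exp (2 * Real.pi * Complex.I / N) ^ (m : ℕ)) →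
        (∀ i, 0 < (z i).im) →
        (∀ u v : Additive ℂˣ →+ ℚ, dehn u v (∑ i, n i • FreeAbelianGroup.of (z i)) = 0) →
        ∑ i, (n i : ℝ) * blochWignerDilog (z i) = 0 →
          ∀ (σ : ↥(algebraicClosure ℚ ℂ) →ₐ[ℚ] ℂ) (w w' : Fin k → ↥(algebraicClosure ℚ ℂ)),
            (∀ i, (w i : ℂ) = z i) → (∀ i, (w' i : ℂ) = conj (z i)) →
            ∑ i, (n i : ℝ) * (blochWignerDilog (σ (w i)) - blochWignerDilog (σ (w' i))) = 0) →
    ∀ (N : ℕ) [NeZero N],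
      (∀ (k : ℕ) (z : Fin k → ℂ) (n : Fin k → ℤ) (q : Fin k → Fin N → ℚ),
          (∀ i, z i = ∑ m : Fin N, (q i m : ℂ) * Complex.exp (2 * Real.pi * Complex.I / N) ^ (m : ℕ)) →
          (∀ i, 0 < (z i).im) →
          (∀ u v : Additive ℂˣ →+ ℚ, dehn u v (∑ i, n i • FreeAbelianGroup.of (z i)) = 0) →
          ∑ i, (n i : ℝ) * blochWignerDilog (z i) = 0 →
            (∑ i, n i • FreeAbelianGroup.of (z i)) ∈ AddSubgroup.closure dilogRelators) ↔
        (∀ m : ZMod N → ℤ, (∀ c, m c ≠ 0 → IsUnit c ∧ 0 < c.val ∧ 2 * c.val < N) →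
          ∑ c : ZMod N, (m c : ℝ) *
              blochWignerDilog (Complex.exp (2 * Real.pi * Complex.I / N) ^ c.val) = 0 →
            ∀ c, m c = 0) :=
  -- CLOSED: Theorems/HyperbolicBlochZagierDilogarithmConjectureStubAbelianSectorIff.lean (p136911, c5 wave 1)
  Summit.KontsevichZagierPeriods.HyperbolicBloch.ZagierDilogarithmCyclotomic.stub_abelianSector_iff

/-! ### c5 wave 2: importable consequences (compositions of the landed c5 stubs) -/

/-- **Stub (c5 wave 2): the full cyclotomic sector at level `N` (torsion form) ⇔ Milnor_N, UNCONDITIONALLY** —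
`stub_cyclotomicSectorTorsion_iff` with its folding hypothesis discharged by `stub_cyclotomicFolding ∘
stub_cyclotomicSpanning`. Every level, composite included (c4 had the prime levels). -/
theorem stub_cyclotomicSector_iff_milnor :
    ∀ (N : ℕ) [NeZero N],
      (∀ (k : ℕ) (u : Fin k → ℂ) (n : Fin k → ℤ), (∀ i, u i ^ N = 1) → (∀ i, 0 < (u i).im) →
          ∑ i, (n i : ℝ) * blochWignerDilog (u i) = 0 →
            ∃ M : ℕ, 0 < M ∧ M • (∑ i, n i • FreeAbelianGroup.of (u i)) ∈ AddSubgroup.closure dilogRelators) ↔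
        (∀ m : ZMod N → ℤ, (∀ c, m c ≠ 0 → IsUnit c ∧ 0 < c.val ∧ 2 * c.val < N) →
          ∑ c : ZMod N, (m c : ℝ) *
              blochWignerDilog (Complex.exp (2 * Real.pi * Complex.I / N) ^ c.val) = 0 →
            ∀ c, m c = 0) :=
  -- CLOSED: Theorems/HyperbolicBlochZagierDilogarithmConjectureStubCyclotomicSectorIffMilnor.lean (p138051, c5 wave 2)
  Summit.KontsevichZagierPeriods.HyperbolicBloch.ZagierDilogarithmCyclotomic.stub_cyclotomicSector_iff_milnor

/-- **Stub (c5 wave 2): Galois descent on the roots of unity, iff form, UNCONDITIONALLY.** For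
`x = Σ_c m_c[ζ_N^c] ∈ ℤ[μ_N]`: a positive multiple of `x` lies in `⟨dilogRelators⟩` iff all its Galois-twisted
volumes `Σ_c m_c D(ζ_N^{ac})` (`a` a unit) vanish (`⇒` `stub_cyclotomicTwists` on `M·x`; `⇐`
`stub_cyclotomicTorsionDescent` with folding and `stub_eqZeroOfTwists` discharged). On `μ_N` the line's Galois
descent needs neither Borel nor Dupont. -/
theorem stub_cyclotomicDescent_iff :
    ∀ (N : ℕ) [NeZero N] (m : ZMod N → ℤ),
      (∃ M : ℕ, 0 < M ∧
          M • ∑ c : ZMod N, m c • FreeAbelianGroup.of (Complex.exp (2 * Real.pi * Complex.I / N) ^ c.val) ∈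
            AddSubgroup.closure dilogRelators) ↔
        ∀ a : (ZMod N)ˣ, ∑ c : ZMod N, (m c : ℝ) *
          blochWignerDilog (Complex.exp (2 * Real.pi * Complex.I / N) ^ ((a : ZMod N) * c).val) = 0 :=
  -- CLOSED: Theorems/HyperbolicBlochZagierDilogarithmConjectureStubCyclotomicDescentIff.lean (p138102, c5 wave 2)
  Summit.KontsevichZagierPeriods.HyperbolicBloch.ZagierDilogarithmCyclotomic.stub_cyclotomicDescent_iff

/-- **Stub (c5 wave 2): all roots of unity at once ⇔ all Milnor conjectures, UNCONDITIONALLY** —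
`stub_allRootsOfUnity_iff` with its level-wise hypothesis discharged by `stub_cyclotomicSector_iff_milnor`. -/
theorem stub_allRootsOfUnity_iff_milnor :
    (∀ (k : ℕ) (u : Fin k → ℂ) (n : Fin k → ℤ), (∀ i, ∃ N : ℕ, 0 < N ∧ u i ^ N = 1) →
        (∀ i, 0 < (u i).im) → ∑ i, (n i : ℝ) * blochWignerDilog (u i) = 0 →
          ∃ M : ℕ, 0 < M ∧ M • (∑ i, n i • FreeAbelianGroup.of (u i)) ∈ AddSubgroup.closure dilogRelators) ↔
      ∀ (N : ℕ) [NeZero N] (m : ZMod N → ℤ), (∀ c, m c ≠ 0 → IsUnit c ∧ 0 < c.val ∧ 2 * c.val < N) →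
        ∑ c : ZMod N, (m c : ℝ) *
            blochWignerDilog (Complex.exp (2 * Real.pi * Complex.I / N) ^ c.val) = 0 →
          ∀ c, m c = 0 :=
  -- CLOSED: Theorems/HyperbolicBlochZagierDilogarithmConjectureStubAllRootsOfUnityIffMilnor.lean (p138103, c5 wave 2)
  Summit.KontsevichZagierPeriods.HyperbolicBloch.ZagierDilogarithmCyclotomic.stub_allRootsOfUnity_iff_milnor

/-- **Stub (c5 wave 2): the exact cyclotomic sector, mod Suslin.** Under Suslin's unique divisibility of
`P(ℚ̄)` (saturation of `⟨dilogRelators⟩`, `stub_saturation`), the EXACT level-`N` sector of the crux (membership,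
not just a positive multiple) is equivalent to Milnor_N — `crux|μ_N ⇔ Milnor_N` for every `N`. -/
theorem stub_cyclotomicSectorExact_iff_milnor :
    Suslin1991_preBloch_isUniquelyDivisible →
    ∀ (N : ℕ) [NeZero N],
      (∀ (k : ℕ) (u : Fin k → ℂ) (n : Fin k → ℤ), (∀ i, u i ^ N = 1) → (∀ i, 0 < (u i).im) →
          ∑ i, (n i : ℝ) * blochWignerDilog (u i) = 0 →
            (∑ i, n i • FreeAbelianGroup.of (u i)) ∈ AddSubgroup.closure dilogRelators) ↔
        (∀ m : ZMod N → ℤ, (∀ c, m c ≠ 0 → IsUnit c ∧ 0 < c.val ∧ 2 * c.val < N) →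
          ∑ c : ZMod N, (m c : ℝ) *
              blochWignerDilog (Complex.exp (2 * Real.pi * Complex.I / N) ^ c.val) = 0 →
            ∀ c, m c = 0) :=
  -- CLOSED: Theorems/HyperbolicBlochZagierDilogarithmConjectureStubCyclotomicSectorExactIffMilnor.lean (p138096, c5 wave 2)
  Summit.KontsevichZagierPeriods.HyperbolicBloch.ZagierDilogarithmCyclotomic.stub_cyclotomicSectorExact_iff_milnor

/-- **Stub (c5 wave 2): Milnor's conjecture at level 5 is ONE irrationality statement.** `(ℤ/5)ˣ ∩ (0, 5/2) =
{1, 2}` and `D > 0` on `ℍ⁺`, so Milnor_5 (ℤ-independence of `D(ζ₅), D(ζ₅²)`) says exactly that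
`D(ζ₅²)/D(ζ₅) = Cl₂(4π/5)/Cl₂(2π/5)` is irrational — the first open case of the line's Galois propagation
(over `ℚ(ζ₅)`, `r₂ = 2`). -/
theorem stub_milnorFive_iff_irrational :
    (∀ m : ZMod 5 → ℤ, (∀ c, m c ≠ 0 → IsUnit c ∧ 0 < c.val ∧ 2 * c.val < 5) →
          ∑ c : ZMod 5, (m c : ℝ) *
              blochWignerDilog (Complex.exp (2 * Real.pi * Complex.I / 5) ^ c.val) = 0 →
            ∀ c, m c = 0) ↔
      Irrational (blochWignerDilog (Complex.exp (2 * Real.pi * Complex.I / 5) ^ 2) /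
        blochWignerDilog (Complex.exp (2 * Real.pi * Complex.I / 5))) :=
  -- CLOSED: Theorems/HyperbolicBlochZagierDilogarithmConjectureStubMilnorFiveIffIrrational.lean (p138271, c5 wave 2)
  Summit.KontsevichZagierPeriods.HyperbolicBloch.ZagierDilogarithmCyclotomic.stub_milnorFive_iff_irrational

/-- **Stub (c5 wave 3): the abelian Dehn-zero sector ⇔ Milnor_N (mod Dupont + Borel rank)** —
`stub_abelianSector_iff` with the propagation hypothesis discharged by `stub_abelianPropagation`. -/
theorem stub_abelianSector_iff_milnor :
    Dupont2001_preBloch_relation_of_invariants → Borel1977_blochGroup_rank_le →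
    ∀ (N : ℕ) [NeZero N],
      (∀ (k : ℕ) (z : Fin k → ℂ) (n : Fin k → ℤ) (q : Fin k → Fin N → ℚ),
          (∀ i, z i = ∑ m : Fin N, (q i m : ℂ) * Complex.exp (2 * Real.pi * Complex.I / N) ^ (m : ℕ)) →
          (∀ i, 0 < (z i).im) →
          (∀ u v : Additive ℂˣ →+ ℚ, dehn u v (∑ i, n i • FreeAbelianGroup.of (z i)) = 0) →
          ∑ i, (n i : ℝ) * blochWignerDilog (z i) = 0 →
            (∑ i, n i • FreeAbelianGroup.of (z i)) ∈ AddSubgroup.closure dilogRelators) ↔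
        (∀ m : ZMod N → ℤ, (∀ c, m c ≠ 0 → IsUnit c ∧ 0 < c.val ∧ 2 * c.val < N) →
          ∑ c : ZMod N, (m c : ℝ) *
              blochWignerDilog (Complex.exp (2 * Real.pi * Complex.I / N) ^ c.val) = 0 →
            ∀ c, m c = 0) :=
  -- CLOSED: Theorems/HyperbolicBlochZagierDilogarithmConjectureStubAbelianSectorIffMilnor.lean (p139285, c5 wave 3)
  Summit.KontsevichZagierPeriods.HyperbolicBloch.ZagierDilogarithmCyclotomic.stub_abelianSector_iff_milnor

/-- **Stub (c5 wave 3, route level): the abelian Dehn-zero sub-sector of Conjecture 1 on ideal tetrahedra,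
mod Dupont + Borel rank + Milnor_N.** For the standard tetrahedral representations `ρ`: every Dehn-zero
`ℤ`-relation among the periods `vol T(zᵢ)`, `zᵢ ∈ ℚ(ζ_N) ∩ ℍ⁺`, is a KZ relation — TetraSector's conclusion
(what `closes` consumes from `hZ`) on the abelian Dehn-zero sector, from `stub_abelianPropagation` and c2's
`stub_galoisSubSector`. -/
theorem stub_abelianKZ_of_milnor :
    Dupont2001_preBloch_relation_of_invariants → Borel1977_blochGroup_rank_le →
    ∀ (N : ℕ) [NeZero N], (∀ m : ZMod N → ℤ, (∀ c, m c ≠ 0 → IsUnit c ∧ 0 < c.val ∧ 2 * c.val < N) →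
          ∑ c : ZMod N, (m c : ℝ) *
              blochWignerDilog (Complex.exp (2 * Real.pi * Complex.I / N) ^ c.val) = 0 →
            ∀ c, m c = 0) →
    ∀ (T : ℂ → Set (Fin 3 → ℝ)), (∀ z, T z = {p | 0 < p 1 ∧ z.re * p 1 < z.im * p 0 ∧
      z.im * (p 0 - 1) < (z.re - 1) * p 1 ∧ 0 < p 2 ∧
      0 < z.im * (p 0 ^ 2 + p 1 ^ 2 + p 2 ^ 2 - p 0) + (z.re - Complex.normSq z) * p 1}) →
    ∀ (ρ : ℂ → KZ.IntegralRep 3), (∀ z, IsAlgebraic ℚ z → 0 < z.im →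
      (ρ z).domain = T z ∧ Set.EqOn (ρ z).integrand (fun p => 1 / p 2 ^ 3) (T z)) →
    ∀ (k : ℕ) (z : Fin k → ℂ) (n : Fin k → ℤ) (q : Fin k → Fin N → ℚ),
      (∀ i, z i = ∑ m : Fin N, (q i m : ℂ) * Complex.exp (2 * Real.pi * Complex.I / N) ^ (m : ℕ)) →
      (∀ i, 0 < (z i).im) →
      (∀ u v : Additive ℂˣ →+ ℚ, dehn u v (∑ i, n i • FreeAbelianGroup.of (z i)) = 0) →
      ∑ i, (n i : ℝ) * (ρ (z i)).value = 0 →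
        (∑ i, n i • KZ.of (ρ (z i))) ∈ KZ.relations :=
  -- CLOSED: Theorems/HyperbolicBlochZagierDilogarithmConjectureStubAbelianKZOfMilnor.lean (p139306, c5 wave 3)
  Summit.KontsevichZagierPeriods.HyperbolicBloch.ZagierDilogarithmCyclotomic.stub_abelianKZ_of_milnor

/-- **Stub (c5 wave 3): the abelian Dehn-zero sector in torsion form, mod BOREL ALONE.** Under both halves of
Borel's theorem for the Bloch group (kernel: `Borel1977_blochGroup_regulator_kernel_torsion`; rank:
`Borel1977_blochGroup_rank_le` — Neumann 1998 Thm. 3.2) and Milnor_N: every Dehn-zero relation among points of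
`ℚ(ζ_N) ∩ ℍ⁺` has a positive multiple of its formal combination in `⟨dilogRelators⟩` — `stub_abelianPropagation` feeds
gen-2's `stub_numberFieldDescent` (no Dupont, no Suslin). -/
theorem stub_abelianSectorTorsion_of_milnor :
    Borel1977_blochGroup_regulator_kernel_torsion → Borel1977_blochGroup_rank_le →
    ∀ (N : ℕ) [NeZero N], (∀ m : ZMod N → ℤ, (∀ c, m c ≠ 0 → IsUnit c ∧ 0 < c.val ∧ 2 * c.val < N) →
          ∑ c : ZMod N, (m c : ℝ) *
              blochWignerDilog (Complex.exp (2 * Real.pi * Complex.I / N) ^ c.val) = 0 →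
            ∀ c, m c = 0) →
      ∀ (k : ℕ) (z : Fin k → ℂ) (n : Fin k → ℤ) (q : Fin k → Fin N → ℚ),
        (∀ i, z i = ∑ m : Fin N, (q i m : ℂ) * Complex.exp (2 * Real.pi * Complex.I / N) ^ (m : ℕ)) →
        (∀ i, 0 < (z i).im) →
        (∀ u v : Additive ℂˣ →+ ℚ, dehn u v (∑ i, n i • FreeAbelianGroup.of (z i)) = 0) →
        ∑ i, (n i : ℝ) * blochWignerDilog (z i) = 0 →
          ∃ M : ℕ, 0 < M ∧ M • (∑ i, n i • FreeAbelianGroup.of (z i)) ∈ AddSubgroup.closure dilogRelators :=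
  -- CLOSED: Theorems/HyperbolicBlochZagierDilogarithmConjectureStubAbelianSectorTorsionOfMilnor.lean (p139313, c5 wave 3)
  Summit.KontsevichZagierPeriods.HyperbolicBloch.ZagierDilogarithmCyclotomic.stub_abelianSectorTorsion_of_milnor

/-! ### c5 cycle 2: the two-point levels `N = 8, 12` — Milnor_N as ONE irrationality of two volumes -/

/-- **Stub (c5 cycle 2): Milnor_12 is the irrationality of vol(Whitehead link)/vol(figure-eight knot).**
`(ℤ/12)ˣ ∩ (0, 6) = {1, 5}`; the distribution relations of `D` at `x = ζ₁₂` give `3(D(ζ₁₂) + D(ζ₁₂⁵)) = 4D(i) = 4G`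
(`N = 3`, `ζ₁₂⁹ = −i`) and `2(D(ζ₁₂) − D(ζ₁₂⁵)) = D(ζ₆)` (`N = 2`, `ζ₁₂⁷ = conj ζ₁₂⁵`), so `span_ℤ{D(ζ₁₂), D(ζ₁₂⁵)}` and
`span_ℤ{G, D(ζ₆)}` have the same rank: Milnor_12 ⇔ `G/D(ζ₆) = D(i)/D(e^{2πi/6}) ∉ ℚ` — Catalan's constant over the
Gieseking constant `Cl₂(π/3)`, i.e. `vol(Whitehead link complement) = 4G` over `vol(figure-eight knot complement) =
2D(ζ₆)` up to the factor 2: a well-known open irrationality, here identified with a sector of the crux. -/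
theorem stub_milnorTwelve_iff_irrational :
    (∀ m : ZMod 12 → ℤ, (∀ c, m c ≠ 0 → IsUnit c ∧ 0 < c.val ∧ 2 * c.val < 12) →
          ∑ c : ZMod 12, (m c : ℝ) *
              blochWignerDilog (Complex.exp (2 * Real.pi * Complex.I / 12) ^ c.val) = 0 →
            ∀ c, m c = 0) ↔
      Irrational (blochWignerDilog Complex.I / blochWignerDilog (Complex.exp (2 * Real.pi * Complex.I / 6))) :=
  -- CLOSED: Theorems/HyperbolicBlochZagierDilogarithmConjectureStubMilnorTwelveIffIrrational.lean (p139401, c5 wave 3)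
  Summit.KontsevichZagierPeriods.HyperbolicBloch.ZagierDilogarithmCyclotomic.stub_milnorTwelve_iff_irrational

/-- **Stub (c5 cycle 2): Milnor_8 is the irrationality of `G/D(ζ₈)`.** `(ℤ/8)ˣ ∩ (0, 4) = {1, 3}` and the
distribution relation at `x = ζ₈` (`N = 2`, `ζ₈⁵ = conj ζ₈³`) gives `2(D(ζ₈) − D(ζ₈³)) = D(i) = G`, so Milnor_8 ⇔
`D(i)/D(ζ₈) ∉ ℚ` (Catalan's constant over `Cl₂(π/4)`). -/
theorem stub_milnorEight_iff_irrational :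
    (∀ m : ZMod 8 → ℤ, (∀ c, m c ≠ 0 → IsUnit c ∧ 0 < c.val ∧ 2 * c.val < 8) →
          ∑ c : ZMod 8, (m c : ℝ) *
              blochWignerDilog (Complex.exp (2 * Real.pi * Complex.I / 8) ^ c.val) = 0 →
            ∀ c, m c = 0) ↔
      Irrational (blochWignerDilog Complex.I / blochWignerDilog (Complex.exp (2 * Real.pi * Complex.I / 8))) :=
  -- CLOSED: Theorems/HyperbolicBlochZagierDilogarithmConjectureStubMilnorEightIffIrrational.lean (p139111, c5 wave 3)
  Summit.KontsevichZagierPeriods.HyperbolicBloch.ZagierDilogarithmCyclotomic.stub_milnorEight_iff_irrational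

/-! ### c5 cycle 2: certificate #2 — the octagonal relation `β₈` over `ℚ(ζ₈)` (formal five-term certificate, UNCONDITIONAL)

Registered so that the generated certificate files (`…OctCertOne…Four`, `…OctCertIdentity`, `…StubOctagonalMembership`; lead c5,
scripts `scratch/oct/*.py`: `{2,3}`-unit search over `ℚ(ζ₈)`, exact sparse solve, emitter in the format of c3's heptagonal files)
land as `--supports` files. -/

/-- **Stub (c5 cycle 2, certificate #2): part/identity `oct_cert_part1` of the octagonal five-term certificate** — an identity in
`𝒫(F)` (`F` algebraically closed, char `0`, `Z⁴ = −1`) generated by `scratch/oct/gen.py`/`gen2.py`. -/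
theorem oct_cert_part1 : ∀ {F : Type*} [Field F] [IsAlgClosed F] [CharZero F] (Z : F) (hΦ : Z ^ 4 + 1 = 0), (-18 : ℤ) • PreBloch.sym ((2 : F) * Z + (-3 : F) * Z ^ 2 + (2 : F) * Z ^ 3) + (10 : ℤ) • PreBloch.sym ((-1 : F)) + (-10 : ℤ) • PreBloch.sym ((2 / 3 : F) * Z + (-1 / 3 : F) * Z ^ 2 + (-2 / 3 : F) * Z ^ 3) + (10 : ℤ) • PreBloch.sym ((-2 : F) * Z + (-3 : F) * Z ^ 2 + (-2 : F) * Z ^ 3) + (-10 : ℤ) • PreBloch.sym ((-2 / 3 : F) * Z + (-1 / 3 : F) * Z ^ 2 + (2 / 3 : F) * Z ^ 3) + (36 : ℤ) • PreBloch.sym ((-1 : F) + (1 : F) * Z + (-1 : F) * Z ^ 3) + (8 : ℤ) • PreBloch.sym ((-1 / 2 : F) + (-1 / 2 : F) * Z + (1 / 2 : F) * Z ^ 2 + (1 / 2 : F) * Z ^ 3) + (8 : ℤ) • PreBloch.sym ((-1 / 2 : F) + (-3 / 2 : F) * Z + (-1 / 2 : F) * Z ^ 2 + (1 / 2 : F)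 * Z ^ 3) + (-8 : ℤ) • PreBloch.sym ((-1 : F) * Z) + (8 : ℤ) • PreBloch.sym ((-1 : F) + (-1 : F) * Z + (-1 : F) * Z ^ 2) + (-28 : ℤ) • PreBloch.sym ((-1 : F) + (2 : F) * Z ^ 2 + (2 : F) * Z ^ 3) + (-28 : ℤ) • PreBloch.sym ((-1 : F) + (1 : F) * Z ^ 2 + (-2 : F) * Z ^ 3) + (28 : ℤ) • PreBloch.sym ((-3 : F) + (-3 : F) * Z + (3 : F) * Z ^ 3) + (-28 : ℤ) • PreBloch.sym ((-1 : F) + (2 : F) * Z ^ 2 + (-2 : F) * Z ^ 3) + (-28 : ℤ) • PreBloch.sym ((-1 : F) + (2 : F) * Z + (-1 : F) * Z ^ 2) + (-8 : ℤ) • PreBloch.sym ((-1 : F) * Z ^ 2) + (-20 : ℤ) • PreBloch.sym ((-1 : F) * Z ^ 3) + (-20 : ℤ) • PreBloch.sym ((-1 : F) * Z + (-1 : F) * Z ^ 2) + (20 : ℤ) • PreBloch.sym ((-1 : F) + (-1 : F) * Z + (1 : F) * Z ^ 3) + (20 : ℤ) • PreBloch.sym ((-1 : F) * Z + (1 : F)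 * Z ^ 2 + (-1 : F) * Z ^ 3) = 0 :=
  -- CLOSED: Theorems/HyperbolicBlochZagierDilogarithmConjectureOctCertOne.lean (p140874)
  Summit.KontsevichZagierPeriods.HyperbolicBloch.ZagierDilogarithmCertificate.oct_cert_part1

/-- **Stub (c5 cycle 2, certificate #2): part/identity `oct_cert_part2` of the octagonal five-term certificate** — an identity in
`𝒫(F)` (`F` algebraically closed, char `0`, `Z⁴ = −1`) generated by `scratch/oct/gen.py`/`gen2.py`. -/
theorem oct_cert_part2 : ∀ {F : Type*} [Field F] [IsAlgClosed F] [CharZero F] (Z : F) (hΦ : Z ^ 4 + 1 = 0), (-32 : ℤ) • PreBloch.sym ((-1 : F) + (1 : F) * Z + (-1 : F) * Z ^ 3) + (12 : ℤ) • PreBloch.sym ((-1 / 2 : F) + (1 / 2 : F) * Z + (1 / 2 : F) * Z ^ 2 + (-1 / 2 : F) * Z ^ 3) + (12 : ℤ) • PreBloch.sym ((-1 : F) * Z ^ 3) + (-12 : ℤ) • PreBloch.sym ((-1 : F) + (1 : F) * Z ^ 2 + (-2 : F) * Z ^ 3) + (-12 : ℤ) • PreBloch.sym ((1 / 2 : F)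 * Z ^ 2 + (1 / 2 : F) * Z ^ 3) + (8 : ℤ) • PreBloch.sym ((-1 / 3 : F) + (2 / 3 : F) * Z ^ 2 + (-2 / 3 : F) * Z ^ 3) + (20 : ℤ) • PreBloch.sym ((-1 / 2 : F) * Z + (-1 / 2 : F) * Z ^ 3) + (-20 : ℤ) • PreBloch.sym ((-1 : F) * Z + (1 : F) * Z ^ 2 + (-1 : F) * Z ^ 3) + (-12 : ℤ) • PreBloch.sym ((-1 / 2 : F) * Z + (-1 / 2 : F) * Z ^ 2) + (12 : ℤ) • PreBloch.sym ((-1 / 3 : F) + (-1 / 3 : F) * Z + (1 / 3 : F) * Z ^ 2 + (1 : F) * Z ^ 3) + (-52 : ℤ) • PreBloch.sym ((-1 : F) + (-1 : F) * Z + (1 : F) * Z ^ 3) + (8 : ℤ) • PreBloch.sym ((-1 : F) + (1 : F) * Z + (1 : F) * Z ^ 3) + (-20 : ℤ) • PreBloch.sym ((-1 : F) + (2 : F) * Z + (-2 : F) * Z ^ 2) + (20 : ℤ) • PreBloch.sym ((2 / 3 : F) * Z + (-1 / 3 : F) * Z ^ 2 + (-2 / 3 : F) * Z ^ 3) + (-20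 : ℤ) • PreBloch.sym ((-1 : F) + (2 : F) * Z + (-1 : F) * Z ^ 2) + (20 : ℤ) • PreBloch.sym ((-1 / 2 : F) + (-1 / 2 : F) * Z + (-1 / 2 : F) * Z ^ 2 + (1 / 2 : F) * Z ^ 3) + (-20 : ℤ) • PreBloch.sym ((-1 : F) + (-2 : F) * Z + (-1 : F) * Z ^ 2) + (20 : ℤ) • PreBloch.sym ((-1 : F) * Z) = 0 :=
  -- CLOSED: Theorems/HyperbolicBlochZagierDilogarithmConjectureOctCertTwo.lean (p140879)
  Summit.KontsevichZagierPeriods.HyperbolicBloch.ZagierDilogarithmCertificate.oct_cert_part2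

/-- **Stub (c5 cycle 2, certificate #2): part/identity `oct_cert_part3` of the octagonal five-term certificate** — an identity in
`𝒫(F)` (`F` algebraically closed, char `0`, `Z⁴ = −1`) generated by `scratch/oct/gen.py`/`gen2.py`. -/
theorem oct_cert_part3 : ∀ {F : Type*} [Field F] [IsAlgClosed F] [CharZero F] (Z : F) (hΦ : Z ^ 4 + 1 = 0), (28 : ℤ) • PreBloch.sym ((-1 : F) + (-2 : F) * Z + (-1 : F) * Z ^ 2) + (28 : ℤ) • PreBloch.sym ((-1 : F) + (2 : F) * Z ^ 2 + (2 : F) * Z ^ 3) + (-20 : ℤ) • PreBloch.sym ((-1 / 2 : F) * Z + (-1 / 2 : F) * Z ^ 3) + (8 : ℤ) • PreBloch.sym ((-1 : F) * Z ^ 2) + (-28 : ℤ) • PreBloch.sym ((-1 : F) + (-1 : F) * Z + (1 : F) * Z ^ 3) + (28 : ℤ) • PreBloch.sym ((-1 : F) + (1 : F) * Z + (-1 : F) * Z ^ 3) + (12 : ℤ) • PreBloch.sym ((-1 : F) * Z + (-1 : F) * Z ^ 2 + (-1 : F) * Z ^ 3) + (20 : ℤ) • PreBloch.sym ((-1 :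 F) * Z + (-1 : F) * Z ^ 2) + (-20 : ℤ) • PreBloch.sym ((-1 : F) * Z) + (-8 : ℤ) • PreBloch.sym ((-1 / 2 : F) + (-1 / 2 : F) * Z + (-1 / 2 : F) * Z ^ 2 + (1 / 2 : F) * Z ^ 3) + (8 : ℤ) • PreBloch.sym ((-2 : F) * Z + (-3 : F) * Z ^ 2 + (-2 : F) * Z ^ 3) + (8 : ℤ) • PreBloch.sym ((-1 / 2 : F) + (-1 / 2 : F) * Z + (1 / 2 : F) * Z ^ 2 + (3 / 2 : F) * Z ^ 3) + (-8 : ℤ) • PreBloch.sym ((-1 / 2 : F) + (1 / 2 : F) * Z + (1 / 2 : F) * Z ^ 2 + (-1 / 2 : F) * Z ^ 3) + (8 : ℤ) • PreBloch.sym ((-1 : F) + (2 : F) * Z ^ 2 + (-2 : F) * Z ^ 3) + (-8 : ℤ) • PreBloch.sym ((-1 : F) + (-1 : F) * Z + (-1 : F) * Z ^ 2) + (8 : ℤ) • PreBloch.sym ((-2 : F)) + (-8 : ℤ) • PreBloch.sym ((-1 / 3 : F) + (2 / 3 : F) * Z ^ 2 + (-2 / 3 : F) * Z ^ 3) = 0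 :=
  -- CLOSED: Theorems/HyperbolicBlochZagierDilogarithmConjectureOctCertThree.lean (p140882)
  Summit.KontsevichZagierPeriods.HyperbolicBloch.ZagierDilogarithmCertificate.oct_cert_part3

/-- **Stub (c5 cycle 2, certificate #2): part/identity `oct_cert_part4` of the octagonal five-term certificate** — an identity in
`𝒫(F)` (`F` algebraically closed, char `0`, `Z⁴ = −1`) generated by `scratch/oct/gen.py`/`gen2.py`. -/
theorem oct_cert_part4 : ∀ {F : Type*} [Field F] [IsAlgClosed F] [CharZero F] (Z : F) (hΦ : Z ^ 4 + 1 = 0), (-4 : ℤ) • PreBloch.sym ((-1 / 2 : F) + (1 / 2 : F) * Z + (1 / 2 : F) * Z ^ 2 + (-1 / 2 : F) * Z ^ 3) + (12 : ℤ) • PreBloch.sym ((-1 / 3 : F) + (-1 : F) * Z + (-1 / 3 : F) * Z ^ 2 + (1 / 3 : F) * Z ^ 3) + (-4 : ℤ) • PreBloch.sym ((-1 / 2 : F) + (-1 / 2 : F) * Z + (1 / 2 : F) * Z ^ 2 + (1 / 2 : F) * Z ^ 3) + (-4 : ℤ) • PreBloch.sym ((-1 : F) * Z + (1 : F) * Z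 ^ 2 + (-1 : F) * Z ^ 3) + (-8 : ℤ) • PreBloch.sym ((-1 : F) + (-2 : F) * Z + (-1 : F) * Z ^ 2) + (-8 : ℤ) • PreBloch.sym ((-1 / 2 : F) + (-1 / 2 : F) * Z + (-1 / 2 : F) * Z ^ 2 + (1 / 2 : F) * Z ^ 3) + (4 : ℤ) • PreBloch.sym ((-2 / 3 : F) + (-1 / 3 : F) * Z + (-1 / 3 : F) * Z ^ 3) + (-8 : ℤ) • PreBloch.sym ((-1 : F) + (-2 : F) * Z + (1 : F) * Z ^ 3) + (8 : ℤ) • PreBloch.sym ((-1 : F) + (2 : F) * Z + (-1 : F) * Z ^ 2) + (-8 : ℤ) • PreBloch.sym ((-1 : F) * Z + (-1 : F) * Z ^ 2 + (-1 : F) * Z ^ 3) + (-8 : ℤ) • PreBloch.sym ((-1 : F) + (-1 : F) * Z + (2 : F) * Z ^ 3) + (8 : ℤ) • PreBloch.sym ((-1 : F) + (-1 : F) * Z + (-1 : F) * Z ^ 3) + (-10 : ℤ) • PreBloch.sym ((2 / 3 : F) * Z + (-1 / 3 : F) * Z ^ 2 + (-2 / 3 : F) * Z ^ 3) + (10 :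 ℤ) • PreBloch.sym ((-2 / 3 : F) * Z + (-1 / 3 : F) * Z ^ 2 + (2 / 3 : F) * Z ^ 3) + (9 : ℤ) • PreBloch.sym ((1 / 2 : F) + (-1 : F) * Z + (-1 : F) * Z ^ 3) + (4 : ℤ) • PreBloch.sym ((1 / 2 : F) + (-5 / 4 : F) * Z + (-5 / 4 : F) * Z ^ 3) + (4 : ℤ) • PreBloch.sym ((-2 / 3 : F) + (1 / 3 : F) * Z + (1 / 3 : F) * Z ^ 3) = 0 :=
  -- CLOSED: Theorems/HyperbolicBlochZagierDilogarithmConjectureOctCertFour.lean (p140883)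
  Summit.KontsevichZagierPeriods.HyperbolicBloch.ZagierDilogarithmCertificate.oct_cert_part4

/-- **Stub (c5 cycle 2, certificate #2): part/identity `oct_cert_identity` of the octagonal five-term certificate** — an identity in
`𝒫(F)` (`F` algebraically closed, char `0`, `Z⁴ = −1`) generated by `scratch/oct/gen.py`/`gen2.py`. -/
theorem oct_cert_identity : ∀ {F : Type*} [Field F] [IsAlgClosed F] [CharZero F] (Z : F) (hΦ : Z ^ 4 + 1 = 0), (8 : ℤ) • PreBloch.sym ((1 : F) * Z) + (8 : ℤ) • PreBloch.sym ((1 : F) * Z ^ 3) + (-9 : ℤ) • PreBloch.sym ((1 / 2 : F) + (1 : F) * Z + (1 : F) * Z ^ 3) + (-4 : ℤ) • PreBloch.sym ((1 / 2 : F) + (5 / 4 : F) * Z + (5 / 4 : F) * Z ^ 3) + (-18 : ℤ) • (PreBloch.sym ((2 : F) * Z + (-3 : F) * Z ^ 2 + (2 : F) * Z ^ 3) + PreBloch.sym ((-2 : F) * Z + (3 : F) * Z ^ 2 + (-2 : F) * Z ^ 3)) + (4 : ℤ) • (PreBloch.sym ((-1 / 2 : F) + (-1 / 2 : F) * Z +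 (1 / 2 : F) * Z ^ 2 + (1 / 2 : F) * Z ^ 3) + PreBloch.sym ((-1 / 2 : F) + (-1 / 2 : F) * Z + (-1 / 2 : F) * Z ^ 2 + (1 / 2 : F) * Z ^ 3)) + (8 : ℤ) • (PreBloch.sym ((-1 / 2 : F) + (-3 / 2 : F) * Z + (-1 / 2 : F) * Z ^ 2 + (1 / 2 : F) * Z ^ 3) + PreBloch.sym ((-1 / 2 : F) + (-1 / 2 : F) * Z + (1 / 2 : F) * Z ^ 2 + (3 / 2 : F) * Z ^ 3)) + (-40 : ℤ) • (PreBloch.sym ((-1 : F) + (1 : F) * Z ^ 2 + (-2 : F) * Z ^ 3) + PreBloch.sym ((-1 : F) + (2 : F) * Z + (-1 : F) * Z ^ 2)) + (-20 : ℤ) • (PreBloch.sym ((-1 : F) + (2 : F) * Z ^ 2 + (-2 : F) * Z ^ 3) + PreBloch.sym ((-1 : F) + (2 : F) * Z + (-2 : F) * Z ^ 2)) + (-4 : ℤ) • (PreBloch.sym ((-1 : F) * Z + (1 : F) * Z ^ 2 + (-1 : F) * Z ^ 3) + PreBloch.sym ((1 : F) * Z + (-1 : F) * Z ^ 2 + (1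 : F) * Z ^ 3)) + (-12 : ℤ) • (PreBloch.sym ((1 / 2 : F) * Z ^ 2 + (1 / 2 : F) * Z ^ 3) + PreBloch.sym ((-1 / 2 : F) * Z + (-1 / 2 : F) * Z ^ 2)) + (12 : ℤ) • (PreBloch.sym ((-1 / 3 : F) + (-1 / 3 : F) * Z + (1 / 3 : F) * Z ^ 2 + (1 : F) * Z ^ 3) + PreBloch.sym ((-1 / 3 : F) + (-1 : F) * Z + (-1 / 3 : F) * Z ^ 2 + (1 / 3 : F) * Z ^ 3)) + (8 : ℤ) • (PreBloch.sym ((-1 : F) + (1 : F) * Z + (1 : F) * Z ^ 3) + PreBloch.sym ((-1 : F) + (-1 : F) * Z + (-1 : F) * Z ^ 3)) + (4 : ℤ) • (PreBloch.sym ((-2 / 3 : F) + (-1 / 3 : F) * Z + (-1 / 3 : F) * Z ^ 3) + PreBloch.sym ((-2 / 3 : F) + (1 / 3 : F) * Z + (1 / 3 : F) * Z ^ 3)) + (-8 : ℤ) • (PreBloch.sym ((-1 : F) + (-2 : F) * Z + (1 : F) * Z ^ 3) + PreBloch.sym ((-1 : F) + (-1 : F) * Z + (2 : F) * Z ^ 3))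 + (10 : ℤ) • PreBloch.sym ((-1 : F)) + (32 : ℤ) • PreBloch.sym ((-1 : F) + (1 : F) * Z + (-1 : F) * Z ^ 3) + (28 : ℤ) • PreBloch.sym ((-3 : F) + (-3 : F) * Z + (3 : F) * Z ^ 3) + (-60 : ℤ) • PreBloch.sym ((-1 : F) + (-1 : F) * Z + (1 : F) * Z ^ 3) + (8 : ℤ) • PreBloch.sym ((-2 : F)) = 0 :=
  -- CLOSED: Theorems/HyperbolicBlochZagierDilogarithmConjectureOctCertIdentity.lean (p143651)
  Summit.KontsevichZagierPeriods.HyperbolicBloch.ZagierDilogarithmCertificate.oct_cert_identity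

/-- **Stub (c5 cycle 2, certificate #2): the octagonal relation is explained UNCONDITIONALLY** —
`8[ζ₈] + 8[ζ₈³] − 9[(1+2√2·i)/2] − 4[(2+5√2·i)/4] ∈ ⟨dilogRelators⟩` (value shadow `9D(w₁) + 4D(w₂) = 8(D(ζ₈) + D(ζ₈³))`,
`w₁ = (1+2√−2)/2`, `w₂ = (2+5√−2)/4`, Bloch group of `ℚ(√−2)` inside `ℚ(ζ₈)`, two complex places): lead c3's deferred certificate
#2, by the formal certificate `oct_cert_identity` pushed forward to `ℤ[ℂ]` — no Borel, no Dupont, no numerics. -/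
theorem stub_octagonalMembership :
    ((8 : ℤ) • FreeAbelianGroup.of (Complex.exp (2 * Real.pi * Complex.I / 8)) +
          (8 : ℤ) • FreeAbelianGroup.of (Complex.exp (2 * Real.pi * Complex.I / 8) ^ 3) -
          (9 : ℤ) • FreeAbelianGroup.of ((1 + 2 * (Real.sqrt 2 : ℂ) * Complex.I) / 2) -
          (4 : ℤ) • FreeAbelianGroup.of ((2 + 5 * (Real.sqrt 2 : ℂ) * Complex.I) / 4)) ∈
        AddSubgroup.closure dilogRelators :=
  -- CLOSED: Theorems/HyperbolicBlochZagierDilogarithmConjectureStubOctagonalMembership.lean (p143867)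
  Summit.KontsevichZagierPeriods.HyperbolicBloch.ZagierDilogarithmCertificate.stub_octagonalMembership

/-! ### c5 cycle 3: corollaries of the sector calculus (antitone, crux ⇒ irrationalities) and certificate #3 (Gaussian circle relation). -/

/-- **Stub (c5 cycle 3): Milnor's conjecture is ANTITONE in the level.** If `N ∣ M` then Milnor_M implies Milnor_N:
by `stub_cyclotomicSector_iff_milnor` Milnor_M is the level-`M` cyclotomic sector (torsion form) of the crux, which contains
the level-`N` sector (`u ^ N = 1 → u ^ M = 1`), which is Milnor_N. (Classically this needs Bass' theorem on the universal
odd distribution; here it is free from the sector calculus.) In particular `∀ N, Milnor_N ⇔ ∀ n, Milnor_{n!}`. -/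
theorem stub_milnor_antitone :
    ∀ (N M : ℕ) [NeZero N] [NeZero M], N ∣ M →
      (∀ m : ZMod M → ℤ, (∀ c, m c ≠ 0 → IsUnit c ∧ 0 < c.val ∧ 2 * c.val < M) →
          ∑ c : ZMod M, (m c : ℝ) *
              blochWignerDilog (Complex.exp (2 * Real.pi * Complex.I / M) ^ c.val) = 0 →
            ∀ c, m c = 0) →
        ∀ m : ZMod N → ℤ, (∀ c, m c ≠ 0 → IsUnit c ∧ 0 < c.val ∧ 2 * c.val < N) →
          ∑ c : ZMod N, (m c : ℝ) *
              blochWignerDilog (Complex.exp (2 * Real.pi * Complex.I / N) ^ c.val) = 0 →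
            ∀ c, m c = 0 :=
  -- CLOSED: Theorems/HyperbolicBlochZagierDilogarithmConjectureStubMilnorAntitone.lean (p141533)
  Summit.KontsevichZagierPeriods.HyperbolicBloch.ZagierDilogarithmCyclotomic.stub_milnor_antitone

/-- **Stub (c5 cycle 3): the crux implies three classical open irrationalities.** Zagier's dilogarithm conjecture implies
Milnor_N for every `N` (`crux_implies_milnor`, c4), and Milnor_5, Milnor_8, Milnor_12 are respectively the irrationality of
`Cl₂(4π/5)/Cl₂(2π/5)`, of `G/Cl₂(π/4)` (`G = D(i)` Catalan's constant) and of `G/Cl₂(π/3)` (= `vol(Whitehead link)/(2·vol(4₁))`,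
the ratio of the volumes of the Whitehead link and figure-eight knot complements up to the factor 2) — c5's
`stub_milnorFive/Eight/Twelve_iff_irrational`. So the route's transcendence input already decides these three open
problems. -/
theorem stub_crux_irrational :
    Theses.HyperbolicBloch.ZagierDilogarithmConjecture →
      Irrational (blochWignerDilog (Complex.exp (2 * Real.pi * Complex.I / 5) ^ 2) /
          blochWignerDilog (Complex.exp (2 * Real.pi * Complex.I / 5))) ∧
        Irrational (blochWignerDilog Complex.I / blochWignerDilog (Complex.exp (2 * Real.pi * Complex.I / 8))) ∧
          Irrational (blochWignerDilog Complex.I / blochWignerDilog (Complex.exp (2 * Real.pi * Complex.I / 6))) :=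
  -- CLOSED: Theorems/HyperbolicBlochZagierDilogarithmConjectureStubCruxIrrational.lean (p141541)
  Summit.KontsevichZagierPeriods.HyperbolicBloch.ZagierDilogarithmCyclotomic.stub_crux_irrational

/-- **Stub (c5 cycle 3, certificate #3): the Gaussian certificate identity in `𝒫(F)`** (`F` algebraically closed, char `0`,
`Z² = −1`): target form + 2 conjugation pairs + 1 real symbol = the part-sum of 3 five-term instances with `{1+i, 2±i}`-unit
arguments (generated by `scratch/gauss/gen.py`, `gen2.py`). -/
theorem gauss_cert_identity : ∀ {F : Type*} [Field F] [IsAlgClosed F] [CharZero F] (Z : F) (hΦ : Z ^ 2 + 1 = 0), (6 : ℤ) • PreBloch.sym ((1 : F) * Z) + (-2 : ℤ) • PreBloch.sym ((4 / 5 : F) + (3 / 5 : F) * Z) + (-3 : ℤ) • PreBloch.sym ((3 / 5 : F) + (4 / 5 : F) * Z) + (-1 : ℤ) • PreBloch.sym ((-3 / 5 : F) + (4 / 5 : F) * Z) + (1 : ℤ) • (PreBloch.sym ((-1 / 2 : F) * Z) + PreBloch.sym ((1 / 2 : F) * Z)) + (2 : ℤ) • (PreBloch.sym ((-1 : F) +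 (-1 : F) * Z) + PreBloch.sym ((-1 : F) + (1 : F) * Z)) + (-1 : ℤ) • PreBloch.sym ((-1 : F)) = 0 :=
  -- CLOSED: Theorems/HyperbolicBlochZagierDilogarithmConjectureGaussCertificate.lean (p141267)
  Summit.KontsevichZagierPeriods.HyperbolicBloch.ZagierDilogarithmCertificate.gauss_cert_identity

/-- **Stub (c5 cycle 3, certificate #3): the Gaussian circle relation is explained UNCONDITIONALLY** —
`6[i] − 2[(4+3i)/5] − 3[(3+4i)/5] − [(−3+4i)/5] ∈ ⟨dilogRelators⟩` (value shadow `2D((4+3i)/5) + 3D((3+4i)/5) + D((−3+4i)/5)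
= 6G`; one of the Bloch-group relations of the disprover's circle sweep j012999, there explained only via Borel + Suslin):
by `gauss_cert_identity` pushed forward to `ℤ[ℂ]`. -/
theorem stub_gaussianMembership :
    ((6 : ℤ) • FreeAbelianGroup.of Complex.I - (2 : ℤ) • FreeAbelianGroup.of ((4 + 3 * Complex.I) / 5) -
          (3 : ℤ) • FreeAbelianGroup.of ((3 + 4 * Complex.I) / 5) -
          FreeAbelianGroup.of ((-3 + 4 * Complex.I) / 5)) ∈
        AddSubgroup.closure dilogRelators :=
  -- CLOSED: Theorems/HyperbolicBlochZagierDilogarithmConjectureStubGaussianMembership.lean (p141840)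
  Summit.KontsevichZagierPeriods.HyperbolicBloch.ZagierDilogarithmCertificate.stub_gaussianMembership

/-! ### c5 cycle 4: the Gaussian exceptional-unit sector (UNCONDITIONAL Dehn-zero sector on the 15 classes of the 147 exceptional
units of ℤ[i,1/10]; W = V ⊕ ℚ[i]; details in the docstrings below, in Lines/kummer_clausen_linearisation.md and cycle reports). -/

/-- **Registered stub `gsec_instances_one`**: the 6 five-term instances of this file (conjunction). [cite: Neumann1998, eq. (2.3)] -/
theorem gsec_instances_one :
    (∀ {F : Type*} [Field F] [IsAlgClosed F] [CharZero F] (Z : F) (hΦ : Z ^ 2 + 1 = 0), (1 : ℤ) • PreBloch.sym ((-1 / 2 : F) * Z) + (-1 : ℤ) • PreBloch.sym ((-1 : F)) + (-1 : ℤ) • PreBloch.sym ((-1 : F) * Z) + (-1 : ℤ) • PreBloch.sym ((-1 : F) + (2 : F) * Z) + (-1 : ℤ) • PreBloch.sym ((-1 : F) + (-1 : F) * Z) = 0) ∧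
    (∀ {F : Type*} [Field F] [IsAlgClosed F] [CharZero F] (Z : F) (hΦ : Z ^ 2 + 1 = 0), (-1 : ℤ) • PreBloch.sym ((-2 : F) + (4 : F) * Z) + (-1 : ℤ) • PreBloch.sym ((-1 : F)) + (1 : ℤ) • PreBloch.sym ((-1 : F) + (2 : F) * Z) + (-1 : ℤ) • PreBloch.sym ((-3 : F) + (4 : F) * Z) + (-1 : ℤ) • PreBloch.sym ((-6 / 5 : F) + (-2 / 5 : F) * Z) = 0) ∧
    (∀ {F : Type*} [Field F] [IsAlgClosed F] [CharZero F] (Z : F) (hΦ : Z ^ 2 + 1 = 0), (2 : ℤ) • PreBloch.sym ((-1 / 2 : F) * Z) + (2 : ℤ) • PreBloch.sym ((-1 : F) + (2 : F) * Z) + (-1 : ℤ) • PreBloch.sym ((-3 : F) + (-4 : F) * Z) = 0) ∧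
    (∀ {F : Type*} [Field F] [IsAlgClosed F] [CharZero F] (Z : F) (hΦ : Z ^ 2 + 1 = 0), (1 : ℤ) • PreBloch.sym ((-1 / 2 : F) * Z) + (-2 : ℤ) • PreBloch.sym ((-1 : F) * Z) + (2 : ℤ) • PreBloch.sym ((-1 : F) + (-1 : F) * Z) = 0) ∧
    (∀ {F : Type*} [Field F] [IsAlgClosed F] [CharZero F] (Z : F) (hΦ : Z ^ 2 + 1 = 0), (1 : ℤ) • PreBloch.sym ((1 / 2 : F) + (-1 : F) * Z) + (-1 : ℤ) • PreBloch.sym ((-1 : F) * Z) + (-1 : ℤ) • PreBloch.sym ((-1 : F) + (-1 : F) * Z) + (1 : ℤ) • PreBloch.sym ((1 / 2 : F) + (-3 / 2 : F) * Z) + (1 : ℤ) • PreBloch.sym ((-1 : F) + (1 : F) * Z) = 0) ∧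
    (∀ {F : Type*} [Field F] [IsAlgClosed F] [CharZero F] (Z : F) (hΦ : Z ^ 2 + 1 = 0), (-1 : ℤ) • PreBloch.sym ((-6 / 5 : F) + (2 / 5 : F) * Z) + (-1 : ℤ) • PreBloch.sym ((-1 / 2 : F) * Z) + (-1 : ℤ) • PreBloch.sym ((1 / 2 : F) + (-3 / 2 : F) * Z) + (1 : ℤ) • PreBloch.sym ((1 / 2 : F) + (-1 : F) * Z) + (1 : ℤ) • PreBloch.sym ((-1 : F) + (-1 : F) * Z) = 0) :=
  -- CLOSED: Theorems/HyperbolicBlochZagierDilogarithmConjectureGaussSectorInstancesOne.lean (p143645)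
  Summit.KontsevichZagierPeriods.HyperbolicBloch.ZagierDilogarithmCertificate.gsec_instances_one

/-- **Registered stub `gsec_instances_two`**: the 6 five-term instances of this file (conjunction). [cite: Neumann1998, eq. (2.3)] -/
theorem gsec_instances_two :
    (∀ {F : Type*} [Field F] [IsAlgClosed F] [CharZero F] (Z : F) (hΦ : Z ^ 2 + 1 = 0), (1 : ℤ) • PreBloch.sym ((-7 : F) + (24 : F) * Z) + (-2 : ℤ) • PreBloch.sym ((-3 : F) + (-4 : F) * Z) + (2 : ℤ) • PreBloch.sym ((-2 : F) + (-4 : F) * Z) = 0) ∧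
    (∀ {F : Type*} [Field F] [IsAlgClosed F] [CharZero F] (Z : F) (hΦ : Z ^ 2 + 1 = 0), (-1 : ℤ) • PreBloch.sym ((-7 / 25 : F) + (-24 / 25 : F) * Z) + (2 : ℤ) • PreBloch.sym ((-6 / 5 : F) + (2 / 5 : F) * Z) + (2 : ℤ) • PreBloch.sym ((-1 : F) + (-2 : F) * Z) = 0) ∧
    (∀ {F : Type*} [Field F] [IsAlgClosed F] [CharZero F] (Z : F) (hΦ : Z ^ 2 + 1 = 0), (1 : ℤ) • PreBloch.sym ((-1 / 2 : F) * Z) + (-1 : ℤ) • PreBloch.sym ((-2 : F) + (-1 : F) * Z) + (-1 : ℤ) • PreBloch.sym ((1 / 2 : F) + (-3 / 2 : F) * Z) + (1 : ℤ) • PreBloch.sym ((-1 : F) * Z) + (1 : ℤ) • PreBloch.sym ((-1 : F) + (1 : F) * Z) = 0) ∧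
    (∀ {F : Type*} [Field F] [IsAlgClosed F] [CharZero F] (Z : F) (hΦ : Z ^ 2 + 1 = 0), (1 : ℤ) • PreBloch.sym ((1 / 2 : F) + (-1 : F) * Z) + (-1 : ℤ) • PreBloch.sym ((1 / 2 : F) + (-3 / 2 : F) * Z) + (1 : ℤ) • PreBloch.sym ((-2 : F) + (-1 : F) * Z) + (-1 : ℤ) • PreBloch.sym ((1 / 2 : F) + (-7 / 2 : F) * Z) + (-1 : ℤ) • PreBloch.sym ((-2 : F) + (1 : F) * Z) = 0) ∧
    (∀ {F : Type*} [Field F] [IsAlgClosed F] [CharZero F] (Z : F) (hΦ : Z ^ 2 + 1 = 0), (1 : ℤ) • PreBloch.sym ((1 / 2 : F) + (-1 : F) * Z) + (-1 : ℤ) • PreBloch.sym ((-1 : F)) + (-1 : ℤ) • PreBloch.sym ((-1 / 2 : F) * Z) + (1 : ℤ) • PreBloch.sym ((-3 / 5 : F) + (-4 / 5 : F) * Z) + (-1 : ℤ) • PreBloch.sym ((-2 : F) * Z) = 0) ∧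
    (∀ {F : Type*} [Field F] [IsAlgClosed F] [CharZero F] (Z : F) (hΦ : Z ^ 2 + 1 = 0), (-1 : ℤ) • PreBloch.sym ((-6 / 5 : F) + (2 / 5 : F) * Z) + (1 : ℤ) • PreBloch.sym ((1 / 2 : F) + (-3 / 2 : F) * Z) + (1 : ℤ) • PreBloch.sym ((-6 / 5 : F) + (-2 / 5 : F) * Z) + (-1 : ℤ) • PreBloch.sym ((1 / 2 : F) + (-7 / 2 : F) * Z) + (-1 : ℤ) • PreBloch.sym ((1 / 2 : F) + (-11 / 4 : F) * Z) = 0) :=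
  -- CLOSED: Theorems/HyperbolicBlochZagierDilogarithmConjectureGaussSectorInstancesTwo.lean (p143646)
  Summit.KontsevichZagierPeriods.HyperbolicBloch.ZagierDilogarithmCertificate.gsec_instances_two

/-- **Registered stub `gsec_identities_one`**: the certificate identities of this file (conjunction). [cite: Neumann1998, eq. (2.3)] -/
theorem gsec_identities_one :
    (∀ {F : Type*} [Field F] [IsAlgClosed F] [CharZero F] (Z : F) (hΦ : Z ^ 2 + 1 = 0), (1 : ℤ) • PreBloch.sym ((-7 : F) + (24 : F) * Z) + (-22 : ℤ) • PreBloch.sym ((-1 / 2 : F) * Z) + (-4 : ℤ) • PreBloch.sym ((1 / 2 : F) + (-1 : F) * Z) + (24 : ℤ) • PreBloch.sym ((-1 : F) * Z) + (-2 : ℤ) • (PreBloch.sym ((-1 : F) + (-1 : F) * Z) + PreBloch.sym ((-1 : F) + (1 : F) * Z)) + (2 : ℤ) • (PreBloch.sym ((-2 : F) + (4 : F) * Z) + PreBloch.sym ((-2 : F) + (-4 : F) * Z)) + (2 : ℤ) • (PreBloch.sym ((-3 : F) + (4 : F) * Z) + PreBloch.sym ((-3 : F) + (-4 : F) * Z))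 + (2 : ℤ) • (PreBloch.sym ((-6 / 5 : F) + (-2 / 5 : F) * Z) + PreBloch.sym ((-6 / 5 : F) + (2 / 5 : F) * Z)) + (12 : ℤ) • PreBloch.sym ((-1 : F)) = 0) ∧
    (∀ {F : Type*} [Field F] [IsAlgClosed F] [CharZero F] (Z : F) (hΦ : Z ^ 2 + 1 = 0), (1 : ℤ) • PreBloch.sym ((-7 / 25 : F) + (-24 / 25 : F) * Z) + (4 : ℤ) • PreBloch.sym ((-1 / 2 : F) * Z) + (-4 : ℤ) • PreBloch.sym ((1 / 2 : F) + (-1 : F) * Z) + (-2 : ℤ) • (PreBloch.sym ((-1 : F) + (2 : F) * Z) + PreBloch.sym ((-1 : F) + (-2 : F) * Z)) + (-2 : ℤ) • (PreBloch.sym ((-1 : F) + (-1 : F) * Z) + PreBloch.sym ((-1 : F) + (1 : F) * Z)) + (-2 : ℤ) • PreBloch.sym ((-1 : F)) = 0) ∧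
    (∀ {F : Type*} [Field F] [IsAlgClosed F] [CharZero F] (Z : F) (hΦ : Z ^ 2 + 1 = 0), (2 : ℤ) • PreBloch.sym ((-6 / 5 : F) + (2 / 5 : F) * Z) + (1 : ℤ) • PreBloch.sym ((-1 / 2 : F) * Z) + (-4 : ℤ) • PreBloch.sym ((1 / 2 : F) + (-1 : F) * Z) + (4 : ℤ) • PreBloch.sym ((-1 : F) * Z) + (-2 : ℤ) • (PreBloch.sym ((-1 : F) + (-1 : F) * Z) + PreBloch.sym ((-1 : F) + (1 : F) * Z)) = 0) ∧
    (∀ {F : Type*} [Field F] [IsAlgClosed F] [CharZero F] (Z : F) (hΦ : Z ^ 2 + 1 = 0), (1 : ℤ) • PreBloch.sym ((-2 : F) + (4 : F) * Z) + (-6 : ℤ) • PreBloch.sym ((-1 / 2 : F) * Z) + (-2 : ℤ) • PreBloch.sym ((1 / 2 : F) + (-1 : F) * Z) + (8 : ℤ) • PreBloch.sym ((-1 : F) * Z) + (-1 : ℤ) • (PreBloch.sym ((-1 : F) + (-1 : F) * Z) + PreBloch.sym ((-1 : F) + (1 : F) * Z)) + (1 : ℤ) • (PreBloch.sym ((-3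 : F) + (4 : F) * Z) + PreBloch.sym ((-3 : F) + (-4 : F) * Z)) + (1 : ℤ) • (PreBloch.sym ((-6 / 5 : F) + (-2 / 5 : F) * Z) + PreBloch.sym ((-6 / 5 : F) + (2 / 5 : F) * Z)) + (4 : ℤ) • PreBloch.sym ((-1 : F)) = 0) ∧
    (∀ {F : Type*} [Field F] [IsAlgClosed F] [CharZero F] (Z : F) (hΦ : Z ^ 2 + 1 = 0), (2 : ℤ) • PreBloch.sym ((-2 : F) + (-1 : F) * Z) + (-5 : ℤ) • PreBloch.sym ((-1 / 2 : F) * Z) + (-2 : ℤ) • PreBloch.sym ((1 / 2 : F) + (-1 : F) * Z) + (6 : ℤ) • PreBloch.sym ((-1 : F) * Z) + (-4 : ℤ) • (PreBloch.sym ((-1 : F) + (-1 : F) * Z) + PreBloch.sym ((-1 : F) + (1 : F) * Z)) = 0) ∧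
    (∀ {F : Type*} [Field F] [IsAlgClosed F] [CharZero F] (Z : F) (hΦ : Z ^ 2 + 1 = 0), (1 : ℤ) • PreBloch.sym ((1 / 2 : F) + (-3 / 2 : F) * Z) + (1 : ℤ) • PreBloch.sym ((-1 / 2 : F) * Z) + (1 : ℤ) • PreBloch.sym ((1 / 2 : F) + (-1 : F) * Z) + (-3 : ℤ) • PreBloch.sym ((-1 : F) * Z) + (1 : ℤ) • (PreBloch.sym ((-1 : F) + (-1 : F) * Z) + PreBloch.sym ((-1 : F) + (1 : F) * Z)) = 0) :=
  -- CLOSED: Theorems/HyperbolicBlochZagierDilogarithmConjectureGaussSectorIdentitiesOne.lean (p143861)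
  Summit.KontsevichZagierPeriods.HyperbolicBloch.ZagierDilogarithmCertificate.gsec_identities_one

/-- **Registered stub `gsec_identities_two`**: the certificate identities of this file (conjunction). [cite: Neumann1998, eq. (2.3)] -/
theorem gsec_identities_two :
    (∀ {F : Type*} [Field F] [IsAlgClosed F] [CharZero F] (Z : F) (hΦ : Z ^ 2 + 1 = 0), (2 : ℤ) • PreBloch.sym ((-1 : F) + (-1 : F) * Z) + (1 : ℤ) • PreBloch.sym ((-1 / 2 : F) * Z) + (-2 : ℤ) • PreBloch.sym ((-1 : F) * Z) = 0) ∧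
    (∀ {F : Type*} [Field F] [IsAlgClosed F] [CharZero F] (Z : F) (hΦ : Z ^ 2 + 1 = 0), (2 : ℤ) • PreBloch.sym ((-1 : F) + (-2 : F) * Z) + (3 : ℤ) • PreBloch.sym ((-1 / 2 : F) * Z) + (-4 : ℤ) • PreBloch.sym ((-1 : F) * Z) + (-2 : ℤ) • (PreBloch.sym ((-1 : F) + (-2 : F) * Z) + PreBloch.sym ((-1 : F) + (2 : F) * Z)) + (-2 : ℤ) • PreBloch.sym ((-1 : F)) = 0) ∧
    (∀ {F : Type*} [Field F] [IsAlgClosed F] [CharZero F] (Z : F) (hΦ : Z ^ 2 + 1 = 0), (1 : ℤ) • PreBloch.sym ((1 / 2 : F) + (-7 / 2 : F) * Z) + (-6 : ℤ) • PreBloch.sym ((-1 / 2 : F) * Z) + (-4 : ℤ) • PreBloch.sym ((1 / 2 : F) + (-1 : F) * Z) + (9 : ℤ) • PreBloch.sym ((-1 : F) * Z) + (-5 : ℤ) • (PreBloch.sym ((-1 : F) + (-1 : F) * Z) + PreBloch.sym ((-1 : F) + (1 : F) * Z)) + (1 : ℤ) • (PreBloch.sym ((-2 : F) + (-1 : F)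 * Z) + PreBloch.sym ((-2 : F) + (1 : F) * Z)) = 0) ∧
    (∀ {F : Type*} [Field F] [IsAlgClosed F] [CharZero F] (Z : F) (hΦ : Z ^ 2 + 1 = 0), (1 : ℤ) • PreBloch.sym ((-3 : F) + (4 : F) * Z) + (5 : ℤ) • PreBloch.sym ((-1 / 2 : F) * Z) + (-4 : ℤ) • PreBloch.sym ((-1 : F) * Z) + (-1 : ℤ) • (PreBloch.sym ((-3 : F) + (4 : F) * Z) + PreBloch.sym ((-3 : F) + (-4 : F) * Z)) + (-2 : ℤ) • PreBloch.sym ((-1 : F)) = 0) ∧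
    (∀ {F : Type*} [Field F] [IsAlgClosed F] [CharZero F] (Z : F) (hΦ : Z ^ 2 + 1 = 0), (1 : ℤ) • PreBloch.sym ((-3 / 5 : F) + (-4 / 5 : F) * Z) + (-2 : ℤ) • PreBloch.sym ((-1 / 2 : F) * Z) + (1 : ℤ) • PreBloch.sym ((1 / 2 : F) + (-1 : F) * Z) + (1 : ℤ) • (PreBloch.sym ((-1 / 2 : F) * Z) + PreBloch.sym ((1 / 2 : F) * Z)) + (-1 : ℤ) • PreBloch.sym ((-1 : F)) = 0) ∧
    (∀ {F : Type*} [Field F] [IsAlgClosed F] [CharZero F] (Z : F) (hΦ : Z ^ 2 + 1 = 0), (1 : ℤ) • PreBloch.sym ((1 / 2 : F) + (-11 / 4 : F) * Z) + (6 : ℤ) • PreBloch.sym ((-1 / 2 : F) * Z) + (9 : ℤ) • PreBloch.sym ((1 / 2 : F) + (-1 : F) * Z) + (-16 : ℤ) • PreBloch.sym ((-1 : F) * Z) + (8 : ℤ) • (PreBloch.sym ((-1 : F) + (-1 : F) * Z) + PreBloch.sym ((-1 : F) + (1 : F) * Z)) + (-1 : ℤ) • (PreBloch.sym ((-6 / 5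 : F) + (2 / 5 : F) * Z) + PreBloch.sym ((-6 / 5 : F) + (-2 / 5 : F) * Z)) + (-1 : ℤ) • (PreBloch.sym ((-2 : F) + (-1 : F) * Z) + PreBloch.sym ((-2 : F) + (1 : F) * Z)) = 0) :=
  -- CLOSED: Theorems/HyperbolicBlochZagierDilogarithmConjectureGaussSectorIdentitiesTwo.lean (p143865)
  Summit.KontsevichZagierPeriods.HyperbolicBloch.ZagierDilogarithmCertificate.gsec_identities_two

/-- **Registered stub `gsec_points`**: the (new) conjugation identities of the Gaussian sector certificates, for any `ζ` with
`ζ² = −1`, `conj ζ = ζ⁷` (at `ζ = i`) (conjunction; the remaining points/pairs coincide with certificate #3's and are reused). [folklore] -/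
theorem gsec_points :
    ∀ ζ : ℂ, ζ ^ 2 + 1 = 0 → (starRingEnd ℂ) ζ = ζ ^ 7 →
      ((-2 : ℂ) + (-4 : ℂ) * ζ) = (starRingEnd ℂ) ((-2 : ℂ) + (4 : ℂ) * ζ) ∧
      ((-3 : ℂ) + (-4 : ℂ) * ζ) = (starRingEnd ℂ) ((-3 : ℂ) + (4 : ℂ) * ζ) ∧
      ((-6 / 5 : ℂ) + (2 / 5 : ℂ) * ζ) = (starRingEnd ℂ) ((-6 / 5 : ℂ) + (-2 / 5 : ℂ) * ζ) ∧
      ((-1 : ℂ) + (-2 : ℂ) * ζ) = (starRingEnd ℂ) ((-1 : ℂ) + (2 : ℂ) * ζ) ∧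
      ((-1 : ℂ) + (2 : ℂ) * ζ) = (starRingEnd ℂ) ((-1 : ℂ) + (-2 : ℂ) * ζ) ∧
      ((-2 : ℂ) + (1 : ℂ) * ζ) = (starRingEnd ℂ) ((-2 : ℂ) + (-1 : ℂ) * ζ) ∧
      ((-6 / 5 : ℂ) + (-2 / 5 : ℂ) * ζ) = (starRingEnd ℂ) ((-6 / 5 : ℂ) + (2 / 5 : ℂ) * ζ) :=
  -- CLOSED: Theorems/HyperbolicBlochZagierDilogarithmConjectureGaussSectorPoints.lean (p143647)
  Summit.KontsevichZagierPeriods.HyperbolicBloch.ZagierDilogarithmCertificate.gsec_points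

/-- **Registered stub `gsec_targets_one`** (Gaussian exceptional-unit sector, lead c5 cycle 4): the memberships `T_t ∈ ⟨dilogRelators⟩` for
`t ∈ {0, 1, 2, 3}` — explicit integer combinations of the class representatives `r_t`, `r₄ = −i/2`, `r₅ = (1−2i)/2`, `r₇ = −i` — each by a
formal five-term certificate (`gsec_identity_t`) pushed to `ℤ[ℂ]`; no Borel, no numerics. [cite: Neumann1998, §2.1 end (pp. 393–394)] -/
theorem gsec_targets_one :
    ((1 : ℤ) • FreeAbelianGroup.of ((-7 : ℂ) + (24 : ℂ) * Complex.I) + (-22 : ℤ) • FreeAbelianGroup.of ((-1 / 2 : ℂ) * Complex.I) + (-4 : ℤ) • FreeAbelianGroup.of ((1 / 2 : ℂ) + (-1 : ℂ) * Complex.I) + (24 : ℤ) • FreeAbelianGroup.of ((-1 : ℂ) * Complex.I) ∈ AddSubgroup.closure dilogRelators) ∧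
    ((1 : ℤ) • FreeAbelianGroup.of ((-7 / 25 : ℂ) + (-24 / 25 : ℂ) * Complex.I) + (4 : ℤ) • FreeAbelianGroup.of ((-1 / 2 : ℂ) * Complex.I) + (-4 : ℤ) • FreeAbelianGroup.of ((1 / 2 : ℂ) + (-1 : ℂ) * Complex.I) ∈ AddSubgroup.closure dilogRelators) ∧
    ((2 : ℤ) • FreeAbelianGroup.of ((-6 / 5 : ℂ) + (2 / 5 : ℂ) * Complex.I) + (1 : ℤ) • FreeAbelianGroup.of ((-1 / 2 : ℂ) * Complex.I) + (-4 : ℤ) • FreeAbelianGroup.of ((1 / 2 : ℂ) + (-1 : ℂ) * Complex.I) + (4 : ℤ) • FreeAbelianGroup.of ((-1 : ℂ) * Complex.I) ∈ AddSubgroup.closure dilogRelators) ∧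
    ((1 : ℤ) • FreeAbelianGroup.of ((-2 : ℂ) + (4 : ℂ) * Complex.I) + (-6 : ℤ) • FreeAbelianGroup.of ((-1 / 2 : ℂ) * Complex.I) + (-2 : ℤ) • FreeAbelianGroup.of ((1 / 2 : ℂ) + (-1 : ℂ) * Complex.I) + (8 : ℤ) • FreeAbelianGroup.of ((-1 : ℂ) * Complex.I) ∈ AddSubgroup.closure dilogRelators) :=
  -- CLOSED: Theorems/HyperbolicBlochZagierDilogarithmConjectureGaussSectorTargetsOne.lean (p144548)
  Summit.KontsevichZagierPeriods.HyperbolicBloch.ZagierDilogarithmCertificate.gsec_targets_one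

/-- **Registered stub `gsec_targets_two`** (Gaussian exceptional-unit sector, lead c5 cycle 4): the memberships `T_t ∈ ⟨dilogRelators⟩` for
`t ∈ {6, 8, 9, 10}` — explicit integer combinations of the class representatives `r_t`, `r₄ = −i/2`, `r₅ = (1−2i)/2`, `r₇ = −i` — each by a
formal five-term certificate (`gsec_identity_t`) pushed to `ℤ[ℂ]`; no Borel, no numerics. [cite: Neumann1998, §2.1 end (pp. 393–394)] -/
theorem gsec_targets_two :
    ((2 : ℤ) • FreeAbelianGroup.of ((-2 : ℂ) + (-1 : ℂ) * Complex.I) + (-5 : ℤ) • FreeAbelianGroup.of ((-1 / 2 : ℂ) * Complex.I) + (-2 : ℤ) • FreeAbelianGroup.of ((1 / 2 : ℂ) + (-1 : ℂ) * Complex.I) + (6 : ℤ) • FreeAbelianGroup.of ((-1 : ℂ) * Complex.I) ∈ AddSubgroup.closure dilogRelators) ∧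
    ((1 : ℤ) • FreeAbelianGroup.of ((1 / 2 : ℂ) + (-3 / 2 : ℂ) * Complex.I) + (1 : ℤ) • FreeAbelianGroup.of ((-1 / 2 : ℂ) * Complex.I) + (1 : ℤ) • FreeAbelianGroup.of ((1 / 2 : ℂ) + (-1 : ℂ) * Complex.I) + (-3 : ℤ) • FreeAbelianGroup.of ((-1 : ℂ) * Complex.I) ∈ AddSubgroup.closure dilogRelators) ∧
    ((2 : ℤ) • FreeAbelianGroup.of ((-1 : ℂ) + (-1 : ℂ) * Complex.I) + (1 : ℤ) • FreeAbelianGroup.of ((-1 / 2 : ℂ) * Complex.I) + (-2 : ℤ) • FreeAbelianGroup.of ((-1 : ℂ) * Complex.I) ∈ AddSubgroup.closure dilogRelators) ∧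
    ((2 : ℤ) • FreeAbelianGroup.of ((-1 : ℂ) + (-2 : ℂ) * Complex.I) + (3 : ℤ) • FreeAbelianGroup.of ((-1 / 2 : ℂ) * Complex.I) + (-4 : ℤ) • FreeAbelianGroup.of ((-1 : ℂ) * Complex.I) ∈ AddSubgroup.closure dilogRelators) :=
  -- CLOSED: Theorems/HyperbolicBlochZagierDilogarithmConjectureGaussSectorTargetsTwo.lean (p144550)
  Summit.KontsevichZagierPeriods.HyperbolicBloch.ZagierDilogarithmCertificate.gsec_targets_two

/-- **Registered stub `gsec_targets_three`** (Gaussian exceptional-unit sector, lead c5 cycle 4): the memberships `T_t ∈ ⟨dilogRelators⟩` for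
`t ∈ {11, 12, 13, 14}` — explicit integer combinations of the class representatives `r_t`, `r₄ = −i/2`, `r₅ = (1−2i)/2`, `r₇ = −i` — each by a
formal five-term certificate (`gsec_identity_t`) pushed to `ℤ[ℂ]`; no Borel, no numerics. [cite: Neumann1998, §2.1 end (pp. 393–394)] -/
theorem gsec_targets_three :
    ((1 : ℤ) • FreeAbelianGroup.of ((1 / 2 : ℂ) + (-7 / 2 : ℂ) * Complex.I) + (-6 : ℤ) • FreeAbelianGroup.of ((-1 / 2 : ℂ) * Complex.I) + (-4 : ℤ) • FreeAbelianGroup.of ((1 / 2 : ℂ) + (-1 : ℂ) * Complex.I) + (9 : ℤ) • FreeAbelianGroup.of ((-1 : ℂ) * Complex.I) ∈ AddSubgroup.closure dilogRelators) ∧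
    ((1 : ℤ) • FreeAbelianGroup.of ((-3 : ℂ) + (4 : ℂ) * Complex.I) + (5 : ℤ) • FreeAbelianGroup.of ((-1 / 2 : ℂ) * Complex.I) + (-4 : ℤ) • FreeAbelianGroup.of ((-1 : ℂ) * Complex.I) ∈ AddSubgroup.closure dilogRelators) ∧
    ((1 : ℤ) • FreeAbelianGroup.of ((-3 / 5 : ℂ) + (-4 / 5 : ℂ) * Complex.I) + (-2 : ℤ) • FreeAbelianGroup.of ((-1 / 2 : ℂ) * Complex.I) + (1 : ℤ) • FreeAbelianGroup.of ((1 / 2 : ℂ) + (-1 : ℂ) * Complex.I) ∈ AddSubgroup.closure dilogRelators) ∧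
    ((1 : ℤ) • FreeAbelianGroup.of ((1 / 2 : ℂ) + (-11 / 4 : ℂ) * Complex.I) + (6 : ℤ) • FreeAbelianGroup.of ((-1 / 2 : ℂ) * Complex.I) + (9 : ℤ) • FreeAbelianGroup.of ((1 / 2 : ℂ) + (-1 : ℂ) * Complex.I) + (-16 : ℤ) • FreeAbelianGroup.of ((-1 : ℂ) * Complex.I) ∈ AddSubgroup.closure dilogRelators) :=
  -- CLOSED: Theorems/HyperbolicBlochZagierDilogarithmConjectureGaussSectorTargetsThree.lean (p144552)
  Summit.KontsevichZagierPeriods.HyperbolicBloch.ZagierDilogarithmCertificate.gsec_targets_three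

/-- **Stub (c5 cycle 4, worker): valuation characters at the Gaussian primes over 2 and 5.** There are additive characters
`u, v, w : ℂˣ → ℚ` with `u(1+i) = 1, u(2±i) = 0`, `v(2+i) = 1, v(1+i) = v(2−i) = 0`, `w(2−i) = 1, w(1+i) = w(2+i) = 0` (`ext` = the
character read on `ℂ`, `0` at `0`): extend from the free subgroup `⟨1+i, 2+i, 2−i⟩` (independent: norms `2, 5, 5` and
`((2+i)/(2−i))^b = 1 ⇒ b = 0`, `DehnWitness.q_zpow_eq_one`) by the injectivity of `ℚ` (`exists_addMonoidHom_eq_one_eq_zero` pattern). -/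
theorem stub_gsecChars :
    ∃ u v w : Additive ℂˣ →+ ℚ,
      ZagierDilogarithmConjectureNegative.ext u (1 + Complex.I) = 1 ∧ ZagierDilogarithmConjectureNegative.ext u (2 + Complex.I) = 0 ∧ ZagierDilogarithmConjectureNegative.ext u (2 - Complex.I) = 0 ∧
      ZagierDilogarithmConjectureNegative.ext v (1 + Complex.I) = 0 ∧ ZagierDilogarithmConjectureNegative.ext v (2 + Complex.I) = 1 ∧ ZagierDilogarithmConjectureNegative.ext v (2 - Complex.I) = 0 ∧
      ZagierDilogarithmConjectureNegative.ext w (1 + Complex.I) = 0 ∧ ZagierDilogarithmConjectureNegative.ext w (2 + Complex.I) = 0 ∧ ZagierDilogarithmConjectureNegative.ext w (2 - Complex.I) = 1 :=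
  -- CLOSED: Theorems/HyperbolicBlochZagierDilogarithmConjectureGaussSectorChars.lean (p143346)
  Summit.KontsevichZagierPeriods.HyperbolicBloch.ZagierDilogarithmCertificate.stub_gsecChars

/-- **Stub (c5 cycle 4, worker): the Dehn invariant of the 15 class representatives, read by the valuation characters.** For characters
as in `stub_gsecChars`, `dehn u v [r_j] = F₁(r_j)` and `dehn v w [r_j] = 2F₂(r_j)` with the explicit integers below (factorisations
`r_j = i^a (1+i)^b (2+i)^c (2−i)^d`, `1 − r_j` likewise; `ext` is additive, kills `i`; `sym`/`asym`/`dehn_of`). Table (j: (a,b,c,d) of r_j;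
of 1−r_j): 0:(0,0,4,0);(0,7,0,1) 1:(0,0,−2,2);(2,6,−2,0) 2:(0,3,0,−1);(3,0,2,−1) 3:(0,2,1,0);(0,0,0,2) 4:(0,−2,0,0);(1,−2,1,0)
5:(0,−2,1,0);(2,−2,0,1) 6:(2,0,1,0);(0,1,0,1) 7:(3,0,0,0);(0,1,0,0) 8:(0,−1,0,1);(1,−1,1,0) 9:(2,1,0,0);(0,0,1,0) 10:(3,0,0,1);(3,3,0,0)
11:(3,−1,2,0);(2,−1,0,2) 12:(2,0,0,2);(1,5,0,0) 13:(2,0,1,−1);(2,4,0,−1) 14:(2,−4,0,3);(2,−4,3,0). -/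
theorem stub_gsecDehnRows :
    ∀ u v w : Additive ℂˣ →+ ℚ,
      ZagierDilogarithmConjectureNegative.ext u (1 + Complex.I) = 1 → ZagierDilogarithmConjectureNegative.ext u (2 + Complex.I) = 0 → ZagierDilogarithmConjectureNegative.ext u (2 - Complex.I) = 0 →
      ZagierDilogarithmConjectureNegative.ext v (1 + Complex.I) = 0 → ZagierDilogarithmConjectureNegative.ext v (2 + Complex.I) = 1 → ZagierDilogarithmConjectureNegative.ext v (2 - Complex.I) = 0 →
      ZagierDilogarithmConjectureNegative.ext w (1 + Complex.I) = 0 → ZagierDilogarithmConjectureNegative.ext w (2 + Complex.I) = 0 → ZagierDilogarithmConjectureNegative.ext w (2 - Complex.I) = 1 →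
      (dehn u v (FreeAbelianGroup.of ((-7 : ℂ) + (24 : ℂ) * Complex.I)) = (-28 : ℚ) ∧
        dehn u v (FreeAbelianGroup.of ((-7 / 25 : ℂ) + (-24 / 25 : ℂ) * Complex.I)) = (24 : ℚ) ∧
        dehn u v (FreeAbelianGroup.of ((-6 / 5 : ℂ) + (2 / 5 : ℂ) * Complex.I)) = (9 : ℚ) ∧
        dehn u v (FreeAbelianGroup.of ((-2 : ℂ) + (4 : ℂ) * Complex.I)) = (-4 : ℚ) ∧
        dehn u v (FreeAbelianGroup.of ((-1 / 2 : ℂ) * Complex.I)) = (-2 : ℚ) ∧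
        dehn u v (FreeAbelianGroup.of ((1 / 2 : ℂ) + (-1 : ℂ) * Complex.I)) = (4 : ℚ) ∧
        dehn u v (FreeAbelianGroup.of ((-2 : ℂ) + (-1 : ℂ) * Complex.I)) = (-1 : ℚ) ∧
        dehn u v (FreeAbelianGroup.of ((-1 : ℂ) * Complex.I)) = (0 : ℚ) ∧
        dehn u v (FreeAbelianGroup.of ((1 / 2 : ℂ) + (-3 / 2 : ℂ) * Complex.I)) = (-2 : ℚ) ∧
        dehn u v (FreeAbelianGroup.of ((-1 : ℂ) + (-1 : ℂ) * Complex.I)) = (1 : ℚ) ∧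
        dehn u v (FreeAbelianGroup.of ((-1 : ℂ) + (-2 : ℂ) * Complex.I)) = (3 : ℚ) ∧
        dehn u v (FreeAbelianGroup.of ((1 / 2 : ℂ) + (-7 / 2 : ℂ) * Complex.I)) = (4 : ℚ) ∧
        dehn u v (FreeAbelianGroup.of ((-3 : ℂ) + (4 : ℂ) * Complex.I)) = (10 : ℚ) ∧
        dehn u v (FreeAbelianGroup.of ((-3 / 5 : ℂ) + (-4 / 5 : ℂ) * Complex.I)) = (-8 : ℚ) ∧
        dehn u v (FreeAbelianGroup.of ((1 / 2 : ℂ) + (-11 / 4 : ℂ) * Complex.I)) = (-24 : ℚ)) ∧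
      (dehn v w (FreeAbelianGroup.of ((-7 : ℂ) + (24 : ℂ) * Complex.I)) = (8 : ℚ) ∧
        dehn v w (FreeAbelianGroup.of ((-7 / 25 : ℂ) + (-24 / 25 : ℂ) * Complex.I)) = (8 : ℚ) ∧
        dehn v w (FreeAbelianGroup.of ((-6 / 5 : ℂ) + (2 / 5 : ℂ) * Complex.I)) = (4 : ℚ) ∧
        dehn v w (FreeAbelianGroup.of ((-2 : ℂ) + (4 : ℂ) * Complex.I)) = (4 : ℚ) ∧
        dehn v w (FreeAbelianGroup.of ((-1 / 2 : ℂ) * Complex.I)) = (0 : ℚ) ∧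
        dehn v w (FreeAbelianGroup.of ((1 / 2 : ℂ) + (-1 : ℂ) * Complex.I)) = (2 : ℚ) ∧
        dehn v w (FreeAbelianGroup.of ((-2 : ℂ) + (-1 : ℂ) * Complex.I)) = (2 : ℚ) ∧
        dehn v w (FreeAbelianGroup.of ((-1 : ℂ) * Complex.I)) = (0 : ℚ) ∧
        dehn v w (FreeAbelianGroup.of ((1 / 2 : ℂ) + (-3 / 2 : ℂ) * Complex.I)) = (-2 : ℚ) ∧
        dehn v w (FreeAbelianGroup.of ((-1 : ℂ) + (-1 : ℂ) * Complex.I)) = (0 : ℚ) ∧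
        dehn v w (FreeAbelianGroup.of ((-1 : ℂ) + (-2 : ℂ) * Complex.I)) = (0 : ℚ) ∧
        dehn v w (FreeAbelianGroup.of ((1 / 2 : ℂ) + (-7 / 2 : ℂ) * Complex.I)) = (8 : ℚ) ∧
        dehn v w (FreeAbelianGroup.of ((-3 : ℂ) + (4 : ℂ) * Complex.I)) = (0 : ℚ) ∧
        dehn v w (FreeAbelianGroup.of ((-3 / 5 : ℂ) + (-4 / 5 : ℂ) * Complex.I)) = (-2 : ℚ) ∧
        dehn v w (FreeAbelianGroup.of ((1 / 2 : ℂ) + (-11 / 4 : ℂ) * Complex.I)) = (-18 : ℚ)) :=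
  -- CLOSED: Theorems/HyperbolicBlochZagierDilogarithmConjectureGaussSectorDehn.lean (p143483)
  Summit.KontsevichZagierPeriods.HyperbolicBloch.ZagierDilogarithmCertificate.stub_gsecDehnRows

/-- **Stub (c5 cycle 4, lead): THE GAUSSIAN EXCEPTIONAL-UNIT SECTOR — Zagier's conjecture, Dehn-zero part, UNCONDITIONALLY and EXACTLY on the
support `r₀,…,r₁₄`.** For all integers `c₀,…,c₁₄`: if `ξ = Σ c_j[r_j]` has vanishing Dehn invariant (all `dehn u v`) and vanishing volume
`Σ c_j D(r_j) = 0`, then `ξ ∈ ⟨dilogRelators⟩`. Proof: two character pairs give `F₁(ξ) = F₂(ξ) = 0`; linear algebra over the `W`-basis: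
`2ξ = Σ_t c_t k_t T_t + A[r₄] + B[r₅] + N[−i]` with `A = B = 0` forced by `F₁, F₂` (pivot rows 4, 5), the `T_t ∈ ⟨dilogRelators⟩`
(`gsec_targets_*`), so `D`: `0 = 2D(ξ) = −N·G` ⇒ `N = 0`; finally `stub_twoSaturation`. No Borel / Suslin / Dupont. -/
theorem stub_gaussUnitSector :
    ∀ c0 c1 c2 c3 c4 c5 c6 c7 c8 c9 c10 c11 c12 c13 c14 : ℤ,
      (∀ u v : Additive ℂˣ →+ ℚ,
        dehn u v (c0 • FreeAbelianGroup.of ((-7 : ℂ) + (24 : ℂ) * Complex.I) +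
          c1 • FreeAbelianGroup.of ((-7 / 25 : ℂ) + (-24 / 25 : ℂ) * Complex.I) +
          c2 • FreeAbelianGroup.of ((-6 / 5 : ℂ) + (2 / 5 : ℂ) * Complex.I) +
          c3 • FreeAbelianGroup.of ((-2 : ℂ) + (4 : ℂ) * Complex.I) +
          c4 • FreeAbelianGroup.of ((-1 / 2 : ℂ) * Complex.I) +
          c5 • FreeAbelianGroup.of ((1 / 2 : ℂ) + (-1 : ℂ) * Complex.I) +
          c6 • FreeAbelianGroup.of ((-2 : ℂ) + (-1 : ℂ) * Complex.I) +
          c7 • FreeAbelianGroup.of ((-1 : ℂ) * Complex.I) +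
          c8 • FreeAbelianGroup.of ((1 / 2 : ℂ) + (-3 / 2 : ℂ) * Complex.I) +
          c9 • FreeAbelianGroup.of ((-1 : ℂ) + (-1 : ℂ) * Complex.I) +
          c10 • FreeAbelianGroup.of ((-1 : ℂ) + (-2 : ℂ) * Complex.I) +
          c11 • FreeAbelianGroup.of ((1 / 2 : ℂ) + (-7 / 2 : ℂ) * Complex.I) +
          c12 • FreeAbelianGroup.of ((-3 : ℂ) + (4 : ℂ) * Complex.I) +
          c13 • FreeAbelianGroup.of ((-3 / 5 : ℂ) + (-4 / 5 : ℂ) * Complex.I) +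
          c14 • FreeAbelianGroup.of ((1 / 2 : ℂ) + (-11 / 4 : ℂ) * Complex.I)) = 0) →
      (c0 : ℝ) * blochWignerDilog ((-7 : ℂ) + (24 : ℂ) * Complex.I) +
        (c1 : ℝ) * blochWignerDilog ((-7 / 25 : ℂ) + (-24 / 25 : ℂ) * Complex.I) +
        (c2 : ℝ) * blochWignerDilog ((-6 / 5 : ℂ) + (2 / 5 : ℂ) * Complex.I) +
        (c3 : ℝ) * blochWignerDilog ((-2 : ℂ) + (4 : ℂ) * Complex.I) +
        (c4 : ℝ) * blochWignerDilog ((-1 / 2 : ℂ) * Complex.I) +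
        (c5 : ℝ) * blochWignerDilog ((1 / 2 : ℂ) + (-1 : ℂ) * Complex.I) +
        (c6 : ℝ) * blochWignerDilog ((-2 : ℂ) + (-1 : ℂ) * Complex.I) +
        (c7 : ℝ) * blochWignerDilog ((-1 : ℂ) * Complex.I) +
        (c8 : ℝ) * blochWignerDilog ((1 / 2 : ℂ) + (-3 / 2 : ℂ) * Complex.I) +
        (c9 : ℝ) * blochWignerDilog ((-1 : ℂ) + (-1 : ℂ) * Complex.I) +
        (c10 : ℝ) * blochWignerDilog ((-1 : ℂ) + (-2 : ℂ) * Complex.I) +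
        (c11 : ℝ) * blochWignerDilog ((1 / 2 : ℂ) + (-7 / 2 : ℂ) * Complex.I) +
        (c12 : ℝ) * blochWignerDilog ((-3 : ℂ) + (4 : ℂ) * Complex.I) +
        (c13 : ℝ) * blochWignerDilog ((-3 / 5 : ℂ) + (-4 / 5 : ℂ) * Complex.I) +
        (c14 : ℝ) * blochWignerDilog ((1 / 2 : ℂ) + (-11 / 4 : ℂ) * Complex.I) = 0 →
        (c0 • FreeAbelianGroup.of ((-7 : ℂ) + (24 : ℂ) * Complex.I) +
          c1 • FreeAbelianGroup.of ((-7 / 25 : ℂ) + (-24 / 25 : ℂ) * Complex.I) +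
          c2 • FreeAbelianGroup.of ((-6 / 5 : ℂ) + (2 / 5 : ℂ) * Complex.I) +
          c3 • FreeAbelianGroup.of ((-2 : ℂ) + (4 : ℂ) * Complex.I) +
          c4 • FreeAbelianGroup.of ((-1 / 2 : ℂ) * Complex.I) +
          c5 • FreeAbelianGroup.of ((1 / 2 : ℂ) + (-1 : ℂ) * Complex.I) +
          c6 • FreeAbelianGroup.of ((-2 : ℂ) + (-1 : ℂ) * Complex.I) +
          c7 • FreeAbelianGroup.of ((-1 : ℂ) * Complex.I) +
          c8 • FreeAbelianGroup.of ((1 / 2 : ℂ) + (-3 / 2 : ℂ) * Complex.I) +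
          c9 • FreeAbelianGroup.of ((-1 : ℂ) + (-1 : ℂ) * Complex.I) +
          c10 • FreeAbelianGroup.of ((-1 : ℂ) + (-2 : ℂ) * Complex.I) +
          c11 • FreeAbelianGroup.of ((1 / 2 : ℂ) + (-7 / 2 : ℂ) * Complex.I) +
          c12 • FreeAbelianGroup.of ((-3 : ℂ) + (4 : ℂ) * Complex.I) +
          c13 • FreeAbelianGroup.of ((-3 / 5 : ℂ) + (-4 / 5 : ℂ) * Complex.I) +
          c14 • FreeAbelianGroup.of ((1 / 2 : ℂ) + (-11 / 4 : ℂ) * Complex.I)) ∈ AddSubgroup.closure dilogRelators :=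
  -- CLOSED: Theorems/HyperbolicBlochZagierDilogarithmConjectureGaussSectorHeadline.lean (p144889)
  Summit.KontsevichZagierPeriods.HyperbolicBloch.ZagierDilogarithmCertificate.stub_gaussUnitSector

/-- **Stub (c5 cycle 4, lead): the constructive Borel statement on this support.** For all integers `c₀,…,c₁₄`: if `ξ = Σ c_j[r_j]` has
vanishing Dehn invariant then `2ξ ≡ N·[−i] (mod ⟨dilogRelators⟩)` for some integer `N` — the Bloch group of `ℤ[i,1/10]` on exceptional
support is `ℚ·[i]` EXPLICITLY (`W = V ⊕ ℚ[i]`), so `D(ξ) ∈ ½ℤ·G`. -/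
theorem stub_gaussUnitBlochRank :
    ∀ c0 c1 c2 c3 c4 c5 c6 c7 c8 c9 c10 c11 c12 c13 c14 : ℤ,
      (∀ u v : Additive ℂˣ →+ ℚ,
        dehn u v (c0 • FreeAbelianGroup.of ((-7 : ℂ) + (24 : ℂ) * Complex.I) +
          c1 • FreeAbelianGroup.of ((-7 / 25 : ℂ) + (-24 / 25 : ℂ) * Complex.I) +
          c2 • FreeAbelianGroup.of ((-6 / 5 : ℂ) + (2 / 5 : ℂ) * Complex.I) +
          c3 • FreeAbelianGroup.of ((-2 : ℂ) + (4 : ℂ) * Complex.I) +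
          c4 • FreeAbelianGroup.of ((-1 / 2 : ℂ) * Complex.I) +
          c5 • FreeAbelianGroup.of ((1 / 2 : ℂ) + (-1 : ℂ) * Complex.I) +
          c6 • FreeAbelianGroup.of ((-2 : ℂ) + (-1 : ℂ) * Complex.I) +
          c7 • FreeAbelianGroup.of ((-1 : ℂ) * Complex.I) +
          c8 • FreeAbelianGroup.of ((1 / 2 : ℂ) + (-3 / 2 : ℂ) * Complex.I) +
          c9 • FreeAbelianGroup.of ((-1 : ℂ) + (-1 : ℂ) * Complex.I) +
          c10 • FreeAbelianGroup.of ((-1 : ℂ) + (-2 : ℂ) * Complex.I) +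
          c11 • FreeAbelianGroup.of ((1 / 2 : ℂ) + (-7 / 2 : ℂ) * Complex.I) +
          c12 • FreeAbelianGroup.of ((-3 : ℂ) + (4 : ℂ) * Complex.I) +
          c13 • FreeAbelianGroup.of ((-3 / 5 : ℂ) + (-4 / 5 : ℂ) * Complex.I) +
          c14 • FreeAbelianGroup.of ((1 / 2 : ℂ) + (-11 / 4 : ℂ) * Complex.I)) = 0) →
      ∃ N : ℤ, (2 : ℤ) • (c0 • FreeAbelianGroup.of ((-7 : ℂ) + (24 : ℂ) * Complex.I) +
          c1 • FreeAbelianGroup.of ((-7 / 25 : ℂ) + (-24 / 25 : ℂ) * Complex.I) +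
          c2 • FreeAbelianGroup.of ((-6 / 5 : ℂ) + (2 / 5 : ℂ) * Complex.I) +
          c3 • FreeAbelianGroup.of ((-2 : ℂ) + (4 : ℂ) * Complex.I) +
          c4 • FreeAbelianGroup.of ((-1 / 2 : ℂ) * Complex.I) +
          c5 • FreeAbelianGroup.of ((1 / 2 : ℂ) + (-1 : ℂ) * Complex.I) +
          c6 • FreeAbelianGroup.of ((-2 : ℂ) + (-1 : ℂ) * Complex.I) +
          c7 • FreeAbelianGroup.of ((-1 : ℂ) * Complex.I) +
          c8 • FreeAbelianGroup.of ((1 / 2 : ℂ) + (-3 / 2 : ℂ) * Complex.I) +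
          c9 • FreeAbelianGroup.of ((-1 : ℂ) + (-1 : ℂ) * Complex.I) +
          c10 • FreeAbelianGroup.of ((-1 : ℂ) + (-2 : ℂ) * Complex.I) +
          c11 • FreeAbelianGroup.of ((1 / 2 : ℂ) + (-7 / 2 : ℂ) * Complex.I) +
          c12 • FreeAbelianGroup.of ((-3 : ℂ) + (4 : ℂ) * Complex.I) +
          c13 • FreeAbelianGroup.of ((-3 / 5 : ℂ) + (-4 / 5 : ℂ) * Complex.I) +
          c14 • FreeAbelianGroup.of ((1 / 2 : ℂ) + (-11 / 4 : ℂ) * Complex.I)) -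
          N • FreeAbelianGroup.of ((-1 : ℂ) * Complex.I) ∈ AddSubgroup.closure dilogRelators :=
  -- CLOSED: Theorems/HyperbolicBlochZagierDilogarithmConjectureGaussSectorHeadline.lean (p144889)
  Summit.KontsevichZagierPeriods.HyperbolicBloch.ZagierDilogarithmCertificate.stub_gaussUnitBlochRank

/-! ### c5 cycle 4 (cont.): the canonical 147-point form (anharmonic relators, folds, `stub_gaussExceptionalUnitOrbits` — orbit form, since a 147-literal signature exceeds the registry's length cap). -/

/-- **Registered stub `stub_anharmonicRelators`** (Gaussian exceptional-unit sector, lead c5 cycle 4): the five anharmonic relators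
in `ℤ[ℂ]` modulo `⟨dilogRelators⟩` for algebraic `x ∉ {0,1}`, images given in multiplicative form (conjunction). [cite: Neumann1998, §2 eq. (2.3)] -/
theorem stub_anharmonicRelators :
    (∀ x y : ℂ, IsAlgebraic ℚ x → x ≠ 0 → x ≠ 1 → x * y = 1 →
        FreeAbelianGroup.of x + FreeAbelianGroup.of y ∈ AddSubgroup.closure dilogRelators) ∧
    (∀ x y : ℂ, IsAlgebraic ℚ x → x ≠ 0 → x ≠ 1 → x + y = 1 →
        FreeAbelianGroup.of x + FreeAbelianGroup.of y ∈ AddSubgroup.closure dilogRelators) ∧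
    (∀ x y : ℂ, IsAlgebraic ℚ x → x ≠ 0 → x ≠ 1 → y * (1 - x) = 1 →
        FreeAbelianGroup.of x - FreeAbelianGroup.of y ∈ AddSubgroup.closure dilogRelators) ∧
    (∀ x y : ℂ, IsAlgebraic ℚ x → x ≠ 0 → x ≠ 1 → (1 - y) * x = 1 →
        FreeAbelianGroup.of x - FreeAbelianGroup.of y ∈ AddSubgroup.closure dilogRelators) ∧
    (∀ x y : ℂ, IsAlgebraic ℚ x → x ≠ 0 → x ≠ 1 → y * (x - 1) = x →
        FreeAbelianGroup.of x + FreeAbelianGroup.of y ∈ AddSubgroup.closure dilogRelators) :=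
  -- CLOSED: Theorems/HyperbolicBlochZagierDilogarithmConjectureGaussSectorAnharmonic.lean (p144489)
  Summit.KontsevichZagierPeriods.HyperbolicBloch.ZagierDilogarithmCertificate.stub_anharmonicRelators

/-- **Registered stub `gsec_fold_one`** (Gaussian exceptional-unit sector): the folds `[w] ≡ S·[r_j]` for 49 of the 147 exceptional
units of `ℤ[i,1/10]` (the representatives `r₀,…,r₁₄` as in `stub_gaussUnitSector`). [cite: Neumann1998, §2.1] -/
theorem gsec_fold_one :
    ∀ w ∈ ({((-7 : ℂ) + (-24 : ℂ) * Complex.I), ((-7 : ℂ) + (24 : ℂ) * Complex.I), ((-4 : ℂ)), ((-3 : ℂ) + (-4 : ℂ) * Complex.I), ((-3 : ℂ) + (4 : ℂ) * Complex.I), ((-2 : ℂ) + (-4 : ℂ) * Complex.I), ((-2 : ℂ) + (-1 : ℂ) * Complex.I), ((-2 : ℂ) + (1 : ℂ) * Complex.I), ((-2 : ℂ) + (4 : ℂ) * Complex.I), ((-6 / 5 : ℂ) + (-2 / 5 : ℂ) * Complex.I), ((-6 / 5 : ℂ) + (2 / 5 : ℂ) * Complex.I), ((-1 : ℂ) + (-2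 : ℂ) * Complex.I), ((-1 : ℂ) + (-1 : ℂ) * Complex.I), ((-1 : ℂ)), ((-1 : ℂ) + (1 : ℂ) * Complex.I), ((-1 : ℂ) + (2 : ℂ) * Complex.I), ((-3 / 4 : ℂ) + (-1 / 4 : ℂ) * Complex.I), ((-3 / 4 : ℂ) + (1 / 4 : ℂ) * Complex.I), ((-3 / 5 : ℂ) + (-4 / 5 : ℂ) * Complex.I), ((-3 / 5 : ℂ) + (4 / 5 : ℂ) * Complex.I), ((-1 / 2 : ℂ) + (-1 / 2 : ℂ) * Complex.I), ((-1 / 2 : ℂ) + (1 / 2 : ℂ) * Complex.I), ((-2 / 5 : ℂ) + (-1 / 5 : ℂ) * Complex.I), ((-2 / 5 : ℂ) + (1 / 5 : ℂ) * Complex.I), ((-7 / 25 : ℂ) + (-24 / 25 : ℂ) * Complex.I), ((-7 / 25 : ℂ) + (24 / 25 : ℂ) * Complex.I), ((-1 / 4 : ℂ)), ((-1 / 5 : ℂ) + (-2 / 5 : ℂ) * Complex.I), ((-1 / 5 : ℂ) + (2 / 5 : ℂ) * Complex.I), ((-3 / 25 : ℂ) + (-4 / 25 : ℂ) * Complex.I),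 ((-3 / 25 : ℂ) + (4 / 25 : ℂ) * Complex.I), ((-1 / 10 : ℂ) + (-1 / 5 : ℂ) * Complex.I), ((-1 / 10 : ℂ) + (1 / 5 : ℂ) * Complex.I), ((-7 / 625 : ℂ) + (-24 / 625 : ℂ) * Complex.I), ((-7 / 625 : ℂ) + (24 / 625 : ℂ) * Complex.I), ((-2 : ℂ) * Complex.I), ((-1 : ℂ) * Complex.I), ((-1 / 2 : ℂ) * Complex.I), ((1 / 2 : ℂ) * Complex.I), ((1 : ℂ) * Complex.I), ((2 : ℂ) * Complex.I), ((1 / 80 : ℂ) + (-3 / 80 : ℂ) * Complex.I), ((1 / 80 : ℂ) + (3 / 80 : ℂ) * Complex.I), ((1 / 25 : ℂ) + (-7 / 25 : ℂ) * Complex.I), ((1 / 25 : ℂ) + (7 / 25 : ℂ) * Complex.I), ((8 / 125 : ℂ) + (-44 / 125 : ℂ) * Complex.I), ((8 / 125 : ℂ) + (44 / 125 : ℂ) * Complex.I), ((3 / 25 : ℂ) + (-4 / 25 : ℂ) * Complex.I), ((3 / 25 : ℂ) + (4 / 25 : ℂ) * Complex.I)} : Set ℂ),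
      ∃ j : Fin 15, ∃ S : ℤ, FreeAbelianGroup.of w - S • FreeAbelianGroup.of ((![((-7 : ℂ) + (24 : ℂ) * Complex.I), ((-7 / 25 : ℂ) + (-24 / 25 : ℂ) * Complex.I), ((-6 / 5 : ℂ) + (2 / 5 : ℂ) * Complex.I), ((-2 : ℂ) + (4 : ℂ) * Complex.I), ((-1 / 2 : ℂ) * Complex.I), ((1 / 2 : ℂ) + (-1 : ℂ) * Complex.I), ((-2 : ℂ) + (-1 : ℂ) * Complex.I), ((-1 : ℂ) * Complex.I), ((1 / 2 : ℂ) + (-3 / 2 : ℂ) * Complex.I), ((-1 : ℂ) + (-1 : ℂ) * Complex.I), ((-1 : ℂ) + (-2 : ℂ) * Complex.I), ((1 / 2 : ℂ) + (-7 / 2 : ℂ) * Complex.I), ((-3 : ℂ) + (4 : ℂ) * Complex.I), ((-3 / 5 : ℂ) + (-4 / 5 : ℂ) * Complex.I), ((1 / 2 : ℂ) + (-11 / 4 : ℂ) * Complex.I)] : Fin 15 → ℂ) j) ∈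
        AddSubgroup.closure dilogRelators :=
  -- CLOSED: Theorems/HyperbolicBlochZagierDilogarithmConjectureGaussSectorFoldOne.lean (p144553)
  Summit.KontsevichZagierPeriods.HyperbolicBloch.ZagierDilogarithmCertificate.gsec_fold_one

/-- **Registered stub `gsec_fold_two`** (Gaussian exceptional-unit sector): the folds `[w] ≡ S·[r_j]` for 49 of the 147 exceptional
units of `ℤ[i,1/10]` (the representatives `r₀,…,r₁₄` as in `stub_gaussUnitSector`). [cite: Neumann1998, §2.1] -/
theorem gsec_fold_two :
    ∀ w ∈ ({((1 / 8 : ℂ) + (-1 / 8 : ℂ) * Complex.I), ((1 / 8 : ℂ) + (1 / 8 : ℂ) * Complex.I), ((1 / 5 : ℂ) + (-3 / 5 : ℂ) * Complex.I), ((1 / 5 : ℂ) + (-2 / 5 : ℂ) * Complex.I), ((1 / 5 : ℂ)), ((1 / 5 : ℂ) + (2 / 5 : ℂ) * Complex.I), ((1 / 5 : ℂ) + (3 / 5 : ℂ) * Complex.I), ((1 / 4 : ℂ) + (-1 / 4 : ℂ) * Complex.I), ((1 / 4 : ℂ) + (1 / 4 : ℂ) * Complex.I), ((3 / 10 : ℂ)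 + (-1 / 10 : ℂ) * Complex.I), ((3 / 10 : ℂ) + (1 / 10 : ℂ) * Complex.I), ((2 / 5 : ℂ) + (-4 / 5 : ℂ) * Complex.I), ((2 / 5 : ℂ) + (-1 / 5 : ℂ) * Complex.I), ((2 / 5 : ℂ) + (1 / 5 : ℂ) * Complex.I), ((2 / 5 : ℂ) + (4 / 5 : ℂ) * Complex.I), ((11 / 25 : ℂ) + (-2 / 25 : ℂ) * Complex.I), ((11 / 25 : ℂ) + (2 / 25 : ℂ) * Complex.I), ((1 / 2 : ℂ) + (-7 / 2 : ℂ) * Complex.I), ((1 / 2 : ℂ) + (-11 / 4 : ℂ) * Complex.I), ((1 / 2 : ℂ) + (-3 / 2 : ℂ) * Complex.I), ((1 / 2 : ℂ) + (-1 : ℂ) * Complex.I), ((1 / 2 : ℂ) + (-1 / 2 : ℂ) * Complex.I), ((1 / 2 : ℂ) + (-3 / 8 : ℂ) * Complex.I), ((1 / 2 : ℂ) + (-1 / 4 : ℂ) * Complex.I), ((1 / 2 : ℂ)), ((1 / 2 : ℂ) + (1 / 4 : ℂ) * Complex.I), ((1 / 2 : ℂ) + (3 / 8 : ℂ) * Complex.I),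 ((1 / 2 : ℂ) + (1 / 2 : ℂ) * Complex.I), ((1 / 2 : ℂ) + (1 : ℂ) * Complex.I), ((1 / 2 : ℂ) + (3 / 2 : ℂ) * Complex.I), ((1 / 2 : ℂ) + (11 / 4 : ℂ) * Complex.I), ((1 / 2 : ℂ) + (7 / 2 : ℂ) * Complex.I), ((14 / 25 : ℂ) + (-2 / 25 : ℂ) * Complex.I), ((14 / 25 : ℂ) + (2 / 25 : ℂ) * Complex.I), ((3 / 5 : ℂ) + (-4 / 5 : ℂ) * Complex.I), ((3 / 5 : ℂ) + (-1 / 5 : ℂ) * Complex.I), ((3 / 5 : ℂ) + (1 / 5 : ℂ) * Complex.I), ((3 / 5 : ℂ) + (4 / 5 : ℂ) * Complex.I), ((7 / 10 : ℂ) + (-1 / 10 : ℂ) * Complex.I), ((7 / 10 : ℂ) + (1 / 10 : ℂ) * Complex.I), ((3 / 4 : ℂ) + (-1 / 4 : ℂ) * Complex.I), ((3 / 4 : ℂ) + (1 / 4 : ℂ) * Complex.I), ((4 / 5 : ℂ) + (-3 / 5 : ℂ) * Complex.I), ((4 / 5 : ℂ) + (-2 / 5 : ℂ) * Complex.I), ((4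 / 5 : ℂ)), ((4 / 5 : ℂ) + (2 / 5 : ℂ) * Complex.I), ((4 / 5 : ℂ) + (3 / 5 : ℂ) * Complex.I), ((7 / 8 : ℂ) + (-1 / 8 : ℂ) * Complex.I), ((7 / 8 : ℂ) + (1 / 8 : ℂ) * Complex.I)} : Set ℂ),
      ∃ j : Fin 15, ∃ S : ℤ, FreeAbelianGroup.of w - S • FreeAbelianGroup.of ((![((-7 : ℂ) + (24 : ℂ) * Complex.I), ((-7 / 25 : ℂ) + (-24 / 25 : ℂ) * Complex.I), ((-6 / 5 : ℂ) + (2 / 5 : ℂ) * Complex.I), ((-2 : ℂ) + (4 : ℂ) * Complex.I), ((-1 / 2 : ℂ) * Complex.I), ((1 / 2 : ℂ) + (-1 : ℂ) * Complex.I), ((-2 : ℂ) + (-1 : ℂ) * Complex.I), ((-1 : ℂ) * Complex.I), ((1 / 2 : ℂ) + (-3 / 2 : ℂ) * Complex.I), ((-1 : ℂ) + (-1 : ℂ) * Complex.I), ((-1 : ℂ) + (-2 : ℂ) * Complex.I), ((1 / 2 : ℂ) + (-7 / 2 : ℂ) * Complex.I), ((-3 : ℂ) + (4 : ℂ) * Complex.I),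 ((-3 / 5 : ℂ) + (-4 / 5 : ℂ) * Complex.I), ((1 / 2 : ℂ) + (-11 / 4 : ℂ) * Complex.I)] : Fin 15 → ℂ) j) ∈
        AddSubgroup.closure dilogRelators :=
  -- CLOSED: Theorems/HyperbolicBlochZagierDilogarithmConjectureGaussSectorFoldTwo.lean (p144554)
  Summit.KontsevichZagierPeriods.HyperbolicBloch.ZagierDilogarithmCertificate.gsec_fold_two

/-- **Registered stub `gsec_fold_three`** (Gaussian exceptional-unit sector): the folds `[w] ≡ S·[r_j]` for 49 of the 147 exceptional
units of `ℤ[i,1/10]` (the representatives `r₀,…,r₁₄` as in `stub_gaussUnitSector`). [cite: Neumann1998, §2.1] -/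
theorem gsec_fold_three :
    ∀ w ∈ ({((22 / 25 : ℂ) + (-4 / 25 : ℂ) * Complex.I), ((22 / 25 : ℂ) + (4 / 25 : ℂ) * Complex.I), ((117 / 125 : ℂ) + (-44 / 125 : ℂ) * Complex.I), ((117 / 125 : ℂ) + (44 / 125 : ℂ) * Complex.I), ((24 / 25 : ℂ) + (-7 / 25 : ℂ) * Complex.I), ((24 / 25 : ℂ) + (7 / 25 : ℂ) * Complex.I), ((79 / 80 : ℂ) + (-3 / 80 : ℂ) * Complex.I), ((79 / 80 : ℂ) + (3 / 80 : ℂ) * Complex.I), ((1 : ℂ) + (-2 : ℂ) * Complex.I), ((1 : ℂ) + (-1 : ℂ) * Complex.I), ((1 : ℂ) + (-1 / 2 : ℂ) * Complex.I), ((1 : ℂ) + (1 / 2 : ℂ) * Complex.I), ((1 : ℂ) + (1 : ℂ) * Complex.I), ((1 : ℂ) + (2 : ℂ) * Complex.I), ((632 / 625 : ℂ) + (-24 / 625 : ℂ) * Complex.I), ((632 / 625 : ℂ) + (24 / 625 : ℂ) * Complex.I), ((11 / 10 : ℂ) + (-1 / 5 : ℂ) * Complex.I), ((11 / 10 : ℂ)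 + (1 / 5 : ℂ) * Complex.I), ((28 / 25 : ℂ) + (-4 / 25 : ℂ) * Complex.I), ((28 / 25 : ℂ) + (4 / 25 : ℂ) * Complex.I), ((6 / 5 : ℂ) + (-2 / 5 : ℂ) * Complex.I), ((6 / 5 : ℂ) + (2 / 5 : ℂ) * Complex.I), ((5 / 4 : ℂ)), ((32 / 25 : ℂ) + (-24 / 25 : ℂ) * Complex.I), ((32 / 25 : ℂ) + (24 / 25 : ℂ) * Complex.I), ((7 / 5 : ℂ) + (-1 / 5 : ℂ) * Complex.I), ((7 / 5 : ℂ) + (1 / 5 : ℂ) * Complex.I), ((3 / 2 : ℂ) + (-1 / 2 : ℂ) * Complex.I), ((3 / 2 : ℂ) + (1 / 2 : ℂ) * Complex.I), ((8 / 5 : ℂ) + (-4 / 5 : ℂ) * Complex.I), ((8 / 5 : ℂ) + (4 / 5 : ℂ) * Complex.I), ((7 / 4 : ℂ) + (-1 / 4 : ℂ) * Complex.I), ((7 / 4 : ℂ) + (1 / 4 : ℂ) * Complex.I), ((2 : ℂ) + (-2 : ℂ) * Complex.I), ((2 : ℂ) + (-1 : ℂ) * Complex.I), ((2 : ℂ)),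 ((2 : ℂ) + (1 : ℂ) * Complex.I), ((2 : ℂ) + (2 : ℂ) * Complex.I), ((11 / 5 : ℂ) + (-2 / 5 : ℂ) * Complex.I), ((11 / 5 : ℂ) + (2 / 5 : ℂ) * Complex.I), ((3 : ℂ) + (-4 : ℂ) * Complex.I), ((3 : ℂ) + (-1 : ℂ) * Complex.I), ((3 : ℂ) + (1 : ℂ) * Complex.I), ((3 : ℂ) + (4 : ℂ) * Complex.I), ((4 : ℂ) + (-4 : ℂ) * Complex.I), ((4 : ℂ) + (4 : ℂ) * Complex.I), ((5 : ℂ)), ((8 : ℂ) + (-24 : ℂ) * Complex.I), ((8 : ℂ) + (24 : ℂ) * Complex.I)} : Set ℂ),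
      ∃ j : Fin 15, ∃ S : ℤ, FreeAbelianGroup.of w - S • FreeAbelianGroup.of ((![((-7 : ℂ) + (24 : ℂ) * Complex.I), ((-7 / 25 : ℂ) + (-24 / 25 : ℂ) * Complex.I), ((-6 / 5 : ℂ) + (2 / 5 : ℂ) * Complex.I), ((-2 : ℂ) + (4 : ℂ) * Complex.I), ((-1 / 2 : ℂ) * Complex.I), ((1 / 2 : ℂ) + (-1 : ℂ) * Complex.I), ((-2 : ℂ) + (-1 : ℂ) * Complex.I), ((-1 : ℂ) * Complex.I), ((1 / 2 : ℂ) + (-3 / 2 : ℂ) * Complex.I), ((-1 : ℂ) + (-1 : ℂ) * Complex.I), ((-1 : ℂ) + (-2 : ℂ) * Complex.I), ((1 / 2 : ℂ) + (-7 / 2 : ℂ) * Complex.I), ((-3 : ℂ) + (4 : ℂ) * Complex.I), ((-3 / 5 : ℂ) + (-4 / 5 : ℂ) * Complex.I), ((1 / 2 : ℂ) + (-11 / 4 : ℂ) * Complex.I)] : Fin 15 → ℂ) j) ∈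
        AddSubgroup.closure dilogRelators :=
  -- CLOSED: Theorems/HyperbolicBlochZagierDilogarithmConjectureGaussSectorFoldThree.lean (p144555)
  Summit.KontsevichZagierPeriods.HyperbolicBloch.ZagierDilogarithmCertificate.gsec_fold_three

/-- **Stub `stub_gaussExceptionalUnitOrbits` (c5 cycle 4): Zagier's conjecture, Dehn-zero part, EXACTLY and UNCONDITIONALLY on the 147
exceptional units of `ℤ[i,1/10]` — the anharmonic–conjugation orbits of `r₀,…,r₁₄, −1, −4`.** For `z : Fin k → ℂ` valued in these orbits
(each `zᵢ` one of the twelve images of one of the 17 representatives) and `n : Fin k → ℤ`: if `Σ nᵢ[zᵢ]` has vanishing Dehn invariant and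
`Σ nᵢ D(zᵢ) = 0` then `Σ nᵢ[zᵢ] ∈ ⟨dilogRelators⟩`. No Borel, no Suslin, no Dupont. [cite: Neumann1998, §2.1 end (pp. 393–394)] -/
theorem stub_gaussExceptionalUnitOrbits :
    ∀ (k : ℕ) (z : Fin k → ℂ) (n : Fin k → ℤ),
      (∀ i, ∃ w : ℂ, (w = ((-7 : ℂ) + (24 : ℂ) * Complex.I) ∨ w = ((-7 / 25 : ℂ) + (-24 / 25 : ℂ) * Complex.I) ∨
          w = ((-6 / 5 : ℂ) + (2 / 5 : ℂ) * Complex.I) ∨ w = ((-2 : ℂ) + (4 : ℂ) * Complex.I) ∨ w = ((-1 / 2 : ℂ) * Complex.I) ∨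
          w = ((1 / 2 : ℂ) + (-1 : ℂ) * Complex.I) ∨ w = ((-2 : ℂ) + (-1 : ℂ) * Complex.I) ∨ w = ((-1 : ℂ) * Complex.I) ∨
          w = ((1 / 2 : ℂ) + (-3 / 2 : ℂ) * Complex.I) ∨ w = ((-1 : ℂ) + (-1 : ℂ) * Complex.I) ∨ w = ((-1 : ℂ) + (-2 : ℂ) * Complex.I) ∨
          w = ((1 / 2 : ℂ) + (-7 / 2 : ℂ) * Complex.I) ∨ w = ((-3 : ℂ) + (4 : ℂ) * Complex.I) ∨ w = ((-3 / 5 : ℂ) + (-4 / 5 : ℂ) * Complex.I) ∨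
          w = ((1 / 2 : ℂ) + (-11 / 4 : ℂ) * Complex.I) ∨ w = (-1 : ℂ) ∨ w = (-4 : ℂ)) ∧
        (z i = w ∨ z i = w⁻¹ ∨ z i = 1 - w ∨ z i = (1 - w)⁻¹ ∨ z i = 1 - w⁻¹ ∨ z i = w / (w - 1) ∨
          z i = conj w ∨ z i = (conj w)⁻¹ ∨ z i = 1 - conj w ∨ z i = (1 - conj w)⁻¹ ∨ z i = 1 - (conj w)⁻¹ ∨
            z i = conj w / (conj w - 1))) →
      (∀ u v : Additive ℂˣ →+ ℚ, dehn u v (∑ i, n i • FreeAbelianGroup.of (z i)) = 0) →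
      ∑ i, (n i : ℝ) * blochWignerDilog (z i) = 0 →
        (∑ i, n i • FreeAbelianGroup.of (z i)) ∈ AddSubgroup.closure dilogRelators := by
  -- LANDED: Theorems/HyperbolicBlochZagierDilogarithmConjectureGaussSectorOrbits.lean (p145403) = Summit.KontsevichZagierPeriods.HyperbolicBloch.ZagierDilogarithmCertificate.stub_gaussExceptionalUnitOrbits; import deferred until the farm has built the module
  sorry

/-! ## Composition -/

/-- **Composition.** The stubs conclude the crux BY NAME: unfold to the Literature conjecture, pass to
the `D`-form (`iff_blochWignerDilog'`, proved), split on the Dehn invariant; on the Dehn-zero side the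
Galois descent (mod Dupont) consumes the propagation supplied by the open stub. -/
theorem ZagierDilogarithmConjecture_of : Theses.HyperbolicBloch.ZagierDilogarithmConjecture :=
  crux_iff.2 <| ZagierDilogarithmRelationsConjecture.iff_blochWignerDilog'.2 fun k z n halg him hsum => by
    by_cases hS : ∃ u v : Additive ℂˣ →+ ℚ, dehn u v (∑ i, n i • FreeAbelianGroup.of (z i)) ≠ 0
    · exact stub_symbolPart k z n halg him hS hsum
    · have hS' : ∀ u v : Additive ℂˣ →+ ℚ, dehn u v (∑ i, n i • FreeAbelianGroup.of (z i)) = 0 := by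
        intro u v
        by_contra h
        exact hS ⟨u, v, h⟩
      exact stub_galoisDescent stub_dupontFact k z n halg him hS'
        (stub_galoisPropagation k z n halg him hS' hsum)

/-! ## Proved consequences -/

/-- The crux implies Galois propagation (soundness of the open stub): an explained combination is
killed by every Galois-twisted odd regulator `[x] ↦ D(σx) − D(σx̄)` (`exists_galoisRegulator`,
`galoisRegulator_eq_zero_of_mem_closure`, gen 2). [folklore] -/
theorem galoisPropagation_of_crux (h : Theses.HyperbolicBloch.ZagierDilogarithmConjecture) :
    ∀ (k : ℕ) (z : Fin k → ℂ) (n : Fin k → ℤ), (∀ i, IsAlgebraic ℚ (z i)) → (∀ i, 0 < (z i).im) →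
      ∑ i, (n i : ℝ) * blochWignerDilog (z i) = 0 →
        ∀ (σ : ↥(algebraicClosure ℚ ℂ) →ₐ[ℚ] ℂ) (w w' : Fin k → ↥(algebraicClosure ℚ ℂ)),
          (∀ i, (w i : ℂ) = z i) → (∀ i, (w' i : ℂ) = conj (z i)) →
          ∑ i, (n i : ℝ) * (blochWignerDilog (σ (w i)) - blochWignerDilog (σ (w' i))) = 0 :=
  -- LANDED: Theorems/HyperbolicBlochZagierDilogarithmConjectureGaloisSlices.lean (p125568)
  Summit.KontsevichZagierPeriods.HyperbolicBloch.ZagierDilogarithmGaloisDescent.galoisPropagation_of_crux h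

/-- **Exactness of the reshape.** Given Dupont's theorem, the crux is EQUIVALENT to the conjunction of
the two open stubs `stub_symbolPart` and `stub_galoisPropagation`. [folklore] -/
theorem crux_iff_residual (hD : Dupont2001_preBloch_relation_of_invariants) :
    Theses.HyperbolicBloch.ZagierDilogarithmConjecture ↔
      ((∀ (k : ℕ) (z : Fin k → ℂ) (n : Fin k → ℤ), (∀ i, IsAlgebraic ℚ (z i)) → (∀ i, 0 < (z i).im) →
          (∃ u v : Additive ℂˣ →+ ℚ, dehn u v (∑ i, n i • FreeAbelianGroup.of (z i)) ≠ 0) →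
          ∑ i, (n i : ℝ) * blochWignerDilog (z i) = 0 →
            (∑ i, n i • FreeAbelianGroup.of (z i)) ∈ AddSubgroup.closure dilogRelators) ∧
        (∀ (k : ℕ) (z : Fin k → ℂ) (n : Fin k → ℤ), (∀ i, IsAlgebraic ℚ (z i)) → (∀ i, 0 < (z i).im) →
          (∀ u v : Additive ℂˣ →+ ℚ, dehn u v (∑ i, n i • FreeAbelianGroup.of (z i)) = 0) →
          ∑ i, (n i : ℝ) * blochWignerDilog (z i) = 0 →
            ∀ (σ : ↥(algebraicClosure ℚ ℂ) →ₐ[ℚ] ℂ) (w w' : Fin k → ↥(algebraicClosure ℚ ℂ)),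
              (∀ i, (w i : ℂ) = z i) → (∀ i, (w' i : ℂ) = conj (z i)) →
              ∑ i, (n i : ℝ) * (blochWignerDilog (σ (w i)) - blochWignerDilog (σ (w' i))) = 0)) :=
  -- LANDED: Theorems/HyperbolicBlochZagierDilogarithmConjectureGaloisSlices.lean (p125568)
  Summit.KontsevichZagierPeriods.HyperbolicBloch.ZagierDilogarithmGaloisDescent.crux_iff_residual hD

/-- `√m` (`m ∈ ℕ`) is algebraic over `ℚ`. [folklore] -/
theorem isAlgebraic_sqrt_nat (m : ℕ) : IsAlgebraic ℚ ((Real.sqrt m : ℝ) : ℂ) := by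
  refine ⟨Polynomial.X ^ 2 - Polynomial.C (m : ℚ), ?_, ?_⟩
  · exact Polynomial.X_pow_sub_C_ne_zero (by norm_num) _
  · have h : ((Real.sqrt m : ℝ) : ℂ) ^ 2 = (m : ℂ) := by
      rw [← Complex.ofReal_pow, Real.sq_sqrt (Nat.cast_nonneg m)]
      push_cast
      rfl
    simp [h]

/-- **The biquadratic slice (`r₂ = 2`), mod Dupont.** A Dehn-zero relation `Σ nᵢ D(zᵢ) = 0` among points of
`ℚ(√e, √−d) ∩ ℍ⁺` that is symmetric under `τ : √e ↦ −√e` is explained by the dilogarithm relators —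
composed from `stub_biquadraticSymmetric`, `stub_selfSimilar` and `stub_galoisDescent`. [folklore] -/
theorem biquadraticSlice (hD : Dupont2001_preBloch_relation_of_invariants) :
    ∀ (d e : ℕ) (k : ℕ) (z : Fin k → ℂ) (n : Fin k → ℤ) (a b c f : Fin k → ℚ) (π : Equiv.Perm (Fin k)),
      (∀ i, z i = a i + b i * (Real.sqrt e : ℂ) +
        (c i + f i * (Real.sqrt e : ℂ)) * ((Real.sqrt d : ℂ) * Complex.I)) →
      (∀ i, n (π i) = n i ∧ a (π i) = a i ∧ b (π i) = -b i ∧ c (π i) = c i ∧ f (π i) = -f i) →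
      (∀ i, 0 < (z i).im) →
      (∀ u v : Additive ℂˣ →+ ℚ, dehn u v (∑ i, n i • FreeAbelianGroup.of (z i)) = 0) →
      ∑ i, (n i : ℝ) * blochWignerDilog (z i) = 0 →
        (∑ i, n i • FreeAbelianGroup.of (z i)) ∈ AddSubgroup.closure dilogRelators :=
  -- LANDED: Theorems/HyperbolicBlochZagierDilogarithmConjectureGaloisSlices.lean (p125568)
  Summit.KontsevichZagierPeriods.HyperbolicBloch.ZagierDilogarithmGaloisDescent.biquadraticSlice hD

/-- **The cyclotomic-orbit slice, mod Dupont.** A Dehn-zero relation `Σ nᵢ D(zᵢ) = 0` among cyclotomic points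
`zᵢ = Σₘ qᵢₘ ζᵐ ∈ ℚ(ζ_N) ∩ ℍ⁺` that is orbit-symmetric in the sense of `stub_cyclotomicPoints` is explained by the
dilogarithm relators — composed from `stub_cyclotomicPoints`, `stub_signedPermutation`, `stub_selfSimilar` and
`stub_galoisDescent`. [folklore] -/
theorem cyclotomicSlice (hD : Dupont2001_preBloch_relation_of_invariants) :
    ∀ (N : ℕ), 0 < N → ∀ (k : ℕ) (z : Fin k → ℂ) (n : Fin k → ℤ) (q : Fin k → Fin N → ℚ),
      (∀ i, z i = ∑ m : Fin N, (q i m : ℂ) *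
        Complex.exp (2 * Real.pi * Complex.I / N) ^ (m : ℕ)) →
      (∀ j : ℕ, j.Coprime N →
        (∃ π : Equiv.Perm (Fin k), (∀ i, n (π i) = n i) ∧ ∀ i,
            (∑ m : Fin N, (q i m : ℂ) * Complex.exp (2 * Real.pi * Complex.I / N) ^ (j * (m : ℕ))) =
              z (π i)) ∨
        (∃ π : Equiv.Perm (Fin k), (∀ i, n (π i) = n i) ∧ ∀ i,
            (∑ m : Fin N, (q i m : ℂ) * Complex.exp (2 * Real.pi * Complex.I / N) ^ (j * (m : ℕ))) =
              conj (z (π i)))) →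
      (∀ i, 0 < (z i).im) →
      (∀ u v : Additive ℂˣ →+ ℚ, dehn u v (∑ i, n i • FreeAbelianGroup.of (z i)) = 0) →
      ∑ i, (n i : ℝ) * blochWignerDilog (z i) = 0 →
        (∑ i, n i • FreeAbelianGroup.of (z i)) ∈ AddSubgroup.closure dilogRelators :=
  -- LANDED: Theorems/HyperbolicBlochZagierDilogarithmConjectureGaloisSlices.lean (p125568)
  Summit.KontsevichZagierPeriods.HyperbolicBloch.ZagierDilogarithmGaloisDescent.cyclotomicSlice hD

/-- **The Borel slice re-derived** (c1's `stub_borelSlice`, p100860) as an instance of the c2 engine: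
`stub_galoisDescent ∘ stub_selfSimilar ∘ stub_signedPermutation ∘ stub_onePlaceSigned`. [folklore] -/
theorem borelSlice_of_galoisDescent (hD : Dupont2001_preBloch_relation_of_invariants) :
    ∀ (k : ℕ) (z : Fin k → ℂ) (n : Fin k → ℤ), (∀ i, IsAlgebraic ℚ (z i)) → (∀ i, 0 < (z i).im) →
      (∀ u v : Additive ℂˣ →+ ℚ, dehn u v (∑ i, n i • FreeAbelianGroup.of (z i)) = 0) →
      (∃ K : IntermediateField ℚ ℂ, FiniteDimensional ℚ K ∧ (∀ i, z i ∈ K) ∧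
          ∀ σ : K →+* ℂ, (∀ x : K, σ x = (x : ℂ)) ∨ (∀ x : K, σ x = (starRingEnd ℂ) (x : ℂ)) ∨
            (∀ x : K, (σ x).im = 0)) →
      ∑ i, (n i : ℝ) * blochWignerDilog (z i) = 0 →
        (∑ i, n i • FreeAbelianGroup.of (z i)) ∈ AddSubgroup.closure dilogRelators :=
  -- LANDED: Theorems/HyperbolicBlochZagierDilogarithmConjectureGaloisSlices.lean (p125568)
  Summit.KontsevichZagierPeriods.HyperbolicBloch.ZagierDilogarithmGaloisDescent.borelSlice_of_galoisDescent hD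

/-- **Stub (CLOSED p125568 with the slices file): the signed cyclotomic slice, mod Dupont** —
`ℍ⁺`-normalised orbit-symmetric relations over `ℚ(ζ_N)` with zero Dehn invariant are explained:
`stub_cyclotomicSigned ∘ stub_monomialSymmetric ∘ stub_selfSimilar ∘ stub_galoisDescent`. Registered so that
the compositions (this one, `biquadraticSlice`, `biquadraticSignedSlice`, `cyclotomicSlice`,
`borelSlice_of_galoisDescent`, `crux_iff_residual`) land as an importable Theorems file. -/
theorem stub_cyclotomicSignedSlice :
    Dupont2001_preBloch_relation_of_invariants →
    ∀ (N : ℕ), 0 < N → ∀ (k : ℕ) (z : Fin k → ℂ) (n : Fin k → ℤ) (q : Fin k → Fin N → ℚ),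
      (∀ i, z i = ∑ m : Fin N, (q i m : ℂ) *
        Complex.exp (2 * Real.pi * Complex.I / N) ^ (m : ℕ)) →
      (∀ j : ℕ, j.Coprime N → ∃ (e : ℤ) (π : Equiv.Perm (Fin k)), ∀ i,
          ((∑ m : Fin N, (q i m : ℂ) * Complex.exp (2 * Real.pi * Complex.I / N) ^ (j * (m : ℕ))) =
              z (π i) ∧ n i = e * n (π i)) ∨
          ((∑ m : Fin N, (q i m : ℂ) * Complex.exp (2 * Real.pi * Complex.I / N) ^ (j * (m : ℕ))) =
              conj (z (π i)) ∧ n i = -(e * n (π i)))) →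
      (∀ i, 0 < (z i).im) →
      (∀ u v : Additive ℂˣ →+ ℚ, dehn u v (∑ i, n i • FreeAbelianGroup.of (z i)) = 0) →
      ∑ i, (n i : ℝ) * blochWignerDilog (z i) = 0 →
        (∑ i, n i • FreeAbelianGroup.of (z i)) ∈ AddSubgroup.closure dilogRelators :=
  -- CLOSED: Theorems/HyperbolicBlochZagierDilogarithmConjectureGaloisSlices.lean (p125568, lead c2)
  Summit.KontsevichZagierPeriods.HyperbolicBloch.ZagierDilogarithmGaloisDescent.stub_cyclotomicSignedSlice

theorem biquadraticSignedSlice (hD : Dupont2001_preBloch_relation_of_invariants) :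
    ∀ (d e : ℕ) (k : ℕ) (z : Fin k → ℂ) (n : Fin k → ℤ) (a b c f : Fin k → ℚ),
      (∀ i, z i = a i + b i * (Real.sqrt e : ℂ) +
        (c i + f i * (Real.sqrt e : ℂ)) * ((Real.sqrt d : ℂ) * Complex.I)) →
      (∃ (E : ℤ) (π : Equiv.Perm (Fin k)), ∀ i,
          ((a i : ℂ) - b i * (Real.sqrt e : ℂ) +
              (c i - f i * (Real.sqrt e : ℂ)) * ((Real.sqrt d : ℂ) * Complex.I) = z (π i) ∧
            n i = E * n (π i)) ∨
          ((a i : ℂ) - b i * (Real.sqrt e : ℂ) +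
              (c i - f i * (Real.sqrt e : ℂ)) * ((Real.sqrt d : ℂ) * Complex.I) = conj (z (π i)) ∧
            n i = -(E * n (π i)))) →
      (∀ i, 0 < (z i).im) →
      (∀ u v : Additive ℂˣ →+ ℚ, dehn u v (∑ i, n i • FreeAbelianGroup.of (z i)) = 0) →
      ∑ i, (n i : ℝ) * blochWignerDilog (z i) = 0 →
        (∑ i, n i • FreeAbelianGroup.of (z i)) ∈ AddSubgroup.closure dilogRelators :=
  -- LANDED: Theorems/HyperbolicBlochZagierDilogarithmConjectureGaloisSlices.lean (p125568)
  Summit.KontsevichZagierPeriods.HyperbolicBloch.ZagierDilogarithmGaloisDescent.biquadraticSignedSlice hD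

/-! ## By-products of the line (earlier leads; all CLOSED, kept for the record) -/

/-- `stub_twoSaturation` (CLOSED, p83900): 2-saturation of the relator group. -/
theorem stub_twoSaturation :
    ∀ x : FreeAbelianGroup ℂ, 2 • x ∈ AddSubgroup.closure dilogRelators →
      x ∈ AddSubgroup.closure dilogRelators :=
  Summit.KontsevichZagierPeriods.HyperbolicBloch.ZagierDilogarithm.stub_twoSaturation

/-- `stub_kummerDescent` (CLOSED, p83052): 2-saturation + Clausen form ⇒ Zagier's conjecture. -/
theorem stub_kummerDescent :
    (∀ x : FreeAbelianGroup ℂ, 2 • x ∈ AddSubgroup.closure dilogRelators →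
        x ∈ AddSubgroup.closure dilogRelators) →
    (∀ (k : ℕ) (u : Fin k → ℂ) (m : Fin k → ℤ), (∀ i, IsAlgebraic ℚ (u i)) →
        (∀ i, 0 < (u i).im) → (∀ i, ‖u i‖ = 1) →
        ∑ i, (m i : ℝ) * blochWignerDilog (u i) = 0 →
          (∑ i, m i • FreeAbelianGroup.of (u i)) ∈ AddSubgroup.closure dilogRelators) →
    ZagierDilogarithmRelationsConjecture :=
  Summit.KontsevichZagierPeriods.HyperbolicBloch.ZagierDilogarithm.stub_kummerDescent

/-- `stub_transferIff` (CLOSED, p86004): the crux is EQUIVALENT to its Clausen (unit-circle) form. -/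
theorem stub_transferIff :
    Summit.KontsevichZagierPeriods.KontsevichZagierPeriods.Theses.HyperbolicBloch.ZagierDilogarithmConjecture ↔
      ∀ (k : ℕ) (u : Fin k → ℂ) (m : Fin k → ℤ), (∀ i, IsAlgebraic ℚ (u i)) →
        (∀ i, 0 < (u i).im) → (∀ i, ‖u i‖ = 1) →
        ∑ i, (m i : ℝ) * blochWignerDilog (u i) = 0 →
          (∑ i, m i • FreeAbelianGroup.of (u i)) ∈ AddSubgroup.closure dilogRelators :=
  Summit.KontsevichZagierPeriods.HyperbolicBloch.ZagierDilogarithm.stub_transferIff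

/-- `stub_oneSigned` (CLOSED, p85358): the positivity sector — one-signed relations are trivial. -/
theorem stub_oneSigned :
    ∀ (T : ℂ → Set (Fin 3 → ℝ)), (∀ z, T z = {p | 0 < p 1 ∧ z.re * p 1 < z.im * p 0 ∧
      z.im * (p 0 - 1) < (z.re - 1) * p 1 ∧ 0 < p 2 ∧
      0 < z.im * (p 0 ^ 2 + p 1 ^ 2 + p 2 ^ 2 - p 0) + (z.re - Complex.normSq z) * p 1}) →
    ∀ (k : ℕ) (z : Fin k → ℂ) (n : Fin k → ℤ), (∀ i, 0 < (z i).im) →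
      ((∀ i, 0 ≤ n i) ∨ (∀ i, n i ≤ 0)) →
      ∑ i, (n i : ℝ) * (∫ p in T (z i), 1 / p 2 ^ 3) = 0 →
        (∑ i, n i • FreeAbelianGroup.of (z i)) ∈ AddSubgroup.closure dilogRelators :=
  Summit.KontsevichZagierPeriods.HyperbolicBloch.ZagierDilogarithm.stub_oneSigned

/-- `stub_nSaturation` (CLOSED; = `stub_saturation` p96486, alias p99040): `n`-saturation from Suslin. -/
theorem stub_nSaturation :
    Suslin1991_preBloch_isUniquelyDivisible →
      ∀ n : ℕ, 0 < n → ∀ x : FreeAbelianGroup ℂ, n • x ∈ AddSubgroup.closure dilogRelators →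
        x ∈ AddSubgroup.closure dilogRelators :=
  Summit.KontsevichZagierPeriods.HyperbolicBloch.ZagierDilogarithm.stub_saturation

/-- `stub_borelSlice` (CLOSED, p100860 — lead c1): Dehn zero + points in a one-complex-place number field ⇒
explained, mod Dupont. Now ALSO an instance of `stub_galoisDescent` (one complex place ⇒ propagation). -/
theorem stub_borelSlice :
    Dupont2001_preBloch_relation_of_invariants →
    ∀ (k : ℕ) (z : Fin k → ℂ) (n : Fin k → ℤ), (∀ i, IsAlgebraic ℚ (z i)) → (∀ i, 0 < (z i).im) →
      (∀ u v : Additive ℂˣ →+ ℚ, dehn u v (∑ i, n i • FreeAbelianGroup.of (z i)) = 0) →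
      (∃ K : IntermediateField ℚ ℂ, FiniteDimensional ℚ K ∧ (∀ i, z i ∈ K) ∧
          ∀ σ : K →+* ℂ, (∀ x : K, σ x = (x : ℂ)) ∨ (∀ x : K, σ x = (starRingEnd ℂ) (x : ℂ)) ∨
            (∀ x : K, (σ x).im = 0)) →
      ∑ i, (n i : ℝ) * blochWignerDilog (z i) = 0 →
        (∑ i, n i • FreeAbelianGroup.of (z i)) ∈ AddSubgroup.closure dilogRelators :=
  Summit.KontsevichZagierPeriods.HyperbolicBloch.ZagierDilogarithmBorelSlice.stub_borelSlice

/-- `stub_imagQuadraticSlice` (CLOSED, p120583 — lead c1): the slice with the field discharged, `zᵢ ∈ ℚ(√−d)`. -/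
theorem stub_imagQuadraticSlice :
    Dupont2001_preBloch_relation_of_invariants →
    ∀ (d : ℕ) (k : ℕ) (z : Fin k → ℂ) (n : Fin k → ℤ),
      (∀ i, ∃ a b : ℚ, z i = a + b * (Real.sqrt d * Complex.I)) → (∀ i, 0 < (z i).im) →
      (∀ u v : Additive ℂˣ →+ ℚ, dehn u v (∑ i, n i • FreeAbelianGroup.of (z i)) = 0) →
      ∑ i, (n i : ℝ) * blochWignerDilog (z i) = 0 →
        (∑ i, n i • FreeAbelianGroup.of (z i)) ∈ AddSubgroup.closure dilogRelators :=
  Summit.KontsevichZagierPeriods.HyperbolicBloch.ZagierDilogarithmBorelSlice.stub_imagQuadraticSlice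

/-- `stub_subSector` (CLOSED, p120575 — lead c1; route level): on the Borel slice the kernel form of
Conjecture 1 holds on the tetrahedral sub-sector, mod Dupont. -/
theorem stub_subSector :
    Dupont2001_preBloch_relation_of_invariants →
    ∀ (T : ℂ → Set (Fin 3 → ℝ)), (∀ z, T z = {p | 0 < p 1 ∧ z.re * p 1 < z.im * p 0 ∧
      z.im * (p 0 - 1) < (z.re - 1) * p 1 ∧ 0 < p 2 ∧
      0 < z.im * (p 0 ^ 2 + p 1 ^ 2 + p 2 ^ 2 - p 0) + (z.re - Complex.normSq z) * p 1}) →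
    ∀ (ρ : ℂ → KZ.IntegralRep 3), (∀ z, IsAlgebraic ℚ z → 0 < z.im →
      (ρ z).domain = T z ∧ Set.EqOn (ρ z).integrand (fun p => 1 / p 2 ^ 3) (T z)) →
    ∀ (k : ℕ) (z : Fin k → ℂ) (n : Fin k → ℤ), (∀ i, IsAlgebraic ℚ (z i)) → (∀ i, 0 < (z i).im) →
      (∀ u v : Additive ℂˣ →+ ℚ, dehn u v (∑ i, n i • FreeAbelianGroup.of (z i)) = 0) →
      (∃ K : IntermediateField ℚ ℂ, FiniteDimensional ℚ K ∧ (∀ i, z i ∈ K) ∧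
          ∀ σ : K →+* ℂ, (∀ x : K, σ x = (x : ℂ)) ∨ (∀ x : K, σ x = (starRingEnd ℂ) (x : ℂ)) ∨
            (∀ x : K, (σ x).im = 0)) →
      ∑ i, (n i : ℝ) * (ρ (z i)).value = 0 →
        (∑ i, n i • KZ.of (ρ (z i))) ∈ KZ.relations :=
  Summit.KontsevichZagierPeriods.HyperbolicBloch.ZagierDilogarithmBorelSlice.stub_subSector

/-- `stub_numberFieldDescent` (CLOSED, p97613 — lead -1, gen 2): the same descent with the Borel–Suslin fact in
Neumann's torsion form (`∃ N > 0, N•β ∈ ⟨dilogRelators⟩`). -/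
theorem stub_numberFieldDescent :
    Borel1977_blochGroup_regulator_kernel_torsion →
      ∀ (k : ℕ) (u : Fin k → ℂ) (m : Fin k → ℤ), (∀ i, IsAlgebraic ℚ (u i)) →
        (∀ i, 0 < (u i).im) →
        (∀ φ ψ : Additive ℂˣ →+ ℚ, dehn φ ψ (∑ i, m i • FreeAbelianGroup.of (u i)) = 0) →
        (∀ (σ : ↥(algebraicClosure ℚ ℂ) →ₐ[ℚ] ℂ) (w w' : Fin k → ↥(algebraicClosure ℚ ℂ)),
          (∀ i, (w i : ℂ) = u i) → (∀ i, (w' i : ℂ) = conj (u i)) →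
          ∑ i, (m i : ℝ) * (blochWignerDilog (σ (w i)) - blochWignerDilog (σ (w' i))) = 0) →
        ∃ n : ℕ, 0 < n ∧ n • (∑ i, m i • FreeAbelianGroup.of (u i)) ∈
          AddSubgroup.closure dilogRelators :=
  Summit.KontsevichZagierPeriods.HyperbolicBloch.ZagierDilogarithm.stub_numberFieldDescent

end Summit.KontsevichZagierPeriods.KontsevichZagierPeriods.Cruxes.ZagierDilogarithmConjecture.KummerClausen

end
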